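import Mathlib.RingTheory.SimpleRing.Principal
import Literature.NumberTheory.EllipticCurves.Greenberg1999.SplitMultiplicativeLocalTowerKernelPTorsionProofs
import Literature.NumberTheory.EllipticCurves.LocalTorsionMultiplicativeProofs
import Literature.NumberTheory.EllipticCurves.KernelReductionInertiaProofs
import Literature.NumberTheory.EllipticCurves.OrdinaryLocalReductionMapProofs
import Literature.NumberTheory.EllipticCurves.TateCurve.NumberFieldUniformizationTwistedTateJ
import Literature.NumberTheory.GaloisRepresentations.LocalNormIndex
import Literature.NumberTheory.EllipticCurves.Greenberg1999.LocalCyclotomicTowerLayerProofs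
import Literature.NumberTheory.EllipticCurves.RibetGoodLatticeExistsProofs
import HarnessLib

/-!
# Greenberg 1999 §3 at a prime of NON-SPLIT multiplicative reduction: the local cyclotomic-tower kernel is trivial for odd `p` and of order `≤ 4` for `p = 2` — `sec3_localTowerKerPrimary_eq_bot_nonsplitMultiplicative_odd_rat` and `sec3_natCard_localTowerKerPrimary_le_four_nonsplitMultiplicative_two` HOLD (re-homed proofs)

**Greenberg 1999 §3 (the local kernel of the cyclotomic tower at a prime of multiplicative reduction) in the NON-SPLIT multiplicative case — the named facts
`Literature.NumberTheory.EllipticCurves.Greenberg1999.sec3_localTowerKerPrimary_eq_bot_nonsplitMultiplicative_odd_rat` (odd `p`: the `p`-primary local tower kernel at a prime of non-split multiplicative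
reduction of `E/ℚ` is trivial) and `…sec3_natCard_localTowerKerPrimary_le_four_nonsplitMultiplicative_two` (`p = 2`: it has order `≤ 4`) of `ControlLocalKernelAtPMultiplicative.lean`
HOLD — EXACT names `…_holds`** ([GreenbergLNM1716] R. Greenberg, *Iwasawa theory for elliptic curves*, LNM 1716 (1999), §3; the twisted Tate-curve algebra of the
unramified quadratic twist, Galois descent along the cyclotomic tower, the Frobenius sign of the Tate parameter [SilvermanATAEC1994] V §5).  Contents: the local layer fields and indices of
the cyclotomic tower at `v ∣ p`, the twisted Tate algebra and Tate transport, units of coinvariants, the odd-`p` tower algebra, the Frobenius sign at a non-split prime (minimal model,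
`c₄`, `c₆`, `γ = -c₆/c₄`), multiplicative transport at `2`, the coboundary computations and the order count at `p = 2` (quadratic norm index), and the two discharges.
RE-HOMED into `Literature/` by the Hodge foundations lane (`lit-hodgefound`, seat p20, generation 40): verbatim DECLARATION-LEVEL ports (the 62 declarations needed, in
dependency order; each Part is a slice of one Summits module) of 22 theorem modules `Summits/BirchSwinnertonDyer/BirchSwinnertonDyer/Theorems/ByReductionTypeAtTwoMult*.lean`,
`…/Rank1Residual/IntModelReduction.lean` and `Summits/BirchSwinnertonDyer/Rank1Residual/{X2,Additive}/…`; namespaces `Summit.BirchSwinnertonDyer.BirchSwinnertonDyer.Theorems.{MultTowerNS2,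
MultTowerNSOdd,MultTowerSP1,MultTransportAtTwo}` ↦ `Literature.NumberTheory.EllipticCurves.Greenberg1999.{…}` (joining the tree's `LocalCyclotomicTowerLayerProofs` /
`SplitMultiplicativeLocalTowerKernelPTorsionProofs`, whose 21 identical lemmas are used, not re-declared), `…Rank1Residual.X2.*` ↦ `Literature.NumberTheory.EllipticCurves.Greenberg1999.*`,
`…Rank1Residual.IntModel` ↦ `Literature.NumberTheory.EllipticCurves.Rank1Residual.IntModel`; the two `_holds` theorems carry the EXACT names.  Theorem-only file: no definition, no new
named fact (D-0026); imports Mathlib/Literature only; every declaration carries the citation of the printed statement it formalises or serves.  The Summits originals stay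
in place (transitional duplication).  WHAT THIS IS NOT: nothing here bears on BSD; it is Greenberg's local computation for Tate curves.
-/

noncomputable section

/-!
## Part 1 — port of `Summits/BirchSwinnertonDyer/BirchSwinnertonDyer/Theorems/ByReductionTypeAtTwoMultTowerNS2LocalLayerIndex.lean` (1 declarations kept)

# Kernel brick 8 — the local layers of the cyclotomic `ℤ_p`-tower at `v ∣ p` have index exactly `p^n` in `Γ_{ℚ_v}` (total ramification), consecutive relative index `p

Declarations of this Part (verbatim port; each keeps its own docstring and citation): `localSubgroup_layerSubgroup_succ_le`.

Reference keys (see `references.bib` and the declarations' citations): [GreenbergLNM1716].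
-/

section Part1

set_option autoImplicit false
namespace Literature.NumberTheory.EllipticCurves.Greenberg1999.MultTowerNS2

open _root_.NumberField _root_.IsDedekindDomain _root_.Field Literature.NumberTheory.EllipticCurves
  Literature.NumberTheory.GaloisRepresentations

variable {p : ℕ} [Fact p.Prime] {κ : ZpExtension ℚ p}

/-- `H_{n+1} ≤ H_n` for the local layer subgroups. [cite: GreenbergLNM1716, §3 (supporting lemma)] -/
theorem localSubgroup_layerSubgroup_succ_le (v : HeightOneSpectrum (𝓞 ℚ)) (n : ℕ) :
    localSubgroup (κ.layerSubgroup (n + 1)) (v.adicCompletion ℚ) ≤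
      localSubgroup (κ.layerSubgroup n) (v.adicCompletion ℚ) :=
  Subgroup.comap_mono (κ.layerSubgroup_antitone (Nat.le_succ n))

end Literature.NumberTheory.EllipticCurves.Greenberg1999.MultTowerNS2

end Part1

/-!
## Part 2 — port of `Summits/BirchSwinnertonDyer/BirchSwinnertonDyer/Theorems/ByReductionTypeAtTwoMultTowerNS2LocalLayerField.lean` (1 declarations kept)

# Kernel brick 9 — the local layer fields `(ℚ_n)_w = K̄_v^{H_n}` of the cyclotomic `ℤ_p`-tower at `v ∣ p` are finite of degree `p^n` over `ℚ_v`, nested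

Declarations of this Part (verbatim port; each keeps its own docstring and citation): `isOpen_localSubgroup`.

Reference keys (see `references.bib` and the declarations' citations): [GreenbergLNM1716].
-/

section Part2

set_option autoImplicit false
namespace Literature.NumberTheory.EllipticCurves.Greenberg1999.MultTowerNS2

open _root_.NumberField _root_.IsDedekindDomain _root_.Field Literature.NumberTheory.EllipticCurves
  Literature.NumberTheory.GaloisRepresentations

universe u

/-- `localSubgroup H E = res⁻¹(H)` is open in `Γ_E` when `H` is open in `Γ_K` (the restriction `resGal E` is
continuous). [cite: GreenbergLNM1716, §3 (supporting lemma)] -/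
theorem isOpen_localSubgroup {K : Type u} [Field K] (H : Subgroup (absoluteGaloisGroup K))
    (hH : IsOpen (H : Set (absoluteGaloisGroup K))) (E : Type u) [Field E] [Algebra K E] :
    IsOpen (localSubgroup H E : Set (absoluteGaloisGroup E)) :=
  hH.preimage (resGal (K := K) E).continuous_toFun

variable {p : ℕ} [Fact p.Prime] {κ : ZpExtension ℚ p}

end Literature.NumberTheory.EllipticCurves.Greenberg1999.MultTowerNS2

end Part2

/-!
## Part 3 — port of `Summits/BirchSwinnertonDyer/BirchSwinnertonDyer/Theorems/ByReductionTypeAtTwoMultTowerNS2TwistedTateAlgebra.lean` (10 declarations kept)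

# Kernel brick 16a — algebra of the twisted Tate module over the local cyclotomic `ℤ₂`-tower: flips, `Γ`-stability of the fixed fields `K̄^{H ∩ Stab(t)}`, orbit produ

Declarations of this Part (verbatim port; each keeps its own docstring and citation): `inv_smul_eq_smul_of_smul_eq_or`, `conj_smul_eq_of_smul_eq`, `smul_mem_of_forall_mem_smul_eq`, `flip_smul_eq`, `flip_smul_smul_comm`, `flip_smul_flip_smul`, `prod_smul_inv`, `prod_smul_smul_eq`, `pow_smul_prod_smul_eq`, `prod_smul_range_two_mul`.

Reference keys (see `references.bib` and the declarations' citations): [GreenbergLNM1716].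
-/

section Part3

set_option autoImplicit false
open scoped _root_.Classical _root_.IntermediateField

namespace Literature.NumberTheory.EllipticCurves.Greenberg1999.MultTowerNS2

open _root_.NumberField _root_.IsDedekindDomain _root_.Field _root_.PadicInt Literature.NumberTheory.EllipticCurves
  Literature.NumberTheory.GaloisRepresentations

variable {K : Type*} [Field K]

/-- If `σ t = ±t` then `σ⁻¹ t = σ t` (both signs square to `1`). [cite: GreenbergLNM1716, §3 (supporting lemma)] -/
theorem inv_smul_eq_smul_of_smul_eq_or {t : AlgebraicClosure K} {σ : absoluteGaloisGroup K}
    (h : σ • t = t ∨ σ • t = -t) : σ⁻¹ • t = σ • t := by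
  rcases h with h | h
  · rw [h]; nth_rw 1 [← h]; rw [inv_smul_smul]
  · rw [h]
    have h' : σ⁻¹ • (σ • t) = t := inv_smul_smul σ t
    rw [h, smul_neg, neg_eq_iff_eq_neg] at h'
    exact h'

/-- A conjugate `σ⁻¹ h σ` of an element `h` fixing `t` fixes `t` (when every element maps `t` to `±t`). [cite: GreenbergLNM1716, §3 (supporting lemma)] -/
theorem conj_smul_eq_of_smul_eq {t : AlgebraicClosure K} (ht : ∀ σ : absoluteGaloisGroup K, σ • t = t ∨ σ • t = -t)
    {h : absoluteGaloisGroup K} (hh : h • t = t) (σ : absoluteGaloisGroup K) : (σ⁻¹ * h * σ) • t = t := by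
  rw [mul_smul, mul_smul]
  rcases ht σ with hs | hs
  · rw [hs, hh, inv_smul_eq_smul_of_smul_eq_or (ht σ), hs]
  · rw [hs, smul_neg, hh, smul_neg, inv_smul_eq_smul_of_smul_eq_or (ht σ), hs, neg_neg]

/-- **`K̄^{N ∩ Stab(t)}` is `Γ`-stable** for `N ⊴ Γ` and `σ t = ±t` for all `σ`: if `x` is fixed by every element of
`N` fixing `t`, so is `σ x`. [cite: GreenbergLNM1716, §3 (supporting lemma)] -/
theorem smul_mem_of_forall_mem_smul_eq {t : AlgebraicClosure K}
    (ht : ∀ σ : absoluteGaloisGroup K, σ • t = t ∨ σ • t = -t) (N : Subgroup (absoluteGaloisGroup K)) [N.Normal]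
    {x : AlgebraicClosure K} (hx : ∀ h ∈ N, h • t = t → h • x = x) (σ : absoluteGaloisGroup K) :
    ∀ h ∈ N, h • t = t → h • (σ • x) = σ • x := by
  intro h hh hht
  have hc : σ⁻¹ * h * σ ∈ N := by
    have := Subgroup.Normal.conj_mem inferInstance h hh σ⁻¹
    rwa [inv_inv] at this
  have h1 := hx _ hc (conj_smul_eq_of_smul_eq ht hht σ)
  rw [mul_smul, mul_smul, inv_smul_eq_iff] at h1
  exact h1

/-- **Two flips of `N` agree on `K̄^{N ∩ Stab(t)}`**: if `τ₀, τ ∈ N` both send `t ↦ −t` and `x` is fixed by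
`N ∩ Stab(t)`, then `τ x = τ₀ x`. [cite: GreenbergLNM1716, §3 (supporting lemma)] -/
theorem flip_smul_eq {t : AlgebraicClosure K} {N : Subgroup (absoluteGaloisGroup K)} {τ₀ τ : absoluteGaloisGroup K}
    (hτ₀ : τ₀ ∈ N) (hτ₀t : τ₀ • t = -t) (hτ : τ ∈ N) (hτt : τ • t = -t) {x : AlgebraicClosure K}
    (hx : ∀ h ∈ N, h • t = t → h • x = x) : τ • x = τ₀ • x := by
  have h1 : (τ₀⁻¹ * τ) • t = t := by
    rw [mul_smul, hτt, smul_neg, inv_smul_eq_smul_of_smul_eq_or (Or.inr hτ₀t), hτ₀t, neg_neg]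
  have h2 := hx _ (N.mul_mem (N.inv_mem hτ₀) hτ) h1
  rw [mul_smul, inv_smul_eq_iff] at h2
  exact h2

/-- **`τ₀ (σ x) = σ (τ₀ x)`** for `σ` fixing `t`, a flip `τ₀ ∈ N ⊴ Γ` and `x ∈ K̄^{N ∩ Stab(t)}` (the conjugate
`σ⁻¹ τ₀ σ` is again a flip of `N`). [cite: GreenbergLNM1716, §3 (supporting lemma)] -/
theorem flip_smul_smul_comm {t : AlgebraicClosure K} (ht : ∀ σ : absoluteGaloisGroup K, σ • t = t ∨ σ • t = -t)
    {N : Subgroup (absoluteGaloisGroup K)} [N.Normal] {τ₀ : absoluteGaloisGroup K} (hτ₀ : τ₀ ∈ N) (hτ₀t : τ₀ • t = -t)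
    {σ : absoluteGaloisGroup K} (hσ : σ • t = t) {x : AlgebraicClosure K} (hx : ∀ h ∈ N, h • t = t → h • x = x) :
    τ₀ • (σ • x) = σ • (τ₀ • x) := by
  have hc : σ⁻¹ * τ₀ * σ ∈ N := by
    have := Subgroup.Normal.conj_mem inferInstance τ₀ hτ₀ σ⁻¹
    rwa [inv_inv] at this
  have hct : (σ⁻¹ * τ₀ * σ) • t = -t := by
    rw [mul_smul, mul_smul, hσ, hτ₀t, smul_neg, inv_smul_eq_smul_of_smul_eq_or (ht σ), hσ]
  have h := flip_smul_eq hτ₀ hτ₀t hc hct hx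
  rw [mul_smul, mul_smul, inv_smul_eq_iff] at h
  exact h

/-- `τ₀² x = x` for a flip `τ₀ ∈ N` and `x ∈ K̄^{N ∩ Stab(t)}`. [cite: GreenbergLNM1716, §3 (supporting lemma)] -/
theorem flip_smul_flip_smul {t : AlgebraicClosure K} {N : Subgroup (absoluteGaloisGroup K)} {τ₀ : absoluteGaloisGroup K}
    (hτ₀ : τ₀ ∈ N) (hτ₀t : τ₀ • t = -t) {x : AlgebraicClosure K} (hx : ∀ h ∈ N, h • t = t → h • x = x) :
    τ₀ • (τ₀ • x) = x := by
  rw [← mul_smul]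
  exact hx _ (N.mul_mem hτ₀ hτ₀) (by rw [mul_smul, hτ₀t, smul_neg, hτ₀t, neg_neg])

/-- `N(w⁻¹) = N(w)⁻¹`. [cite: GreenbergLNM1716, §3 (supporting lemma)] -/
theorem prod_smul_inv (g : absoluteGaloisGroup K) (m : ℕ) (w : AlgebraicClosure K) :
    (∏ i ∈ Finset.range m, (g ^ i) • w⁻¹) = (∏ i ∈ Finset.range m, (g ^ i) • w)⁻¹ := by
  rw [← Finset.prod_inv_distrib]
  exact Finset.prod_congr rfl fun i _ ↦ smul_inv'' _ _

/-- `N_m(g w) = N_m(w)` when `g^m w = w`. [cite: GreenbergLNM1716, §3 (supporting lemma)] -/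
theorem prod_smul_smul_eq (g : absoluteGaloisGroup K) (m : ℕ) {w : AlgebraicClosure K} (hw : (g ^ m) • w = w) :
    (∏ i ∈ Finset.range m, (g ^ i) • (g • w)) = ∏ i ∈ Finset.range m, (g ^ i) • w := by
  have h : ∀ i, (g ^ i) • (g • w) = (g ^ (i + 1)) • w := fun i ↦ by rw [← mul_smul, ← pow_succ]
  simp_rw [h]
  by_cases hw0 : w = 0
  · simp [hw0]
  -- `(∏_{i<m} g^{i+1} w) · g^0 w = ∏_{i<m+1} g^i w = (∏_{i<m} g^i w) · g^m w`
  have h1 := Finset.prod_range_succ' (fun i ↦ (g ^ i) • w) m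
  rw [Finset.prod_range_succ, hw, pow_zero, one_smul] at h1
  exact mul_right_cancel₀ hw0 h1.symm

/-- `g^m N_m(w) = N_m(w)` when `g^m w = w`. [cite: GreenbergLNM1716, §3 (supporting lemma)] -/
theorem pow_smul_prod_smul_eq (g : absoluteGaloisGroup K) (m : ℕ) {w : AlgebraicClosure K} (hw : (g ^ m) • w = w) :
    (g ^ m) • (∏ i ∈ Finset.range m, (g ^ i) • w) = ∏ i ∈ Finset.range m, (g ^ i) • w := by
  rw [Finset.smul_prod']
  refine Finset.prod_congr rfl fun i _ ↦ ?_
  rw [← mul_smul, ← pow_add, add_comm, pow_add, mul_smul, hw]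

/-- `N_{2m}(w) = N_m(w) · g^m N_m(w)` (splitting the range `[0, 2m)`). [cite: GreenbergLNM1716, §3 (supporting lemma)] -/
theorem prod_smul_range_two_mul (g : absoluteGaloisGroup K) (m : ℕ) (w : AlgebraicClosure K) :
    (∏ i ∈ Finset.range (2 * m), (g ^ i) • w) =
      (∏ i ∈ Finset.range m, (g ^ i) • w) * (g ^ m) • ∏ i ∈ Finset.range m, (g ^ i) • w := by
  rw [two_mul, Finset.prod_range_add, Finset.smul_prod']
  congr 1
  exact Finset.prod_congr rfl fun i _ ↦ by rw [pow_add, mul_smul]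

variable {κ : ZpExtension ℚ 2}

end Literature.NumberTheory.EllipticCurves.Greenberg1999.MultTowerNS2

end Part3

/-!
## Part 4 — port of `Summits/BirchSwinnertonDyer/BirchSwinnertonDyer/Theorems/ByReductionTypeAtTwoMultTowerNS2TateTransport.lean` (1 declarations kept)

# Kernel brick 18 — transport along Tate's twisted uniformisation: `M_∞ = E(K̄_v)^{H_∞} = Ψ(T)`, `T = {x ∈ (K̄_v^{H_∞ ∩ Stab t})ˣ : τ₀x·x ∈ q^ℤ}`

Declarations of this Part (verbatim port; each keeps its own docstring and citation): `smul_eq_self_of_smul_eq_zpow_mul`.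

Reference keys (see `references.bib` and the declarations' citations): [GreenbergLNM1716].
-/

section Part4

set_option autoImplicit false
open scoped _root_.Classical

namespace Literature.NumberTheory.EllipticCurves.Greenberg1999.MultTowerNS2

open _root_.NumberField _root_.IsDedekindDomain _root_.Field Literature.NumberTheory.EllipticCurves
  Literature.NumberTheory.GaloisRepresentations

variable {κ : ZpExtension ℚ 2}

/-- **If `h x = Q^j x` with `h Q = Q` and `Q` of infinite order, then `h x = x`.** The `h`-orbit of the algebraic
element `x` lies in the root set of its minimal polynomial, so `h^d x = x` for some `d ≥ 1`, while
`h^d x = Q^{jd} x`; hence `Q^{jd} = 1`, `j = 0`. [cite: GreenbergLNM1716, §3 (supporting lemma)] -/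
theorem smul_eq_self_of_smul_eq_zpow_mul (v : HeightOneSpectrum (𝓞 ℚ))
    {h : absoluteGaloisGroup (v.adicCompletion ℚ)} {Q x : AlgebraicClosure (v.adicCompletion ℚ)}
    (hQfix : h • Q = Q) (hQ0 : Q ≠ 0) (hQtor : ∀ j : ℤ, Q ^ j = 1 → j = 0) (hx0 : x ≠ 0) {j : ℤ}
    (hj : h • x = Q ^ j * x) : h • x = x := by
  -- `h^m x = Q^{jm} x`
  have hpow : ∀ m : ℕ, (h ^ m) • x = Q ^ (j * m) * x := fun m ↦ by
    induction m with
    | zero => simp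
    | succ m ih =>
      rw [pow_succ', mul_smul, ih, smul_mul', smul_zpow₀', hQfix, hj, ← mul_assoc, ← zpow_add₀ hQ0]
      push_cast
      ring_nf
  -- the orbit lies in the (finite) root set of the minimal polynomial
  have hint : IsIntegral (v.adicCompletion ℚ) x := Algebra.IsIntegral.isIntegral x
  have hmem : ∀ m : ℕ, (h ^ m) • x ∈ (minpoly (v.adicCompletion ℚ) x).rootSet (AlgebraicClosure (v.adicCompletion ℚ)) :=
    fun m ↦ by
      rw [Polynomial.mem_rootSet]
      refine ⟨minpoly.ne_zero hint, ?_⟩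
      have e1 := Polynomial.aeval_algHom_apply
        ((absoluteGaloisGroup.toAlgEquiv (v.adicCompletion ℚ) (h ^ m) :
          AlgebraicClosure (v.adicCompletion ℚ) ≃ₐ[v.adicCompletion ℚ] AlgebraicClosure (v.adicCompletion ℚ)) :
          AlgebraicClosure (v.adicCompletion ℚ) →ₐ[v.adicCompletion ℚ] AlgebraicClosure (v.adicCompletion ℚ))
        x (minpoly (v.adicCompletion ℚ) x)
      rw [minpoly.aeval, map_zero] at e1
      exact e1
  let f : ℕ → (minpoly (v.adicCompletion ℚ) x).rootSet (AlgebraicClosure (v.adicCompletion ℚ)) :=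
    fun m ↦ ⟨(h ^ m) • x, hmem m⟩
  obtain ⟨m₁, m₂, hne, heq⟩ := Finite.exists_ne_map_eq_of_infinite f
  have heq' : (h ^ m₁) • x = (h ^ m₂) • x := congrArg Subtype.val heq
  -- `h^d x = x` with `d ≥ 1` forces `j = 0`
  have key : ∀ {a b : ℕ}, a < b → (h ^ a) • x = (h ^ b) • x → h • x = x := by
    intro a b hab hab'
    obtain ⟨d, rfl⟩ := Nat.exists_eq_add_of_lt hab
    rw [show a + d + 1 = a + (d + 1) by ring, pow_add, mul_smul] at hab'
    have h1 : x = (h ^ (d + 1)) • x := smul_left_cancel _ hab'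
    rw [hpow] at h1
    have h2 : Q ^ (j * (d + 1 : ℕ)) = 1 := by
      have h3 : Q ^ (j * (d + 1 : ℕ)) * x = 1 * x := by rw [one_mul]; exact h1.symm
      exact mul_right_cancel₀ hx0 h3
    have h4 := hQtor _ h2
    have hj0 : j = 0 := by
      rcases mul_eq_zero.mp h4 with h5 | h5
      · exact h5
      · exfalso; push_cast at h5; omega
    rw [hj, hj0, zpow_zero, one_mul]
  rcases lt_or_gt_of_ne hne with hlt | hlt
  · exact key hlt heq'
  · exact key hlt heq'.symm

end Literature.NumberTheory.EllipticCurves.Greenberg1999.MultTowerNS2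

end Part4

/-!
## Part 5 — port of `Summits/BirchSwinnertonDyer/BirchSwinnertonDyer/Theorems/ByReductionTypeAtTwoMultTowerNS2CoinvariantsUnit.lean` (4 declarations kept)

# Kernel brick 16b — `2`-torsion coinvariant classes of the twisted Tate module: the unit classes come from Hilbert 90 with an `F_n`-rational norm invariant

Declarations of this Part (verbatim port; each keeps its own docstring and citation): `localSubgroup_layerSubgroup_le_of_le`, `isClosed_stabilizer`, `exists_forall_mem_localSubgroup_layerSubgroup_add_smul_eq₂`, `flip_smul_coboundary_mul_coboundary`.

Reference keys (see `references.bib` and the declarations' citations): [NeukirchANT1999].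
-/

section Part5

set_option autoImplicit false
open scoped _root_.Classical _root_.IntermediateField

namespace Literature.NumberTheory.EllipticCurves.Greenberg1999.MultTowerNS2

open _root_.NumberField _root_.IsDedekindDomain _root_.Field _root_.PadicInt Literature.NumberTheory.EllipticCurves
  Literature.NumberTheory.GaloisRepresentations

variable {κ : ZpExtension ℚ 2}

/-- `H_{m'} ≤ H_m` for `m ≤ m'`. [cite: NeukirchANT1999, Ch. IV §1] -/
theorem localSubgroup_layerSubgroup_le_of_le (v : HeightOneSpectrum (𝓞 ℚ)) {m m' : ℕ} (h : m ≤ m') :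
    localSubgroup (κ.layerSubgroup m') (v.adicCompletion ℚ) ≤ localSubgroup (κ.layerSubgroup m) (v.adicCompletion ℚ) :=
  Subgroup.comap_mono (κ.layerSubgroup_antitone h)

/-- The stabiliser of an element of `K̄_v` in `Γ_{ℚ_v}` is closed (it contains the open subgroup `Gal(K̄/K(t))`).
[cite: NeukirchANT1999, Ch. IV §1] -/
theorem isClosed_stabilizer (v : HeightOneSpectrum (𝓞 ℚ)) (t : AlgebraicClosure (v.adicCompletion ℚ)) :
    IsClosed (MulAction.stabilizer (absoluteGaloisGroup (v.adicCompletion ℚ)) t :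
      Set (absoluteGaloisGroup (v.adicCompletion ℚ))) := by
  have hint : IsIntegral (v.adicCompletion ℚ) t := Algebra.IsIntegral.isIntegral t
  haveI : FiniteDimensional (v.adicCompletion ℚ) (v.adicCompletion ℚ)⟮t⟯ := IntermediateField.adjoin.finiteDimensional hint
  refine Subgroup.isClosed_of_isOpen _ (Subgroup.isOpen_mono ?_ (IntermediateField.fixingSubgroup_isOpen (v.adicCompletion ℚ)⟮t⟯))
  intro σ hσ
  exact MulAction.mem_stabilizer_iff.mpr
    ((IntermediateField.mem_fixingSubgroup_iff _ _).mp hσ t (IntermediateField.mem_adjoin_simple_self _ t))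

/-- **A common finite level for two elements**: if `x, z ∈ K̄_v` are fixed by `H_∞ ∩ Stab(t)`, then for some `R` both
are fixed by `H_{n+R} ∩ Stab(t)`. [cite: NeukirchANT1999, Ch. IV §1] -/
theorem exists_forall_mem_localSubgroup_layerSubgroup_add_smul_eq₂ (v : HeightOneSpectrum (𝓞 ℚ)) (n : ℕ)
    (t x z : AlgebraicClosure (v.adicCompletion ℚ))
    (hx : ∀ h ∈ localSubgroup κ.kerSubgroup (v.adicCompletion ℚ), h • t = t → h • x = x)
    (hz : ∀ h ∈ localSubgroup κ.kerSubgroup (v.adicCompletion ℚ), h • t = t → h • z = z) :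
    ∃ R : ℕ, (∀ h ∈ localSubgroup (κ.layerSubgroup (n + R)) (v.adicCompletion ℚ), h • t = t → h • x = x) ∧
      (∀ h ∈ localSubgroup (κ.layerSubgroup (n + R)) (v.adicCompletion ℚ), h • t = t → h • z = z) := by
  have hS := isClosed_stabilizer v t
  obtain ⟨m₁, hm₁⟩ := exists_forall_mem_localSubgroup_layerSubgroup_smul_eq (κ := κ) v _ hS x
    (fun h hh hht ↦ hx h hh (MulAction.mem_stabilizer_iff.mp hht))
  obtain ⟨m₂, hm₂⟩ := exists_forall_mem_localSubgroup_layerSubgroup_smul_eq (κ := κ) v _ hS z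
    (fun h hh hht ↦ hz h hh (MulAction.mem_stabilizer_iff.mp hht))
  refine ⟨m₁ + m₂, fun h hh hht ↦ hm₁ h (localSubgroup_layerSubgroup_le_of_le v (by omega) hh)
    (MulAction.mem_stabilizer_iff.mpr hht), fun h hh hht ↦ hm₂ h (localSubgroup_layerSubgroup_le_of_le v (by omega) hh)
    (MulAction.mem_stabilizer_iff.mpr hht)⟩

/-- **`τ₀(σz/z) · (σz/z) = 1`**: for `σ` fixing `t` and the `Γ`-fixed `Q`, a flip `τ₀ ∈ N ⊴ Γ`, and `z ≠ 0` fixed by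
`N ∩ Stab(t)` with `τ₀z · z = Q^{j'}` — the exponent map `x ↦ a(x)` (`τ₀x·x = Q^{a(x)}`) kills `σz/z`. [cite: NeukirchANT1999, Ch. IV §1] -/
theorem flip_smul_coboundary_mul_coboundary {v : HeightOneSpectrum (𝓞 ℚ)} {t : AlgebraicClosure (v.adicCompletion ℚ)}
    (ht : ∀ σ : absoluteGaloisGroup (v.adicCompletion ℚ), σ • t = t ∨ σ • t = -t)
    {N : Subgroup (absoluteGaloisGroup (v.adicCompletion ℚ))} [N.Normal] {τ₀ : absoluteGaloisGroup (v.adicCompletion ℚ)}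
    (hτ₀ : τ₀ ∈ N) (hτ₀t : τ₀ • t = -t) {σ : absoluteGaloisGroup (v.adicCompletion ℚ)} (hσt : σ • t = t)
    {Q : AlgebraicClosure (v.adicCompletion ℚ)} (hQ0 : Q ≠ 0) (hQσ : σ • Q = Q)
    {z : AlgebraicClosure (v.adicCompletion ℚ)} (hz0 : z ≠ 0)
    (hzL : ∀ h ∈ N, h • t = t → h • z = z) {j' : ℤ} (hzj : τ₀ • z * z = Q ^ j') :
    τ₀ • (σ • z / z) * (σ • z / z) = 1 := by
  have hσz0 : σ • z ≠ 0 := (smul_ne_zero_iff_ne σ).mpr hz0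
  have hQj : Q ^ j' ≠ 0 := zpow_ne_zero _ hQ0
  have hτz : τ₀ • z = Q ^ j' / z := eq_div_of_mul_eq hz0 hzj
  rw [smul_div₀', flip_smul_smul_comm ht hτ₀ hτ₀t hσt hzL, hτz, smul_div₀', smul_zpow₀', hQσ]
  field_simp

end Literature.NumberTheory.EllipticCurves.Greenberg1999.MultTowerNS2

end Part5

/-!
## Part 6 — port of `Summits/BirchSwinnertonDyer/BirchSwinnertonDyer/Theorems/ByReductionTypeAtTwoMultTowerSplitTowerAlgebra.lean` (2 declarations kept)

# Tower algebra at any prime `p` — topological generators of the local layer subgroups, finite levels, and cyclic Hilbert 90 for `⟨g⟩` acting on `K̄_v^{H_{n+R}}`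

Declarations of this Part (verbatim port; each keeps its own docstring and citation): `prod_smul_pow`, `prod_smul_range_mul_eq_pow`.

Reference keys (see `references.bib` and the declarations' citations): [GreenbergLNM1716].
-/

section Part6

set_option autoImplicit false
open scoped _root_.Classical _root_.IntermediateField

universe u

namespace Literature.NumberTheory.EllipticCurves.Greenberg1999.MultTowerSP1

open _root_.NumberField _root_.IsDedekindDomain _root_.Field _root_.PadicInt Literature.NumberTheory.EllipticCurves
  Literature.NumberTheory.GaloisRepresentations

variable {p : ℕ} [Fact p.Prime] {κ : ZpExtension ℚ p}

section Orbit

variable {K : Type*} [Field K]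

/-- `N_m(w^k) = N_m(w)^k`. [cite: GreenbergLNM1716, §3 (supporting lemma)] -/
theorem prod_smul_pow (g : absoluteGaloisGroup K) (m k : ℕ) (w : AlgebraicClosure K) :
    (∏ i ∈ Finset.range m, (g ^ i) • (w ^ k)) = (∏ i ∈ Finset.range m, (g ^ i) • w) ^ k := by
  rw [← Finset.prod_pow]
  exact Finset.prod_congr rfl fun i _ ↦ smul_pow' _ _ _

/-- `N_{mk}(w) = N_m(w)^k` when `g^m w = w` (splitting the range `[0, mk)` into `k` blocks of length `m`, each with
product `g^{mj} N_m(w) = N_m(w)`). [cite: GreenbergLNM1716, §3 (supporting lemma)] -/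
theorem prod_smul_range_mul_eq_pow (g : absoluteGaloisGroup K) (m : ℕ) {w : AlgebraicClosure K}
    (hw : (g ^ m) • w = w) (k : ℕ) :
    (∏ i ∈ Finset.range (m * k), (g ^ i) • w) = (∏ i ∈ Finset.range m, (g ^ i) • w) ^ k := by
  have hfix : ∀ j : ℕ, (g ^ (m * j)) • (∏ i ∈ Finset.range m, (g ^ i) • w) = ∏ i ∈ Finset.range m, (g ^ i) • w := by
    intro j
    induction j with
    | zero => rw [mul_zero, pow_zero, one_smul]
    | succ j ih => rw [Nat.mul_succ, pow_add, mul_smul, MultTowerNS2.pow_smul_prod_smul_eq g m hw, ih]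
  induction k with
  | zero => rw [mul_zero, Finset.prod_range_zero, pow_zero]
  | succ k ih =>
    rw [Nat.mul_succ, Finset.prod_range_add, ih, pow_succ]
    congr 1
    rw [← hfix k, Finset.smul_prod']
    exact Finset.prod_congr rfl fun i _ ↦ by rw [pow_add, mul_smul]

end Orbit

end Literature.NumberTheory.EllipticCurves.Greenberg1999.MultTowerSP1

end Part6

/-!
## Part 7 — port of `Summits/BirchSwinnertonDyer/BirchSwinnertonDyer/Theorems/ByReductionTypeAtTwoMultTowerNSOddTowerAlgebra.lean` (5 declarations kept)

# Greenberg 1999 §3 at a non-split multiplicative odd `p`, part 1 — the twisted-Tate tower algebra at any prime `p`: finite level inside `Stab(t)`, cyclic Hilbert 90 on `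

Declarations of this Part (verbatim port; each keeps its own docstring and citation): `exists_forall_mem_localSubgroup_layerSubgroup_smul_eq`, `exists_forall_mem_localSubgroup_layerSubgroup_add_smul_eq₂`, `exists_eq_smul_div_of_prod_smul_eq_one`, `exists_unit_of_mem_fixedPoints`, `apply_mem_fixedPoints`.

Reference keys (see `references.bib` and the declarations' citations): [NeukirchANT1999], [GreenbergLNM1716], [SilvermanATAEC1994].
-/

section Part7

set_option autoImplicit false
open scoped _root_.Classical _root_.IntermediateField

namespace Literature.NumberTheory.EllipticCurves.Greenberg1999.MultTowerNSOdd

open _root_.NumberField _root_.IsDedekindDomain _root_.Field _root_.PadicInt _root_.WeierstrassCurve Literature.NumberTheory.EllipticCurves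
  Literature.NumberTheory.GaloisRepresentations

variable {p : ℕ} [hp : Fact p.Prime]

/-! ### Finite level inside a closed subgroup -/

/-- **Finite level** (any `p`): if `x ∈ K̄_v` is fixed by every element of `H_∞ ∩ S` (`S ≤ Γ` closed), then for some `m`
it is fixed by every element of `H_m ∩ S` — the sets `(H_m ∩ S) ∖ Fix(x)` are compact, decreasing, with empty
intersection. Port of `MultTowerNS2.exists_forall_mem_localSubgroup_layerSubgroup_smul_eq` (`p = 2`) to any `p`.
[cite: NeukirchANT1999, Ch. IV §1] -/
theorem exists_forall_mem_localSubgroup_layerSubgroup_smul_eq {κ : ZpExtension ℚ p} (v : HeightOneSpectrum (𝓞 ℚ))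
    (S : Subgroup (absoluteGaloisGroup (v.adicCompletion ℚ)))
    (hS : IsClosed (S : Set (absoluteGaloisGroup (v.adicCompletion ℚ)))) (x : AlgebraicClosure (v.adicCompletion ℚ))
    (hx : ∀ h ∈ localSubgroup κ.kerSubgroup (v.adicCompletion ℚ), h ∈ S → h • x = x) :
    ∃ m : ℕ, ∀ h ∈ localSubgroup (κ.layerSubgroup m) (v.adicCompletion ℚ), h ∈ S → h • x = x := by
  -- the open subgroup `U = Gal(K̄/K(x))` of elements fixing `x`
  let H : ℕ → Subgroup (absoluteGaloisGroup (v.adicCompletion ℚ)) :=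
    fun m ↦ localSubgroup (κ.layerSubgroup m) (v.adicCompletion ℚ)
  have hHanti : ∀ m, H (m + 1) ≤ H m := fun m ↦ MultTowerNS2.localSubgroup_layerSubgroup_succ_le (κ := κ) v m
  have hHopen : ∀ m, IsOpen (H m : Set (absoluteGaloisGroup (v.adicCompletion ℚ))) :=
    fun m ↦ MultTowerNS2.isOpen_localSubgroup _ (κ.isOpen_layerSubgroup m) _
  have hHker : ∀ σ : absoluteGaloisGroup (v.adicCompletion ℚ), (∀ m, σ ∈ H m) →
      σ ∈ localSubgroup κ.kerSubgroup (v.adicCompletion ℚ) := fun σ h ↦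
    MultTowerSP1.mem_localSubgroup_kerSubgroup_of_forall κ (v.adicCompletion ℚ) h
  have hint : IsIntegral (v.adicCompletion ℚ) x := Algebra.IsIntegral.isIntegral x
  haveI : FiniteDimensional (v.adicCompletion ℚ) (v.adicCompletion ℚ)⟮x⟯ := IntermediateField.adjoin.finiteDimensional hint
  let U : Subgroup (absoluteGaloisGroup (v.adicCompletion ℚ)) := ((v.adicCompletion ℚ)⟮x⟯).fixingSubgroup
  have hUopen : IsOpen (U : Set (absoluteGaloisGroup (v.adicCompletion ℚ))) :=
    IntermediateField.fixingSubgroup_isOpen _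
  have hUfix : ∀ σ ∈ U, σ • x = x := fun σ hσ ↦
    (IntermediateField.mem_fixingSubgroup_iff _ _).mp hσ x (IntermediateField.mem_adjoin_simple_self _ x)
  have hfixU : ∀ σ : absoluteGaloisGroup (v.adicCompletion ℚ), σ • x = x → σ ∈ U := by
    intro σ hσ
    have hle : (v.adicCompletion ℚ)⟮x⟯ ≤ IntermediateField.fixedField (Subgroup.zpowers σ) := by
      rw [IntermediateField.adjoin_simple_le_iff, IntermediateField.mem_fixedField_iff]
      rintro τ ⟨k, rfl⟩
      exact MulAction.mem_stabilizer_iff.mp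
        ((MulAction.stabilizer (absoluteGaloisGroup (v.adicCompletion ℚ)) x).zpow_mem
          (MulAction.mem_stabilizer_iff.mpr hσ) k)
    exact (IntermediateField.mem_fixingSubgroup_iff _ _).mpr fun y hy ↦
      (IntermediateField.mem_fixedField_iff _ _).mp (hle hy) σ (Subgroup.mem_zpowers σ)
  -- the compact sets `(H m ∩ S) \ U`
  by_contra hcon
  have hcon' : ∀ m, ∃ h, h ∈ H m ∧ h ∈ S ∧ h • x ≠ x := by
    intro m
    by_contra hm
    refine hcon ⟨m, fun h hh hhS ↦ ?_⟩
    by_contra hne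
    exact hm ⟨h, hh, hhS, hne⟩
  let t : ℕ → Set (absoluteGaloisGroup (v.adicCompletion ℚ)) := fun m ↦ ((H m : Set _) ∩ (S : Set _)) \ (U : Set _)
  have htd : ∀ m, t (m + 1) ⊆ t m := fun m σ hσ ↦ ⟨⟨hHanti m hσ.1.1, hσ.1.2⟩, hσ.2⟩
  have htn : ∀ m, (t m).Nonempty := by
    intro m
    obtain ⟨h, hh, hhS, hne⟩ := hcon' m
    exact ⟨h, ⟨hh, hhS⟩, fun hU ↦ hne (hUfix h hU)⟩
  have htcl : ∀ m, IsClosed (t m) := fun m ↦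
    (((H m).isClosed_of_isOpen (hHopen m)).inter hS).sdiff hUopen
  -- (`CharZero ℚ_v` enters the context only now, for the compactness of `Γ`)
  haveI : CharZero (v.adicCompletion ℚ) :=
    charZero_of_injective_algebraMap (algebraMap ℚ (v.adicCompletion ℚ)).injective
  obtain ⟨σ, hσ⟩ := IsCompact.nonempty_iInter_of_sequence_nonempty_isCompact_isClosed t htd htn
    (htcl 0).isCompact htcl
  rw [Set.mem_iInter] at hσ
  have hσS : σ ∈ S := (hσ 0).1.2
  have hσU : σ ∉ U := (hσ 0).2
  have hσi := hHker σ fun m ↦ (hσ m).1.1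
  exact hσU (hfixU σ (hx σ hσi hσS))

/-- **A common finite level for two elements** (any `p`): if `x, z ∈ K̄_v` are fixed by `H_∞ ∩ Stab(t)`, then for some
`R` both are fixed by `H_{n+R} ∩ Stab(t)` (the stabiliser of `t` is closed, `MultTowerNS2.isClosed_stabilizer`). Port of
`MultTowerNS2.exists_forall_mem_localSubgroup_layerSubgroup_add_smul_eq₂` (`p = 2`). [cite: NeukirchANT1999, Ch. IV §1] -/
theorem exists_forall_mem_localSubgroup_layerSubgroup_add_smul_eq₂ {κ : ZpExtension ℚ p} (v : HeightOneSpectrum (𝓞 ℚ)) (n : ℕ)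
    (t x z : AlgebraicClosure (v.adicCompletion ℚ))
    (hx : ∀ h ∈ localSubgroup κ.kerSubgroup (v.adicCompletion ℚ), h • t = t → h • x = x)
    (hz : ∀ h ∈ localSubgroup κ.kerSubgroup (v.adicCompletion ℚ), h • t = t → h • z = z) :
    ∃ R : ℕ, (∀ h ∈ localSubgroup (κ.layerSubgroup (n + R)) (v.adicCompletion ℚ), h • t = t → h • x = x) ∧
      (∀ h ∈ localSubgroup (κ.layerSubgroup (n + R)) (v.adicCompletion ℚ), h • t = t → h • z = z) := by
  have hS := MultTowerNS2.isClosed_stabilizer v t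
  obtain ⟨m₁, hm₁⟩ := exists_forall_mem_localSubgroup_layerSubgroup_smul_eq (κ := κ) v _ hS x
    (fun h hh hht ↦ hx h hh (MulAction.mem_stabilizer_iff.mp hht))
  obtain ⟨m₂, hm₂⟩ := exists_forall_mem_localSubgroup_layerSubgroup_smul_eq (κ := κ) v _ hS z
    (fun h hh hht ↦ hz h hh (MulAction.mem_stabilizer_iff.mp hht))
  refine ⟨m₁ + m₂,
    fun h hh hht ↦ hm₁ h (MultTowerSP1.localSubgroup_layerSubgroup_antitone κ (v.adicCompletion ℚ) (by omega) hh)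
      (MulAction.mem_stabilizer_iff.mpr hht),
    fun h hh hht ↦ hm₂ h (MultTowerSP1.localSubgroup_layerSubgroup_antitone κ (v.adicCompletion ℚ) (by omega) hh)
      (MulAction.mem_stabilizer_iff.mpr hht)⟩

/-! ### Cyclic Hilbert 90 for `⟨g⟩` acting on `K̄^{H_{n+R} ∩ Stab(t)}` (any `p`) -/

/-- **Cyclic Hilbert 90 for the local layer, twisted, ANY `p`.** `κ` the cyclotomic `ℤ_p`-extension, `v ∋ p`,
`g ∈ Γ_{ℚ_v}` with `κ(res g) = p^n u_g` (`u_g` a unit) fixing `t` (`σ t = ±t` for all `σ`), `M = K̄_v^{H_{n+R} ∩ Stab(t)}`: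
the group `⟨g⟩` acts on `M` through a cyclic group of order `p^R`, and an element `u ∈ M` with `∏_{i<p^R} g^i u = 1` is
`g(y)/y` for some `y ∈ Mˣ`. Proof: the `p^R` characters `x ↦ g^i x` of `Mˣ` are distinct (`g^i ∉ H_{n+R}` for
`0 < i < p^R`), hence linearly independent (Artin; Mathlib `linearIndependent_monoidHom`), so some Lagrange resolvent
`θ = ∑_i (∏_{j<i} g^j u) g^i b` is non-zero; it satisfies `u · gθ = θ`, and `y = θ⁻¹`. Port of
`MultTowerNS2.exists_eq_smul_div_of_prod_smul_eq_one` (`p = 2`). [cite: NeukirchANT1999, Ch. IV (3.5)] -/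
theorem exists_eq_smul_div_of_prod_smul_eq_one {κ : ZpExtension ℚ p} (v : HeightOneSpectrum (𝓞 ℚ)) (n R : ℕ)
    {g : absoluteGaloisGroup (v.adicCompletion ℚ)} {ug : ℤ_[p]ˣ}
    (hug : ((κ (resGal (K := ℚ) (v.adicCompletion ℚ) g)).toAdd : ℤ_[p]) = (p : ℤ_[p]) ^ n * (ug : ℤ_[p]))
    {t : AlgebraicClosure (v.adicCompletion ℚ)}
    (ht : ∀ σ : absoluteGaloisGroup (v.adicCompletion ℚ), σ • t = t ∨ σ • t = -t) (hgt : g • t = t)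
    {u : AlgebraicClosure (v.adicCompletion ℚ)}
    (hu : ∀ h ∈ localSubgroup (κ.layerSubgroup (n + R)) (v.adicCompletion ℚ), h • t = t → h • u = u)
    (hN : (∏ i ∈ Finset.range (p ^ R), (g ^ i) • u) = 1) :
    ∃ y : AlgebraicClosure (v.adicCompletion ℚ), y ≠ 0 ∧
      (∀ h ∈ localSubgroup (κ.layerSubgroup (n + R)) (v.adicCompletion ℚ), h • t = t → h • y = y) ∧
      u = g • y / y := by
  -- the field `M = K̄^{H_{n+R} ∩ Stab(t)}` and the subfield `F_{n+R} = K̄^{H_{n+R}}`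
  set Hm := localSubgroup (κ.layerSubgroup (n + R)) (v.adicCompletion ℚ) with hHm
  haveI hnormal : Hm.Normal := by rw [hHm, localSubgroup_eq_comap]; exact Subgroup.Normal.comap inferInstance _
  let M : IntermediateField (v.adicCompletion ℚ) (AlgebraicClosure (v.adicCompletion ℚ)) :=
    IntermediateField.fixedField (Hm ⊓ MulAction.stabilizer (absoluteGaloisGroup (v.adicCompletion ℚ)) t)
  have hmemM : ∀ x, x ∈ M ↔ ∀ h ∈ Hm, h • t = t → h • x = x := by
    intro x
    rw [IntermediateField.mem_fixedField_iff]
    constructor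
    · intro hx h hh hht
      have hmem : h ∈ Hm ⊓ MulAction.stabilizer (absoluteGaloisGroup (v.adicCompletion ℚ)) t :=
        Subgroup.mem_inf.mpr ⟨hh, MulAction.mem_stabilizer_iff.mpr hht⟩
      exact hx h hmem
    · intro hx f hf
      let f' : absoluteGaloisGroup (v.adicCompletion ℚ) := f
      have hf' : f' ∈ Hm ⊓ MulAction.stabilizer (absoluteGaloisGroup (v.adicCompletion ℚ)) t := hf
      obtain ⟨hf1, hf2⟩ := Subgroup.mem_inf.mp hf'
      exact hx f' hf1 (MulAction.mem_stabilizer_iff.mp hf2)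
  have hstab : ∀ σ : absoluteGaloisGroup (v.adicCompletion ℚ), ∀ x ∈ M, σ • x ∈ M := fun σ x hx ↦
    (hmemM _).mpr (MultTowerNS2.smul_mem_of_forall_mem_smul_eq ht Hm ((hmemM x).mp hx) σ)
  have hgit : ∀ i : ℕ, (g ^ i) • t = t := fun i ↦ by
    induction i with
    | zero => rw [pow_zero, one_smul]
    | succ i ih => rw [pow_succ, mul_smul, hgt, ih]
  have hgi : ∀ i : ℕ, g ^ i ∈ Hm ↔ p ^ R ∣ i :=
    MultTowerSP1.pow_mem_localSubgroup_layerSubgroup_iff (κ := κ) v n R hug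
  have hgRM : ∀ x ∈ M, (g ^ p ^ R) • x = x := fun x hx ↦ (hmemM x).mp hx _ ((hgi _).mpr dvd_rfl) (hgit _)
  have huM : u ∈ M := (hmemM u).mpr hu
  have hopen : IsOpen (Hm : Set (absoluteGaloisGroup (v.adicCompletion ℚ))) :=
    MultTowerNS2.isOpen_localSubgroup _ (κ.isOpen_layerSubgroup (n + R)) _
  have hFM : IntermediateField.fixedField Hm ≤ M := IntermediateField.fixedField_le inf_le_left
  -- `u ≠ 0`
  have hR0 : 0 < p ^ R := pow_pos hp.out.pos R
  have hu0 : u ≠ 0 := by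
    intro h0
    have hz : (∏ i ∈ Finset.range (p ^ R), (g ^ i) • u) = 0 :=
      Finset.prod_eq_zero (Finset.mem_range.mpr hR0) (by rw [h0, smul_zero])
    rw [hz] at hN
    exact zero_ne_one hN
  -- (`CharZero ℚ_v` from here on; no term mentioning `localSubgroup` is written after this point)
  haveI : CharZero (v.adicCompletion ℚ) :=
    charZero_of_injective_algebraMap (algebraMap ℚ (v.adicCompletion ℚ)).injective
  have hfix := fixingSubgroup_fixedField_of_isOpen _ hopen
  have hHfix := fun σ ↦ SetLike.ext_iff.mp hfix σ
  -- the characters `x ↦ g^i x` of `M`, `i < p^R`, are distinct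
  let χ : Fin (p ^ R) → (M →* AlgebraicClosure (v.adicCompletion ℚ)) := fun i ↦
    { toFun := fun x ↦ (g ^ (i : ℕ)) • (x : AlgebraicClosure (v.adicCompletion ℚ))
      map_one' := by simp
      map_mul' := fun x y ↦ by
        rw [IntermediateField.coe_mul]
        exact smul_mul' _ _ _ }
  have hχapp : ∀ (i : Fin (p ^ R)) (x : M), χ i x = (g ^ (i : ℕ)) • (x : AlgebraicClosure (v.adicCompletion ℚ)) :=
    fun _ _ ↦ rfl
  have key : ∀ i i' : Fin (p ^ R), (i : ℕ) < i' → χ i = χ i' → False := by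
    intro i i' hlt heq
    set d : ℕ := (i' : ℕ) - i with hd
    have hd0 : 0 < d := by omega
    have hdlt : d < p ^ R := by omega
    have hgd : g ^ d ∉ Hm := by
      rw [hgi]
      intro hdvd
      exact absurd (Nat.le_of_dvd hd0 hdvd) (by omega)
    -- some `b ∈ F_{n+R}` is moved by `g^d`
    have hnot : ¬ ∀ b : IntermediateField.fixedField Hm,
        (g ^ d) • (b : AlgebraicClosure (v.adicCompletion ℚ)) = b := by
      intro hall
      exact hgd ((hHfix (g ^ d)).mp ((mem_fixingSubgroup_iff_forall_smul (IntermediateField.fixedField Hm) (g ^ d)).mpr hall))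
    push Not at hnot
    obtain ⟨⟨b, hb⟩, hgb⟩ := hnot
    have h1 := DFunLike.congr_fun heq ⟨b, hFM hb⟩
    rw [hχapp, hχapp] at h1
    change (g ^ (i : ℕ)) • b = (g ^ (i' : ℕ)) • b at h1
    rw [show (i' : ℕ) = (i : ℕ) + d by omega, pow_add, mul_smul] at h1
    exact hgb (smul_left_cancel (g ^ (i : ℕ)) h1.symm)
  have hχinj : Function.Injective χ := by
    intro i i' h
    rcases lt_trichotomy (i : ℕ) i' with hlt | heq | hgt
    · exact (key i i' hlt h).elim
    · exact Fin.ext heq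
    · exact (key i' i hgt h.symm).elim
  -- Artin: the characters are linearly independent, so some Lagrange resolvent is non-zero
  have hli := (linearIndependent_monoidHom M (AlgebraicClosure (v.adicCompletion ℚ))).comp χ hχinj
  let c : ℕ → AlgebraicClosure (v.adicCompletion ℚ) := fun i ↦ ∏ j ∈ Finset.range i, (g ^ j) • u
  have hc0 : c 0 = 1 := Finset.prod_range_zero _
  have hcN : c (p ^ R) = 1 := hN
  obtain ⟨b, hb⟩ : ∃ b : M, (∑ i : Fin (p ^ R), c i * (g ^ (i : ℕ)) • (b : AlgebraicClosure (v.adicCompletion ℚ))) ≠ 0 := by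
    by_contra hall
    push Not at hall
    have hsum : (∑ i : Fin (p ^ R), c i • ((χ i : M →* AlgebraicClosure (v.adicCompletion ℚ)) :
        M → AlgebraicClosure (v.adicCompletion ℚ))) = 0 := by
      funext x
      rw [Finset.sum_apply, Pi.zero_apply]
      simp only [Pi.smul_apply, smul_eq_mul]
      exact hall x
    have h0 := Fintype.linearIndependent_iff.mp hli (fun i ↦ c i) hsum ⟨0, hR0⟩
    exact one_ne_zero (hc0 ▸ h0)
  -- the resolvent `θ` and the identity `u · gθ = θ`
  set θ : AlgebraicClosure (v.adicCompletion ℚ) :=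
    ∑ i ∈ Finset.range (p ^ R), c i * (g ^ i) • (b : AlgebraicClosure (v.adicCompletion ℚ)) with hθ
  have hθb : (∑ i : Fin (p ^ R), c i * (g ^ (i : ℕ)) • (b : AlgebraicClosure (v.adicCompletion ℚ))) = θ :=
    Fin.sum_univ_eq_sum_range (fun i ↦ c i * (g ^ i) • (b : AlgebraicClosure (v.adicCompletion ℚ))) (p ^ R)
  have hθ0 : θ ≠ 0 := hθb ▸ hb
  have hshift : ∀ i : ℕ, u * (g • c i) = c (i + 1) := by
    intro i
    change u * (g • ∏ j ∈ Finset.range i, (g ^ j) • u) = ∏ j ∈ Finset.range (i + 1), (g ^ j) • u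
    rw [Finset.prod_range_succ', pow_zero, one_smul, Finset.smul_prod', mul_comm]
    congr 1
    exact Finset.prod_congr rfl fun j _ ↦ by rw [← mul_smul, ← pow_succ']
  have hgb : (g ^ p ^ R) • (b : AlgebraicClosure (v.adicCompletion ℚ)) = b := hgRM _ b.2
  have hkey : u * (g • θ) = θ := by
    have h1 : u * (g • θ) = ∑ i ∈ Finset.range (p ^ R), c (i + 1) * (g ^ (i + 1)) •
        (b : AlgebraicClosure (v.adicCompletion ℚ)) := by
      rw [hθ, Finset.smul_sum, Finset.mul_sum]
      refine Finset.sum_congr rfl fun i _ ↦ ?_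
      rw [smul_mul', ← mul_assoc, hshift i, ← mul_smul, ← pow_succ']
    have h2 := Finset.sum_range_succ' (fun i ↦ c i * (g ^ i) • (b : AlgebraicClosure (v.adicCompletion ℚ))) (p ^ R)
    have h3 := Finset.sum_range_succ (fun i ↦ c i * (g ^ i) • (b : AlgebraicClosure (v.adicCompletion ℚ))) (p ^ R)
    rw [h1]
    simp only [pow_zero, one_smul, hc0, one_mul] at h2
    rw [h3, hcN, hgb, one_mul, ← hθ] at h2
    linear_combination -h2
  -- `y = θ⁻¹`
  have hgθ0 : g • θ ≠ 0 := by
    intro h0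
    rw [h0, mul_zero] at hkey
    exact hθ0 hkey.symm
  have hθM : θ ∈ M := by
    rw [hθ]
    refine sum_mem fun i _ ↦ mul_mem ?_ (hstab _ _ b.2)
    exact prod_mem fun j _ ↦ hstab _ _ huM
  refine ⟨θ⁻¹, inv_ne_zero hθ0, fun h hh hht ↦ ?_, ?_⟩
  · rw [smul_inv'', (hmemM θ).mp hθM h hh hht]
  · rw [smul_inv'', eq_div_iff (inv_ne_zero hθ0)]
    field_simp
    linear_combination hkey

/-! ### The twisted Tate module: `M_∞ = Ψ(T)` (any `p`) -/

section Transport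

variable (v : HeightOneSpectrum (𝓞 ℚ)) {W : WeierstrassCurve ℚ}
  {Ψ : Additive (AlgebraicClosure (v.adicCompletion ℚ))ˣ →+ localPoints W (v.adicCompletion ℚ)}
  {t Q : AlgebraicClosure (v.adicCompletion ℚ)} {τ₀ : absoluteGaloisGroup (v.adicCompletion ℚ)}

/-- **`M_∞ ⊆ Ψ(T)`** (any `p`): a point of `E(K̄_v)` fixed by `H_∞` is `Ψ(x)` with `x` fixed by `H_∞ ∩ Stab(t)` and
`τ₀x · x ∈ q^ℤ` (`τ₀ ∈ H_∞` a flip of `t`). For `h ∈ H_∞ ∩ Stab(t)`: `Ψ(x) = hΨ(x) = Ψ(hx)`, so `hx = q^j x`,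
and `hx = x` by orbit finiteness; for the flip: `Ψ(x) = τ₀Ψ(x) = −Ψ(τ₀x)`, so `Ψ(x·τ₀x) = 0`. Port of
`MultTowerNS2.exists_unit_of_mem_fixedPoints` (`p = 2`).
[cite: GreenbergLNM1716, §3 (pp. 87–93)] [cite: SilvermanATAEC1994, Lemma V.5.2 (c), Thm. V.5.3] -/
theorem exists_unit_of_mem_fixedPoints {κ : ZpExtension ℚ p} (hsurj : Function.Surjective Ψ)
    (hker : ∀ u : (AlgebraicClosure (v.adicCompletion ℚ))ˣ, Ψ (Additive.ofMul u) = 0 ↔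
      ∃ j : ℤ, (u : AlgebraicClosure (v.adicCompletion ℚ)) = Q ^ j)
    (hequiv : ∀ (σ : absoluteGaloisGroup (v.adicCompletion ℚ)) (u u' : (AlgebraicClosure (v.adicCompletion ℚ))ˣ),
      (u' : AlgebraicClosure (v.adicCompletion ℚ)) = σ • (u : AlgebraicClosure (v.adicCompletion ℚ)) →
        σ • Ψ (Additive.ofMul u) = (if σ • t = t then (1 : ℤ) else -1) • Ψ (Additive.ofMul u'))
    (hQfix : ∀ σ : absoluteGaloisGroup (v.adicCompletion ℚ), σ • Q = Q) (hQ0 : Q ≠ 0)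
    (hQtor : ∀ j : ℤ, Q ^ j = 1 → j = 0) (hne : -t ≠ t)
    (hτ₀ : τ₀ ∈ localSubgroup κ.kerSubgroup (v.adicCompletion ℚ)) (hτ₀t : τ₀ • t = -t)
    {m : localPoints W (v.adicCompletion ℚ)}
    (hm : ∀ h ∈ localSubgroup κ.kerSubgroup (v.adicCompletion ℚ), h • m = m) :
    ∃ x : (AlgebraicClosure (v.adicCompletion ℚ))ˣ, Ψ (Additive.ofMul x) = m ∧
      (∀ h ∈ localSubgroup κ.kerSubgroup (v.adicCompletion ℚ), h • t = t →
        h • (x : AlgebraicClosure (v.adicCompletion ℚ)) = x) ∧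
      ∃ a : ℤ, τ₀ • (x : AlgebraicClosure (v.adicCompletion ℚ)) * x = Q ^ a := by
  obtain ⟨x', hx'⟩ := hsurj m
  set x : (AlgebraicClosure (v.adicCompletion ℚ))ˣ := Additive.toMul x' with hx
  have hxm : Ψ (Additive.ofMul x) = m := by rw [hx, ofMul_toMul]; exact hx'
  refine ⟨x, hxm, fun h hh hht ↦ ?_, ?_⟩
  · -- `h ∈ H_∞ ∩ Stab(t)`
    set u' : (AlgebraicClosure (v.adicCompletion ℚ))ˣ :=
      Units.mk0 (h • (x : AlgebraicClosure (v.adicCompletion ℚ))) ((smul_ne_zero_iff_ne h).mpr x.ne_zero) with hu'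
    have h1 := hequiv h x u' rfl
    rw [if_pos hht, one_zsmul, hxm, hm h hh] at h1
    -- `Ψ x = Ψ (h x)`: `h x = Q^j x`
    rw [← hxm, MultTowerNS2.tatePsi_eq_iff v hker] at h1
    obtain ⟨j, hj⟩ := h1
    have hj' : h • (x : AlgebraicClosure (v.adicCompletion ℚ)) = Q ^ (-j) * x := by
      rw [zpow_neg, ← Units.val_mk0 ((smul_ne_zero_iff_ne h).mpr x.ne_zero), ← hu', hj]
      field_simp
    exact MultTowerNS2.smul_eq_self_of_smul_eq_zpow_mul v (hQfix h) hQ0 hQtor x.ne_zero hj'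
  · -- the flip `τ₀`
    set u' : (AlgebraicClosure (v.adicCompletion ℚ))ˣ :=
      Units.mk0 (τ₀ • (x : AlgebraicClosure (v.adicCompletion ℚ))) ((smul_ne_zero_iff_ne τ₀).mpr x.ne_zero) with hu'
    have h1 := hequiv τ₀ x u' rfl
    rw [if_neg (fun h' ↦ hne (hτ₀t.symm.trans h')), neg_one_zsmul, hxm, hm τ₀ hτ₀] at h1
    -- `Ψ x = -Ψ (τ₀ x)`: `Ψ (τ₀x · x) = 0`
    have h2 : Ψ (Additive.ofMul (u' * x)) = 0 := by rw [ofMul_mul, map_add, hxm, h1, add_neg_cancel]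
    obtain ⟨a, ha⟩ := (hker _).mp h2
    exact ⟨a, by rw [← ha, Units.val_mul, hu', Units.val_mk0]⟩

/-- **`Ψ(T) ⊆ M_∞`** (any `p`): if `x` is fixed by `H_∞ ∩ Stab(t)` and `τ₀x · x = Q^a`, then `Ψ(x)` is fixed by `H_∞`
(an element of `H_∞` either fixes `t`, or flips it and then acts on `x` like `τ₀`: `hΨ(x) = −Ψ(τ₀x) = −Ψ(Q^a/x) = Ψ(x)`).
Port of `MultTowerNS2.apply_mem_fixedPoints` (`p = 2`).
[cite: GreenbergLNM1716, §3 (pp. 87–93)] [cite: SilvermanATAEC1994, Lemma V.5.2 (c), Thm. V.5.3] -/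
theorem apply_mem_fixedPoints {κ : ZpExtension ℚ p}
    (hker : ∀ u : (AlgebraicClosure (v.adicCompletion ℚ))ˣ, Ψ (Additive.ofMul u) = 0 ↔
      ∃ j : ℤ, (u : AlgebraicClosure (v.adicCompletion ℚ)) = Q ^ j)
    (hequiv : ∀ (σ : absoluteGaloisGroup (v.adicCompletion ℚ)) (u u' : (AlgebraicClosure (v.adicCompletion ℚ))ˣ),
      (u' : AlgebraicClosure (v.adicCompletion ℚ)) = σ • (u : AlgebraicClosure (v.adicCompletion ℚ)) →
        σ • Ψ (Additive.ofMul u) = (if σ • t = t then (1 : ℤ) else -1) • Ψ (Additive.ofMul u'))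
    (ht : ∀ σ : absoluteGaloisGroup (v.adicCompletion ℚ), σ • t = t ∨ σ • t = -t) (hne : -t ≠ t)
    (hτ₀ : τ₀ ∈ localSubgroup κ.kerSubgroup (v.adicCompletion ℚ)) (hτ₀t : τ₀ • t = -t)
    {x : (AlgebraicClosure (v.adicCompletion ℚ))ˣ}
    (hxL : ∀ h ∈ localSubgroup κ.kerSubgroup (v.adicCompletion ℚ), h • t = t →
      h • (x : AlgebraicClosure (v.adicCompletion ℚ)) = x)
    {a : ℤ} (hxa : τ₀ • (x : AlgebraicClosure (v.adicCompletion ℚ)) * x = Q ^ a) :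
    ∀ h ∈ localSubgroup κ.kerSubgroup (v.adicCompletion ℚ), h • Ψ (Additive.ofMul x) = Ψ (Additive.ofMul x) := by
  intro h hh
  rcases ht h with hht | hht
  · have h1 := hequiv h x x (hxL h hh hht).symm
    rw [if_pos hht, one_zsmul] at h1
    exact h1
  · set u' : (AlgebraicClosure (v.adicCompletion ℚ))ˣ :=
      Units.mk0 (h • (x : AlgebraicClosure (v.adicCompletion ℚ))) ((smul_ne_zero_iff_ne h).mpr x.ne_zero) with hu'
    have h1 := hequiv h x u' rfl
    rw [if_neg (fun h' ↦ hne (hht.symm.trans h')), neg_one_zsmul] at h1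
    -- `h x = τ₀ x = Q^a x⁻¹`, so `Ψ (h x) = Ψ (x⁻¹) = -Ψ x`
    have h2 : Ψ (Additive.ofMul u') = Ψ (Additive.ofMul x⁻¹) := by
      rw [MultTowerNS2.tatePsi_eq_iff v hker]
      refine ⟨a, ?_⟩
      rw [hu', Units.val_mk0, Units.val_inv_eq_inv_val, MultTowerNS2.flip_smul_eq hτ₀ hτ₀t hh hht hxL, ← hxa]
      field_simp
    rw [h1, h2, ofMul_inv, map_neg, neg_neg]

end Transport

end Literature.NumberTheory.EllipticCurves.Greenberg1999.MultTowerNSOdd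

end Part7

/-!
## Part 8 — port of `Summits/BirchSwinnertonDyer/Rank1Residual/Additive/CyclotomicThreeMultiplicativeReduction.lean` (1 declarations kept)

# The canonical model `V ⊗ K` of a curve with multiplicative reduction at `3` at the prime of `K = ℚ(ζ₃)` above `3`: minimality, (non-split) multiplicative reduction, and `ord₃ C(V ⊗ K) = ord₃ ∏ c_w` (line V15 of the additive sub-cell: the (M

Declarations of this Part (verbatim port; each keeps its own docstring and citation): `dvd_and_not_dvd_c₄_of_hasMultiplicativeReductionAtPrime`.

Reference keys (see `references.bib` and the declarations' citations): [SilvermanAEC2009].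
-/

section Part8

open scoped _root_.Classical _root_.NumberField

open _root_.WeierstrassCurve _root_.NumberField _root_.IsDedekindDomain _root_.Rat.HeightOneSpectrum
  Literature.NumberTheory.EllipticCurves Literature.NumberTheory.EllipticCurves.Rank1Residual

namespace Literature.NumberTheory.EllipticCurves.CoatesGreenberg1996

section IntData

variable (V : WeierstrassCurve ℚ) [V.IsElliptic] [V.IsGloballyMinimal] (p : ℕ) [hp : Fact p.Prime]

/-- **`p ∣ Δ_min(V)` and `p ∤ c₄(V_ℤ)` at a prime of multiplicative reduction** of the globally
minimal `V` (Silverman VII.5.1(b): `ord_p Δ > 0`, `ord_p c₄ = 0` on a minimal equation; tree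
`hasMultiplicativeReductionAt_iff_of_isMinimalAt` at the place of `𝓞 ℚ` over `p`).
[cite: SilvermanAEC2009, VII.5 Prop. 5.1(b)] -/
theorem dvd_and_not_dvd_c₄_of_hasMultiplicativeReductionAtPrime
    (h : V.HasMultiplicativeReductionAtPrime p) :
    (p : ℤ) ∣ minimalDiscriminantInt V ∧ ¬ (p : ℤ) ∣ (integralModelInt V).c₄ := by
  obtain ⟨v, hv⟩ : ∃ v : HeightOneSpectrum (𝓞 ℚ), (primesEquiv v : ℕ) = p :=
    ⟨primesEquiv.symm ⟨p, hp.out⟩, by rw [Equiv.apply_symm_apply]⟩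
  subst hv
  have hm : V.HasMultiplicativeReductionAt v :=
    (hasMultiplicativeReductionAtPrime_iff_hasMultiplicativeReductionAt_ringOfIntegers V v).mp h
  rw [hasMultiplicativeReductionAt_iff_of_isMinimalAt (IsGloballyMinimal.isMinimal (W := V) v)] at hm
  obtain ⟨hΔ, hc⟩ := hm
  have hc' : V.c₄ = ((integralModelInt V).c₄ : ℚ) := by
    conv_lhs => rw [← map_integralModelInt V]
    rw [map_c₄, eq_intCast]
  rw [← cast_minimalDiscriminantInt, (valuation_equiv_padicValuation v).lt_one_iff_lt_one,
    Rat.padicValuation_cast, Int.padicValuation_lt_one_iff] at hΔ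
  rw [hc', (valuation_equiv_padicValuation v).eq_one_iff_eq_one, Rat.padicValuation_cast,
    Int.padicValuation_eq_one_iff] at hc
  exact ⟨hΔ, hc⟩

end IntData

end Literature.NumberTheory.EllipticCurves.CoatesGreenberg1996

end Part8

/-!
## Part 9 — port of `Summits/BirchSwinnertonDyer/Rank1Residual/X2/GreenbergVatsalTateDatumRat.lean` (1 declarations kept)

# The Tate datum of `E/ℚ` at an odd prime `p ‖ N`, split or non-split: the local inertia group fixes `√γ(E)` (`γ = −c₄/c₆` is a `p`-unit), so GV's "`I_p` acts trivially on `D`" and the Kummer compatibility hold, and `Sel_{p^∞}(E/ℚ_∞) ⊆ S^{Σ₀}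

Declarations of this Part (verbatim port; each keeps its own docstring and citation): `not_dvd_c₆_of_hasMultiplicativeReductionAtPrime`.

Reference keys (see `references.bib` and the declarations' citations): [SilvermanAEC2009].
-/

section Part9

open scoped _root_.Classical AddSubgroup _root_.NNReal

open _root_.NumberField _root_.IsDedekindDomain _root_.Field
open Literature.NumberTheory.EllipticCurves Literature.NumberTheory.EllipticCurves.GreenbergSelmer Literature.NumberTheory.GaloisRepresentations _root_.IsDedekindDomain.HeightOneSpectrum
open _root_.WeierstrassCurve (minimalDiscriminantInt integralModelInt)

namespace Literature.NumberTheory.EllipticCurves.Greenberg1999.GreenbergVatsalTateDatumRat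

variable (W : WeierstrassCurve ℚ) [W.IsElliptic] [W.IsGloballyMinimal] {p : ℕ} [hp : Fact p.Prime]
  {v : HeightOneSpectrum (𝓞 ℚ)}

/-- **At a prime of multiplicative reduction `p ∤ c₆(E_ℤ)`** (globally minimal `E/ℚ`): `p ∣ Δ_min`,
`p ∤ c₄` (Silverman VII.5.1(b), tree `dvd_and_not_dvd_c₄_of_hasMultiplicativeReductionAtPrime`) and
`1728Δ = c₄³ − c₆²`. [cite: SilvermanAEC2009, VII.5 Prop. 5.1(b)] -/
theorem not_dvd_c₆_of_hasMultiplicativeReductionAtPrime (hmult : W.HasMultiplicativeReductionAtPrime p) :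
    ¬ (p : ℤ) ∣ (integralModelInt W).c₆ := by
  obtain ⟨hΔ, hc₄⟩ := Literature.NumberTheory.EllipticCurves.CoatesGreenberg1996.dvd_and_not_dvd_c₄_of_hasMultiplicativeReductionAtPrime W p hmult
  intro h6
  have hp' : Prime (p : ℤ) := Nat.prime_iff_prime_int.mp hp.out
  have hrel : (integralModelInt W).c₄ ^ 3 =
      1728 * (integralModelInt W).Δ + (integralModelInt W).c₆ ^ 2 := by
    rw [(integralModelInt W).c_relation]; ring
  have h3 : (p : ℤ) ∣ (integralModelInt W).c₄ ^ 3 := by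
    rw [hrel]
    exact dvd_add (dvd_mul_of_dvd_right hΔ _) (dvd_pow h6 two_ne_zero)
  exact hc₄ (hp'.dvd_of_dvd_pow h3)

end Literature.NumberTheory.EllipticCurves.Greenberg1999.GreenbergVatsalTateDatumRat

end Part9

/-!
## Part 10 — port of `Summits/BirchSwinnertonDyer/BirchSwinnertonDyer/Theorems/Rank1ResidualIntModelReduction.lean` (4 declarations kept)

# Reduction data, (ram) and irreducibility of `E[p]` read off an integer model

Declarations of this Part (verbatim port; each keeps its own docstring and citation): `degree_nodal_eq_two`, `minimalDiscriminantInt_eq`, `hasSplitMultiplicativeReductionAtPrime_iff_splits`, `hasSplitMultiplicativeReductionAtPrime_of_intModel_of_root`.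

Reference keys (see `references.bib` and the declarations' citations): [SilvermanAEC2009].
-/

section Part10

set_option autoImplicit false

open scoped _root_.Classical

open _root_.IsDedekindDomain _root_.NumberField _root_.Rat.HeightOneSpectrum _root_.WeierstrassCurve _root_.Polynomial
  Literature.NumberTheory.EllipticCurves Literature.NumberTheory.EllipticCurves.Rank1Residual
  Literature.NumberTheory.GaloisRepresentations

namespace Literature.NumberTheory.EllipticCurves.Rank1Residual.IntModel

/-- The node-tangent quadratic of `E₀` mod `p` has degree `2` when `p ∤ c₄(E₀)`. [cite: SilvermanAEC2009, VII.5 Prop. 5.1(b)] -/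
theorem degree_nodal_eq_two (E₀ : WeierstrassCurve ℤ) (p : ℕ) [Fact p.Prime] (hc₄ : ¬ (p : ℤ) ∣ E₀.c₄) :
    (letI I := E₀.map (Int.castRingHom (ZMod p));
      (C I.c₄ * X ^ 2 + C (I.a₁ * I.c₄) * X - C (54 * I.b₆ - 3 * I.b₂ * I.b₄ + I.a₂ * I.c₄)).degree) = 2 := by
  have hc : (E₀.map (Int.castRingHom (ZMod p))).c₄ ≠ 0 := by
    rw [map_c₄, eq_intCast, Ne, ZMod.intCast_zmod_eq_zero_iff_dvd]
    exact hc₄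
  rw [sub_eq_add_neg, ← C_neg]
  exact degree_quadratic hc

section

variable {W : WeierstrassCurve ℚ} [W.IsElliptic] [W.IsGloballyMinimal] {E₀ : WeierstrassCurve ℤ}
  (hI : integralModelInt W = E₀)
include hI

omit [W.IsElliptic] in
/-- `Δ_min(W) = Δ(E₀)`. [cite: SilvermanAEC2009, VII.5 Prop. 5.1(b)] -/
theorem minimalDiscriminantInt_eq : minimalDiscriminantInt W = E₀.Δ := by
  rw [minimalDiscriminantInt, hI]

/-- The place-indexed criterion of the tree, moved to the prime `p` and the model `E₀`: split
multiplicative at `p` iff the node-tangent quadratic of `E₀` mod `p` splits. [cite: SilvermanAEC2009, VII.5 Prop. 5.1(b)] -/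
theorem hasSplitMultiplicativeReductionAtPrime_iff_splits (p : ℕ) [hp : Fact p.Prime]
    (hΔ : (p : ℤ) ∣ E₀.Δ) (hc₄ : ¬ (p : ℤ) ∣ E₀.c₄) :
    W.HasSplitMultiplicativeReductionAtPrime p ↔
      (letI I := E₀.map (Int.castRingHom (ZMod p));
        (C I.c₄ * X ^ 2 + C (I.a₁ * I.c₄) * X - C (54 * I.b₆ - 3 * I.b₂ * I.b₄ + I.a₂ * I.c₄)).Splits) := by
  set v : HeightOneSpectrum (𝓞 ℚ) := (primesEquiv (R := 𝓞 ℚ)).symm ⟨p, hp.out⟩ with hvdef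
  have hv : primesEquiv v = ⟨p, hp.out⟩ := Equiv.apply_symm_apply _ _
  have hΔ' : ((primesEquiv v : ℕ) : ℤ) ∣ minimalDiscriminantInt W := by
    rw [hv, minimalDiscriminantInt_eq hI]; exact hΔ
  have hc₄' : ¬ ((primesEquiv v : ℕ) : ℤ) ∣ (integralModelInt W).c₄ := by
    rw [hv, hI]; exact hc₄
  have h1 := W.hasSplitMultiplicativeReductionAt_iff_splits v hΔ' hc₄'
  have h2 := hasSplitMultiplicativeReductionAtPrime_iff_hasSplitMultiplicativeReductionAt W v
  have key : ∀ q : Nat.Primes, primesEquiv v = q →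
      ((haveI := Fact.mk q.2; W.HasSplitMultiplicativeReductionAtPrime (q : ℕ)) ↔
        (letI I := (integralModelInt W).map (Int.castRingHom (ZMod q));
          (C I.c₄ * X ^ 2 + C (I.a₁ * I.c₄) * X
            - C (54 * I.b₆ - 3 * I.b₂ * I.b₄ + I.a₂ * I.c₄)).Splits)) := by
    rintro q rfl
    exact h2.trans h1
  have h3 := key ⟨p, hp.out⟩ hv
  rw [hI] at h3
  exact h3

/-- **Split multiplicative at `p` from a root** of the node-tangent quadratic of `E₀` mod `p`
(`p ∣ Δ(E₀)`, `p ∤ c₄(E₀)`): a quadratic with a root splits. [cite: SilvermanAEC2009, VII.5 Prop. 5.1(b)] -/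
theorem hasSplitMultiplicativeReductionAtPrime_of_intModel_of_root (p : ℕ) [hp : Fact p.Prime]
    (hΔ : (p : ℤ) ∣ E₀.Δ) (hc₄ : ¬ (p : ℤ) ∣ E₀.c₄)
    (hroot : ∃ t : ZMod p, (E₀.c₄ : ZMod p) * t ^ 2 + (E₀.a₁ * E₀.c₄ : ZMod p) * t
      - (54 * E₀.b₆ - 3 * E₀.b₂ * E₀.b₄ + E₀.a₂ * E₀.c₄ : ZMod p) = 0) :
    W.HasSplitMultiplicativeReductionAtPrime p := by
  rw [hasSplitMultiplicativeReductionAtPrime_iff_splits hI p hΔ hc₄]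
  obtain ⟨t, ht⟩ := hroot
  refine Splits.of_degree_eq_two (degree_nodal_eq_two E₀ p hc₄) (x := t) ?_
  simp only [eval_sub, eval_add, eval_mul, eval_C, eval_X, eval_pow, map_c₄, map_b₂, map_b₄,
    map_b₆, map_a₁, map_a₂, eq_intCast]
  linear_combination ht

end

end Literature.NumberTheory.EllipticCurves.Rank1Residual.IntModel

end Part10

/-!
## Part 11 — port of `Summits/BirchSwinnertonDyer/Rank1Residual/X2/GreenbergVatsalTateFrobeniusSign.lean` (3 declarations kept)

# At an odd non-split multiplicative prime `p` of `E/ℚ` an arithmetic Frobenius flips `√γ(E)`: `τ(t) = −t` for `t² = γ = −c₄/c₆` (so the unramified quadratic character `φ` of the Tate curve has `φ(Frob_p) = −1`), from "non-split ⟹ `−c₄c₆` is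

Declarations of this Part (verbatim port; each keeps its own docstring and citation): `not_isSquare_neg_c₄_mul_c₆_of_not_split`, `int_dvd_pow_div_two_add_one_of_not_split`, `frob_smul_sqrt_gamma_eq_neg`.

Reference keys (see `references.bib` and the declarations' citations): [SilvermanAEC2009], [SilvermanATAEC1994], [GreenbergVatsal2000].
-/

section Part11

open scoped _root_.Classical _root_.NNReal

open _root_.NumberField _root_.IsDedekindDomain _root_.Field _root_.Polynomial
open Literature.NumberTheory.EllipticCurves Literature.NumberTheory.GaloisRepresentations
  _root_.IsDedekindDomain.HeightOneSpectrum _root_.Rat.HeightOneSpectrum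
open _root_.WeierstrassCurve (minimalDiscriminantInt integralModelInt)

namespace Literature.NumberTheory.EllipticCurves.Greenberg1999.GreenbergVatsalTateFrobeniusSign

section NonSquare

variable (W : WeierstrassCurve ℚ) [W.IsElliptic] [W.IsGloballyMinimal] (p : ℕ) [hp : Fact p.Prime]

/-- **At an odd prime of NON-SPLIT multiplicative reduction, `−c₄c₆` of the global minimal model is
a NON-SQUARE mod `p`.** If `−c₄c₆ ≡ s²`, the node-tangent quadratic mod `p` (leading coefficient
`c₄ ≢ 0`, discriminant `−c₄c₆` by `WeierstrassCurve.discrim_nodalTangents`) has the root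
`(−a₁c₄ + s)/(2c₄)`, so the reduction is split (tree:
`IntModel.hasSplitMultiplicativeReductionAtPrime_of_intModel_of_root`).
[cite: SilvermanAEC2009, VII.5 Prop. 5.1(b)] -/
theorem not_isSquare_neg_c₄_mul_c₆_of_not_split (hp2 : p ≠ 2)
    (hmult : W.HasMultiplicativeReductionAtPrime p) (hns : ¬ W.HasSplitMultiplicativeReductionAtPrime p) :
    ¬ IsSquare ((-((integralModelInt W).c₄ * (integralModelInt W).c₆) : ℤ) : ZMod p) := by
  obtain ⟨hΔ, hc₄⟩ := Literature.NumberTheory.EllipticCurves.CoatesGreenberg1996.dvd_and_not_dvd_c₄_of_hasMultiplicativeReductionAtPrime W p hmult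
  rintro ⟨s, hs⟩
  apply hns
  set E₀ := integralModelInt W with hE₀
  have hΔ' : (p : ℤ) ∣ E₀.Δ := by rw [hE₀]; exact hΔ
  haveI : NeZero (2 : ZMod p) := ⟨by
    rw [show (2 : ZMod p) = ((2 : ℕ) : ZMod p) by norm_cast, Ne, ZMod.natCast_eq_zero_iff]
    intro h
    exact hp2 ((Nat.prime_dvd_prime_iff_eq hp.out Nat.prime_two).mp h)⟩
  have hc₄' : (E₀.c₄ : ZMod p) ≠ 0 := by
    rw [Ne, ZMod.intCast_zmod_eq_zero_iff_dvd]; exact hc₄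
  -- the discriminant of the node-tangent quadratic mod `p` is `-c₄c₆ = s * s`
  set I := E₀.map (Int.castRingHom (ZMod p)) with hI
  have hdisc : discrim (E₀.c₄ : ZMod p) ((E₀.a₁ : ZMod p) * (E₀.c₄ : ZMod p))
      (-(54 * (E₀.b₆ : ZMod p) - 3 * (E₀.b₂ : ZMod p) * (E₀.b₄ : ZMod p) +
        (E₀.a₂ : ZMod p) * (E₀.c₄ : ZMod p))) = s * s := by
    have h := WeierstrassCurve.discrim_nodalTangents I
    simp only [hI, WeierstrassCurve.map_c₄, WeierstrassCurve.map_c₆, WeierstrassCurve.map_b₂,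
      WeierstrassCurve.map_b₄, WeierstrassCurve.map_b₆, WeierstrassCurve.map_a₁,
      WeierstrassCurve.map_a₂, eq_intCast] at h
    rw [h, ← hs]
    push_cast
    ring
  obtain ⟨x, hx⟩ := exists_quadratic_eq_zero hc₄' ⟨s, hdisc⟩
  refine Literature.NumberTheory.EllipticCurves.Rank1Residual.IntModel.hasSplitMultiplicativeReductionAtPrime_of_intModel_of_root
    (W := W) (E₀ := E₀) hE₀.symm p hΔ' hc₄ ⟨x, ?_⟩
  linear_combination hx

/-- **Euler's criterion at a non-split prime**: `p ∣ (−c₄c₆)^{(p−1)/2} + 1` (`p` odd, `p ∤ c₄c₆`,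
`−c₄c₆` a non-square mod `p`; Mathlib `ZMod.euler_criterion`, `ZMod.pow_div_two_eq_neg_one_or_one`).
[cite: SilvermanAEC2009, VII.5 Prop. 5.1(b)] -/
theorem int_dvd_pow_div_two_add_one_of_not_split (hp2 : p ≠ 2)
    (hmult : W.HasMultiplicativeReductionAtPrime p) (hns : ¬ W.HasSplitMultiplicativeReductionAtPrime p) :
    (p : ℤ) ∣ (-((integralModelInt W).c₄ * (integralModelInt W).c₆)) ^ (p / 2) + 1 := by
  have hnsq := not_isSquare_neg_c₄_mul_c₆_of_not_split W p hp2 hmult hns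
  obtain ⟨-, hc₄⟩ := Literature.NumberTheory.EllipticCurves.CoatesGreenberg1996.dvd_and_not_dvd_c₄_of_hasMultiplicativeReductionAtPrime W p hmult
  have hc₆ := GreenbergVatsalTateDatumRat.not_dvd_c₆_of_hasMultiplicativeReductionAtPrime W hmult
  have hp' : Prime (p : ℤ) := Nat.prime_iff_prime_int.mp hp.out
  have hg : ((-((integralModelInt W).c₄ * (integralModelInt W).c₆) : ℤ) : ZMod p) ≠ 0 := by
    rw [Ne, ZMod.intCast_zmod_eq_zero_iff_dvd, dvd_neg]
    intro h
    rcases hp'.dvd_or_dvd h with h4 | h6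
    · exact hc₄ h4
    · exact hc₆ h6
  have hpow : ((-((integralModelInt W).c₄ * (integralModelInt W).c₆) : ℤ) : ZMod p) ^ (p / 2) = -1 := by
    rcases ZMod.pow_div_two_eq_neg_one_or_one p hg with h | h
    · exact absurd ((ZMod.euler_criterion p hg).mpr h) hnsq
    · exact h
  rw [← ZMod.intCast_zmod_eq_zero_iff_dvd]
  push_cast at hpow ⊢
  rw [hpow, neg_add_cancel]

end NonSquare

section Flip

variable (W : WeierstrassCurve ℚ) [W.IsElliptic] [W.IsGloballyMinimal] {p : ℕ} [hp : Fact p.Prime]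
  {v : HeightOneSpectrum (𝓞 ℚ)}

/-- **An arithmetic Frobenius FLIPS `√γ(E)` at an odd prime of non-split multiplicative
reduction.** For the globally minimal `E/ℚ`, `p` odd with `E` multiplicative and NOT split at `p`,
`v ∋ p`, `𝔐` a prime of the local absolute integers `\bar 𝓞_v` above `𝓂_v`, `τ ∈ Γ_{ℚ_v}` an
arithmetic Frobenius at `𝔐` (`τ x ≡ x^p (mod 𝔐)`), and `t ∈ ℚ̄_v` with `t² = γ = −c₄/c₆`:
`τ(t) = −t`. Proof: `c₄`, `c₆` are `p`-units (Silverman VII.5.1(b)), `t' = c₆t` is a `v`-adic unit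
with `t'² = g = −c₄c₆ ∈ ℤ`; `τt' ≡ t'^p = t'·g^{(p−1)/2} ≡ −t' (mod 𝔐)` by Euler's criterion
(`int_dvd_pow_div_two_add_one_of_not_split`); and `τt = ±t` with `τt = t` forcing
`|2t'|_v < 1`, absurd for odd `p`. Equivalently `ℚ_v(√γ)` is the unramified QUADRATIC extension of
`ℚ_v` (Silverman *ATAEC* V Ex. 5.11 (b); gen 9 `GreenbergVatsalTateDatumRat.inertia_fix_sqrt_gamma`
gave the inertial half), i.e. the character `φ` of GV pp. 14–15 has `φ(Frob) = −1`.
[cite: SilvermanATAEC1994, Ch. V Lemma 5.2 (c), Thm. 5.3 (a),(b), Cor. 5.4 (held copy PDF pp. 406–410)]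
[cite: SilvermanAEC2009, VII.5 Prop. 5.1(b)] [cite: GreenbergVatsal2000, §2 pp. 14–15] -/
theorem frob_smul_sqrt_gamma_eq_neg (hp2 : p ≠ 2) (hmult : W.HasMultiplicativeReductionAtPrime p)
    (hns : ¬ W.HasSplitMultiplicativeReductionAtPrime p) (hpv : ((p : ℕ) : 𝓞 ℚ) ∈ v.asIdeal)
    {𝔐 : Ideal v.localAbsIntegers} (h𝔐 : 𝔐 ∈ v.localPrimesAbove)
    {τ : absoluteGaloisGroup (v.adicCompletion ℚ)}
    (hτ : IsArithFrobAt (v.adicCompletionIntegers ℚ) τ 𝔐)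
    (t : AlgebraicClosure (v.adicCompletion ℚ))
    (ht : t ^ 2 = algebraMap (v.adicCompletion ℚ) (AlgebraicClosure (v.adicCompletion ℚ))
      (algebraMap ℚ (v.adicCompletion ℚ) (-(W.c₄ / W.c₆)))) :
    τ • t = -t := by
  obtain ⟨w, hw⟩ := v.exists_spectralValuation
  obtain ⟨-, hc₄⟩ := Literature.NumberTheory.EllipticCurves.CoatesGreenberg1996.dvd_and_not_dvd_c₄_of_hasMultiplicativeReductionAtPrime W p hmult
  have hc₆ := GreenbergVatsalTateDatumRat.not_dvd_c₆_of_hasMultiplicativeReductionAtPrime W hmult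
  haveI : CharZero (AlgebraicClosure (v.adicCompletion ℚ)) :=
    charZero_of_injective_algebraMap (algebraMap ℚ (AlgebraicClosure (v.adicCompletion ℚ))).injective
  -- `γ` in `ℚ̄_v`
  have h4 : W.c₄ = ((integralModelInt W).c₄ : ℚ) := by
    conv_lhs => rw [← WeierstrassCurve.map_integralModelInt W]
    rw [WeierstrassCurve.map_c₄, eq_intCast]
  have h6 : W.c₆ = ((integralModelInt W).c₆ : ℚ) := by
    conv_lhs => rw [← WeierstrassCurve.map_integralModelInt W]
    rw [WeierstrassCurve.map_c₆, eq_intCast]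
  have hγ : algebraMap (v.adicCompletion ℚ) (AlgebraicClosure (v.adicCompletion ℚ))
      (algebraMap ℚ (v.adicCompletion ℚ) (-(W.c₄ / W.c₆))) =
      -((((integralModelInt W).c₄ : ℤ) : AlgebraicClosure (v.adicCompletion ℚ)) /
        (((integralModelInt W).c₆ : ℤ) : AlgebraicClosure (v.adicCompletion ℚ))) := by
    rw [← IsScalarTower.algebraMap_apply ℚ (v.adicCompletion ℚ)
      (AlgebraicClosure (v.adicCompletion ℚ)), h4, h6, map_neg, map_div₀, map_intCast, map_intCast]
  have hc60 : (((integralModelInt W).c₆ : ℤ) : AlgebraicClosure (v.adicCompletion ℚ)) ≠ 0 := by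
    rw [Int.cast_ne_zero]; intro h0; exact hc₆ (by rw [h0]; exact dvd_zero _)
  -- `t' = c₆ t`, `t'² = g = -c₄c₆`
  obtain ⟨t', ht'def⟩ : ∃ t' : AlgebraicClosure (v.adicCompletion ℚ),
      t' = (((integralModelInt W).c₆ : ℤ) : AlgebraicClosure (v.adicCompletion ℚ)) * t := ⟨_, rfl⟩
  have ht'2 : t' ^ 2 = (((-((integralModelInt W).c₄ * (integralModelInt W).c₆)) : ℤ) :
      AlgebraicClosure (v.adicCompletion ℚ)) := by
    rw [ht'def, mul_pow, ht, hγ]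
    push_cast
    field_simp
  -- valuations: `|c₆| = |t| = |t'| = 1`
  have hw4 : w (((integralModelInt W).c₄ : ℤ) : AlgebraicClosure (v.adicCompletion ℚ)) = 1 :=
    spectralValuation_intCast_eq_one_of_natCast_mem hpv hw hc₄
  have hw6 : w (((integralModelInt W).c₆ : ℤ) : AlgebraicClosure (v.adicCompletion ℚ)) = 1 :=
    spectralValuation_intCast_eq_one_of_natCast_mem hpv hw hc₆
  have hwt2 : w t ^ 2 = 1 := by
    rw [← map_pow, ht, hγ, Valuation.map_neg, map_div₀, hw4, hw6, div_one]
  have hwt : w t = 1 := by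
    rcases lt_trichotomy (w t) 1 with h | h | h
    · exact absurd hwt2 (ne_of_lt (pow_lt_one₀ zero_le h two_ne_zero))
    · exact h
    · exact absurd hwt2 (ne_of_gt (one_lt_pow₀ h two_ne_zero))
  have hwt' : w t' = 1 := by rw [ht'def, map_mul, hw6, hwt, one_mul]
  -- `t'` is a local absolute integer; apply the Frobenius congruence to it
  have ht'mem : t' ∈ v.localAbsIntegers := (mem_localAbsIntegers_iff_spectralValuation hw).2 hwt'.le
  have hcard : Nat.card (v.adicCompletionIntegers ℚ ⧸
      Ideal.under (v.adicCompletionIntegers ℚ) 𝔐) = p := by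
    rw [natCard_quotient_under_eq_of_mem_localPrimesAbove v h𝔐,
      WeierstrassCurve.natCard_residueField_adicCompletionIntegers v,
      Rat.HeightOneSpectrum.primesEquiv_eq_of_natCast_mem v hp.out hpv]
  have hfrob : w (τ • t' - t' ^ p) < 1 := by
    have h := hτ ⟨t', ht'mem⟩
    rw [hcard] at h
    exact (mem_iff_spectralValuation_lt_one hw h𝔐).1 h
  -- Euler: `t'^p = t' * g^{(p-1)/2} = t' * (p k) - t'`
  obtain ⟨k, hk⟩ := int_dvd_pow_div_two_add_one_of_not_split W p hp2 hmult hns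
  have hpodd : p = 2 * (p / 2) + 1 :=
    (Nat.two_mul_div_two_add_one_of_odd (hp.out.odd_of_ne_two hp2)).symm
  have htp : t' ^ p = t' * ((p : AlgebraicClosure (v.adicCompletion ℚ)) *
      (k : AlgebraicClosure (v.adicCompletion ℚ))) - t' := by
    have e1 : t' ^ p = t' * (t' ^ 2) ^ (p / 2) := by
      conv_lhs => rw [hpodd]
      rw [pow_succ, pow_mul, mul_comm]
    have e2 : ((((-((integralModelInt W).c₄ * (integralModelInt W).c₆)) : ℤ) :
        AlgebraicClosure (v.adicCompletion ℚ))) ^ (p / 2) =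
        (p : AlgebraicClosure (v.adicCompletion ℚ)) * (k : AlgebraicClosure (v.adicCompletion ℚ))
          - 1 := by
      have := congrArg (fun z : ℤ ↦ (z : AlgebraicClosure (v.adicCompletion ℚ))) hk
      push_cast at this ⊢
      linear_combination this
    rw [e1, ht'2, e2]; ring
  -- hence `|τ t' + t'| < 1`
  have hwp : w (p : AlgebraicClosure (v.adicCompletion ℚ)) < 1 := spectralValuation_natCast_lt_one hw hpv
  have hwk : w (k : AlgebraicClosure (v.adicCompletion ℚ)) ≤ 1 :=
    (mem_localAbsIntegers_iff_spectralValuation hw).1 (intCast_mem v.localAbsIntegers k)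
  have hsum : w (τ • t' + t') < 1 := by
    have e : τ • t' + t' = (τ • t' - t' ^ p) + t' * ((p : AlgebraicClosure (v.adicCompletion ℚ)) *
        (k : AlgebraicClosure (v.adicCompletion ℚ))) := by rw [htp]; ring
    rw [e]
    refine lt_of_le_of_lt (Valuation.map_add w _ _) (max_lt hfrob ?_)
    rw [map_mul, hwt', one_mul, map_mul]
    calc w (p : AlgebraicClosure (v.adicCompletion ℚ)) * w (k : AlgebraicClosure (v.adicCompletion ℚ))
        ≤ w (p : AlgebraicClosure (v.adicCompletion ℚ)) * 1 := by gcongr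
      _ < 1 := by rw [mul_one]; exact hwp
  -- `τ t = ± t`
  have hsq : (τ • t) ^ 2 = t ^ 2 := by
    rw [Field.absoluteGaloisGroup.smul_def, ← map_pow, ht, AlgEquiv.commutes]
  have hcases : τ • t = t ∨ τ • t = -t := by
    have h0 : (τ • t - t) * (τ • t + t) = 0 := by
      have : (τ • t - t) * (τ • t + t) = (τ • t) ^ 2 - t ^ 2 := by ring
      rw [this, hsq, sub_self]
    rcases mul_eq_zero.mp h0 with h | h
    · exact Or.inl (sub_eq_zero.mp h)
    · exact Or.inr (eq_neg_of_add_eq_zero_left h)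
  have hτc6 : τ • (((integralModelInt W).c₆ : ℤ) : AlgebraicClosure (v.adicCompletion ℚ)) =
      (((integralModelInt W).c₆ : ℤ) : AlgebraicClosure (v.adicCompletion ℚ)) := by
    rw [Field.absoluteGaloisGroup.smul_def, map_intCast]
  rcases hcases with h | h
  · exfalso
    have hτt' : τ • t' = t' := by rw [ht'def, smul_mul', hτc6, h]
    have h2 : ¬ (p : ℤ) ∣ (2 : ℤ) := by
      intro hd
      have : p ∣ 2 := by exact_mod_cast hd
      exact hp2 ((Nat.prime_dvd_prime_iff_eq hp.out Nat.prime_two).mp this)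
    have hw2 : w ((2 : ℤ) : AlgebraicClosure (v.adicCompletion ℚ)) = 1 :=
      spectralValuation_intCast_eq_one_of_natCast_mem hpv hw h2
    rw [hτt', ← two_mul, show (2 : AlgebraicClosure (v.adicCompletion ℚ)) =
      ((2 : ℤ) : AlgebraicClosure (v.adicCompletion ℚ)) by norm_cast, map_mul, hw2, hwt',
      one_mul] at hsum
    exact lt_irrefl _ hsum
  · exact h

end Flip

end Literature.NumberTheory.EllipticCurves.Greenberg1999.GreenbergVatsalTateFrobeniusSign

end Part11

/-!
## Part 12 — port of `Summits/BirchSwinnertonDyer/Rank1Residual/X2/GreenbergVatsalStrictSelmerMultiplicative.lean` (1 declarations kept)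

# `Sel_{p^∞}(E/ℚ_∞)` at an odd prime `p ‖ N`: it is the non-primitive strict Greenberg group of the Tate datum (`⊓` Kummer at `Σ₀`); at a non-split `p` this is GV's `S^{Σ₀}_{E[p^∞]}(ℚ_∞)` itself (`e_p

Declarations of this Part (verbatim port; each keeps its own docstring and citation): `hasMultiplicativeReductionAt_of_mem`.

Reference keys (see `references.bib` and the declarations' citations): [SilvermanAEC2009].
-/

section Part12

open scoped _root_.Classical

namespace Literature.NumberTheory.EllipticCurves.Greenberg1999.GreenbergVatsalStrictSelmerMultiplicative

open _root_.NumberField _root_.IsDedekindDomain _root_.Field Literature.NumberTheory.GaloisRepresentations Literature.NumberTheory.EllipticCurves Literature.NumberTheory.EllipticCurves.GreenbergSelmer _root_.IsDedekindDomain.HeightOneSpectrum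

variable (W : WeierstrassCurve ℚ) [W.IsGloballyMinimal] [W.IsElliptic] (p : ℕ) [hp : Fact p.Prime]
  (κ : ZpExtension ℚ p) (S₀ : Set (HeightOneSpectrum (𝓞 ℚ)))

omit [W.IsGloballyMinimal] in
/-- `HasMultiplicativeReductionAtPrime p` gives multiplicative reduction at the place `v ∋ p`.
[cite: SilvermanAEC2009, VII.5 Prop. 5.1(b)] -/
theorem hasMultiplicativeReductionAt_of_mem {v : HeightOneSpectrum (𝓞 ℚ)}
    (hmult : W.HasMultiplicativeReductionAtPrime p) (hpv : ((p : ℕ) : 𝓞 ℚ) ∈ v.asIdeal) :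
    W.HasMultiplicativeReductionAt v := by
  have hvp : (Rat.HeightOneSpectrum.primesEquiv v : ℕ) = p :=
    Rat.HeightOneSpectrum.primesEquiv_eq_of_natCast_mem v hp.out hpv
  have h := W.hasMultiplicativeReductionAtPrime_iff_hasMultiplicativeReductionAt_ringOfIntegers v
  subst hvp
  exact h.mp hmult

end Literature.NumberTheory.EllipticCurves.Greenberg1999.GreenbergVatsalStrictSelmerMultiplicative

end Part12

/-!
## Part 13 — port of `Summits/BirchSwinnertonDyer/BirchSwinnertonDyer/Theorems/ByReductionTypeAtTwoMultTransportFrobenius.lean` (3 declarations kept)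

# An arithmetic Frobenius flips `√γ(E)` at a non-split multiplicative `2`

Declarations of this Part (verbatim port; each keeps its own docstring and citation): `odd_a₁_of_not_two_dvd_c₄`, `nodal_root_zero_of_two_dvd`, `frob_smul_sqrt_gamma_eq_neg_two`.

Reference keys (see `references.bib` and the declarations' citations): [SilvermanATAEC1994], [SilvermanAEC2009].
-/

section Part13

set_option autoImplicit false

open scoped _root_.Classical AddSubgroup _root_.NNReal

universe u

namespace Literature.NumberTheory.EllipticCurves.Greenberg1999.MultTransportAtTwo

open _root_.NumberField _root_.IsDedekindDomain _root_.Field _root_.Polynomial Literature.NumberTheory.GaloisRepresentations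
  Literature.NumberTheory.EllipticCurves Literature.NumberTheory.EllipticCurves.GreenbergSelmer
  Literature.NumberTheory.EllipticCurves.GreenbergVatsal2000
  Literature.NumberTheory.EllipticCurves.Greenberg1999
  Literature.NumberTheory.EllipticCurves.ResKernel _root_.IsDedekindDomain.HeightOneSpectrum
  _root_.Rat.HeightOneSpectrum
  Literature.NumberTheory.EllipticCurves.Greenberg1999
  Literature.NumberTheory.EllipticCurves.Greenberg1999
  Literature.NumberTheory.EllipticCurves.RibetGoodLattice.GreenbergVatsalReductionDatum
open _root_.WeierstrassCurve (minimalDiscriminantInt integralModelInt)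

section Flip

variable (W : WeierstrassCurve ℚ) [W.IsElliptic] [W.IsGloballyMinimal] {v : HeightOneSpectrum (𝓞 ℚ)}

/-- `a₁` is odd when `c₄` is odd (integral Weierstrass equation): `c₄ = b₂² − 24b₄` odd forces
`b₂ = a₁² + 4a₂` odd. Silverman, *AEC* III.1. [cite: SilvermanATAEC1994, Ch. V Lemma 5.2 (c), Thm. 5.3 (a),(b), Cor. 5.4, Ex. 5.11] -/
theorem odd_a₁_of_not_two_dvd_c₄ (V : WeierstrassCurve ℤ) (h : ¬ (2 : ℤ) ∣ V.c₄) : Odd V.a₁ := by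
  rcases Int.even_or_odd V.a₁ with ⟨m, hm⟩ | hodd
  · exfalso
    apply h
    refine ⟨8 * (m ^ 2 + V.a₂) ^ 2 - 12 * V.b₄, ?_⟩
    rw [WeierstrassCurve.c₄, WeierstrassCurve.b₂, hm]
    ring
  · exact hodd

/-- If `a₁` is odd and the node-tangent constant `C = 54b₆ − 3b₂b₄ + a₂c₄` is even then `T = 0` is a
root of the node-tangent quadratic `c₄T² + a₁c₄T − C` modulo `2`. Silverman, *AEC* VII.5.1(b) (the
quadratic). [cite: SilvermanATAEC1994, Ch. V Lemma 5.2 (c), Thm. 5.3 (a),(b), Cor. 5.4, Ex. 5.11] -/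
theorem nodal_root_zero_of_two_dvd (V : WeierstrassCurve ℤ)
    (hC : (2 : ℤ) ∣ 54 * V.b₆ - 3 * V.b₂ * V.b₄ + V.a₂ * V.c₄) :
    ∃ t : ZMod 2, (V.c₄ : ZMod 2) * t ^ 2 + (V.a₁ * V.c₄ : ZMod 2) * t
      - (54 * V.b₆ - 3 * V.b₂ * V.b₄ + V.a₂ * V.c₄ : ZMod 2) = 0 := by
  refine ⟨0, ?_⟩
  have h0 : ((54 * V.b₆ - 3 * V.b₂ * V.b₄ + V.a₂ * V.c₄ : ℤ) : ZMod 2) = 0 :=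
    (ZMod.intCast_zmod_eq_zero_iff_dvd _ 2).2 hC
  push_cast at h0
  linear_combination (-1 : ZMod 2) * h0

/-- **An arithmetic Frobenius FLIPS `√γ(E)` at a NON-SPLIT multiplicative `2`.** For the globally
minimal `E/ℚ`, multiplicative and NOT split at `2`, `v ∋ 2`, `𝔐` a prime of `\bar 𝓞_v` above `𝓂_v`,
`τ ∈ Γ_{ℚ_v}` an arithmetic Frobenius at `𝔐` (`τ x ≡ x² (mod 𝔐)`), and `t ∈ ℚ̄_v` with
`t² = γ = −c₄/c₆`: `τ(t) = −t`. The `2`-adic replacement of Euler's criterion: the root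
`T₀ = (c₆t − a₁c₄)/(2c₄)` of the node-tangent quadratic is a `v`-adic integer with `τT₀ ≡ T₀²`; were
`τ t = t`, then `|(1 + a₁)T₀ − C/c₄|_v = |T₀ − T₀²|_v < 1` with `a₁` odd, so `2 ∣ C` and `T = 0` is a
root of the node-tangent quadratic mod `2`, i.e. the reduction is split. Equivalently `ℚ₂(√γ)` is the
unramified QUADRATIC extension of `ℚ₂` at a non-split `2` (Silverman *ATAEC* V Ex. 5.11 (b)).
[cite: SilvermanATAEC1994, Ch. V Lemma 5.2 (c), Thm. 5.3 (a),(b), Cor. 5.4, Ex. 5.11]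
[cite: SilvermanAEC2009, VII.5 Prop. 5.1(b)] -/
theorem frob_smul_sqrt_gamma_eq_neg_two (hmult : W.HasMultiplicativeReductionAtPrime 2)
    (hns : ¬ W.HasSplitMultiplicativeReductionAtPrime 2) (h2v : ((2 : ℕ) : 𝓞 ℚ) ∈ v.asIdeal)
    {𝔐 : Ideal v.localAbsIntegers} (h𝔐 : 𝔐 ∈ v.localPrimesAbove)
    {τ : absoluteGaloisGroup (v.adicCompletion ℚ)}
    (hτ : IsArithFrobAt (v.adicCompletionIntegers ℚ) τ 𝔐)
    (t : AlgebraicClosure (v.adicCompletion ℚ))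
    (ht : t ^ 2 = algebraMap (v.adicCompletion ℚ) (AlgebraicClosure (v.adicCompletion ℚ))
      (algebraMap ℚ (v.adicCompletion ℚ) (-(W.c₄ / W.c₆)))) :
    τ • t = -t := by
  haveI : CharZero (AlgebraicClosure (v.adicCompletion ℚ)) :=
    charZero_of_injective_algebraMap (algebraMap ℚ (AlgebraicClosure (v.adicCompletion ℚ))).injective
  obtain ⟨w, hw⟩ := v.exists_spectralValuation
  obtain ⟨hΔ, hc₄⟩ := Literature.NumberTheory.EllipticCurves.CoatesGreenberg1996.dvd_and_not_dvd_c₄_of_hasMultiplicativeReductionAtPrime W 2 hmult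
  have hc₆ := GreenbergVatsalTateDatumRat.not_dvd_c₆_of_hasMultiplicativeReductionAtPrime W hmult
  rw [Nat.cast_ofNat] at hΔ hc₄ hc₆
  set E₀ := integralModelInt W with hE₀
  have h4 : W.c₄ = (E₀.c₄ : ℚ) := by
    conv_lhs => rw [← WeierstrassCurve.map_integralModelInt W]
    rw [WeierstrassCurve.map_c₄, eq_intCast]
  have h6 : W.c₆ = (E₀.c₆ : ℚ) := by
    conv_lhs => rw [← WeierstrassCurve.map_integralModelInt W]
    rw [WeierstrassCurve.map_c₆, eq_intCast]
  have hγ : algebraMap (v.adicCompletion ℚ) (AlgebraicClosure (v.adicCompletion ℚ)) (algebraMap ℚ (v.adicCompletion ℚ) (-(W.c₄ / W.c₆))) =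
      -(((E₀.c₄ : ℤ) : AlgebraicClosure (v.adicCompletion ℚ)) / ((E₀.c₆ : ℤ) : AlgebraicClosure (v.adicCompletion ℚ))) := by
    rw [← IsScalarTower.algebraMap_apply ℚ (v.adicCompletion ℚ)
      (AlgebraicClosure (v.adicCompletion ℚ)), h4, h6, map_neg, map_div₀,
      map_intCast, map_intCast]
  have hw4 : w ((E₀.c₄ : ℤ) : AlgebraicClosure (v.adicCompletion ℚ)) = 1 :=
    spectralValuation_intCast_eq_one_of_natCast_mem h2v hw (by rwa [Nat.cast_ofNat])
  have hw6 : w ((E₀.c₆ : ℤ) : AlgebraicClosure (v.adicCompletion ℚ)) = 1 :=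
    spectralValuation_intCast_eq_one_of_natCast_mem h2v hw (by rwa [Nat.cast_ofNat])
  have hc₄0 : ((E₀.c₄ : ℤ) : AlgebraicClosure (v.adicCompletion ℚ)) ≠ 0 := by
    intro h0; rw [h0, map_zero] at hw4; exact zero_ne_one hw4
  have hc₆0 : ((E₀.c₆ : ℤ) : AlgebraicClosure (v.adicCompletion ℚ)) ≠ 0 := by
    intro h0; rw [h0, map_zero] at hw6; exact zero_ne_one hw6
  have h20 : (2 : AlgebraicClosure (v.adicCompletion ℚ)) ≠ 0 := two_ne_zero
  -- `a₁` is odd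
  obtain ⟨m, hm⟩ := odd_a₁_of_not_two_dvd_c₄ E₀ hc₄
  -- the node-tangent constant and the root `T₀`
  set C : ℤ := 54 * E₀.b₆ - 3 * E₀.b₂ * E₀.b₄ + E₀.a₂ * E₀.c₄ with hCdef
  have hdisc : (E₀.a₁ * E₀.c₄) ^ 2 + 4 * E₀.c₄ * C = -(E₀.c₄ * E₀.c₆) := by
    have h := WeierstrassCurve.discrim_nodalTangents E₀
    rw [discrim] at h
    rw [hCdef]
    linear_combination h
  set T₀ : AlgebraicClosure (v.adicCompletion ℚ) := (((E₀.c₆ : ℤ) : AlgebraicClosure (v.adicCompletion ℚ)) * t - ((E₀.a₁ : ℤ) : AlgebraicClosure (v.adicCompletion ℚ)) * ((E₀.c₄ : ℤ) : AlgebraicClosure (v.adicCompletion ℚ))) /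
    (2 * ((E₀.c₄ : ℤ) : AlgebraicClosure (v.adicCompletion ℚ))) with hT₀
  -- `T₀² + a₁ T₀ = C / c₄`
  have hT₀eq : T₀ ^ 2 + ((E₀.a₁ : ℤ) : AlgebraicClosure (v.adicCompletion ℚ)) * T₀ = ((C : ℤ) : AlgebraicClosure (v.adicCompletion ℚ)) / ((E₀.c₄ : ℤ) : AlgebraicClosure (v.adicCompletion ℚ)) := by
    have hd : (((E₀.a₁ : ℤ) : AlgebraicClosure (v.adicCompletion ℚ)) * ((E₀.c₄ : ℤ) : AlgebraicClosure (v.adicCompletion ℚ))) ^ 2 + 4 * ((E₀.c₄ : ℤ) : AlgebraicClosure (v.adicCompletion ℚ)) * ((C : ℤ) : AlgebraicClosure (v.adicCompletion ℚ)) =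
        -(((E₀.c₄ : ℤ) : AlgebraicClosure (v.adicCompletion ℚ)) * ((E₀.c₆ : ℤ) : AlgebraicClosure (v.adicCompletion ℚ))) := by
      have h := congrArg (fun z : ℤ ↦ (z : AlgebraicClosure (v.adicCompletion ℚ))) hdisc
      push_cast at h
      exact h
    have ht' : (((E₀.c₆ : ℤ) : AlgebraicClosure (v.adicCompletion ℚ)) * t) ^ 2 = -(((E₀.c₄ : ℤ) : AlgebraicClosure (v.adicCompletion ℚ)) * ((E₀.c₆ : ℤ) : AlgebraicClosure (v.adicCompletion ℚ))) := by
      rw [mul_pow, ht, hγ]; field_simp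
    rw [hT₀]
    field_simp
    linear_combination ht' - hd
  -- `T₀` is a `v`-adic integer
  have hwa₁ : w ((E₀.a₁ : ℤ) : AlgebraicClosure (v.adicCompletion ℚ)) ≤ 1 :=
    (mem_localAbsIntegers_iff_spectralValuation hw).1 (intCast_mem v.localAbsIntegers E₀.a₁)
  have hwC : w ((C : ℤ) : AlgebraicClosure (v.adicCompletion ℚ)) ≤ 1 :=
    (mem_localAbsIntegers_iff_spectralValuation hw).1 (intCast_mem v.localAbsIntegers C)
  have hwT₀ : w T₀ ≤ 1 := by
    by_contra hlt
    rw [not_le] at hlt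
    have hval : w (T₀ ^ 2 + ((E₀.a₁ : ℤ) : AlgebraicClosure (v.adicCompletion ℚ)) * T₀) ≤ 1 := by
      rw [hT₀eq, map_div₀, hw4, div_one]; exact hwC
    have hu1 : w (T₀ + ((E₀.a₁ : ℤ) : AlgebraicClosure (v.adicCompletion ℚ))) = w T₀ := by
      rw [Valuation.map_add_eq_of_lt_left]
      exact lt_of_le_of_lt hwa₁ hlt
    have : w (T₀ ^ 2 + ((E₀.a₁ : ℤ) : AlgebraicClosure (v.adicCompletion ℚ)) * T₀) = w T₀ ^ 2 := by
      rw [show T₀ ^ 2 + ((E₀.a₁ : ℤ) : AlgebraicClosure (v.adicCompletion ℚ)) * T₀ = T₀ * (T₀ + ((E₀.a₁ : ℤ) : AlgebraicClosure (v.adicCompletion ℚ))) by ring,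
        Valuation.map_mul, hu1, pow_two]
    rw [this] at hval
    exact absurd hval (not_le.mpr (one_lt_pow₀ hlt two_ne_zero))
  have hT₀mem : T₀ ∈ v.localAbsIntegers := (mem_localAbsIntegers_iff_spectralValuation hw).2 hwT₀
  -- the Frobenius congruence `τ T₀ ≡ T₀² (mod 𝔐)`
  have hcard : Nat.card (v.adicCompletionIntegers ℚ ⧸
      Ideal.under (v.adicCompletionIntegers ℚ) 𝔐) = 2 := by
    rw [natCard_quotient_under_eq_of_mem_localPrimesAbove v h𝔐,
      WeierstrassCurve.natCard_residueField_adicCompletionIntegers v,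
      Rat.HeightOneSpectrum.primesEquiv_eq_of_natCast_mem v Nat.prime_two h2v]
  have hfrob : w (τ • T₀ - T₀ ^ 2) < 1 := by
    have h := hτ ⟨T₀, hT₀mem⟩
    rw [hcard] at h
    exact (mem_iff_spectralValuation_lt_one hw h𝔐).1 h
  -- `τ t = ± t`
  have hsq : (τ • t) ^ 2 = t ^ 2 := by
    rw [Field.absoluteGaloisGroup.smul_def, ← map_pow, ht, AlgEquiv.commutes]
  have hcases : τ • t = t ∨ τ • t = -t := by
    have h0 : (τ • t - t) * (τ • t + t) = 0 := by
      have : (τ • t - t) * (τ • t + t) = (τ • t) ^ 2 - t ^ 2 := by ring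
      rw [this, hsq, sub_self]
    rcases mul_eq_zero.mp h0 with h | h
    · exact Or.inl (sub_eq_zero.mp h)
    · exact Or.inr (eq_neg_of_add_eq_zero_left h)
  rcases hcases with h | h
  · exfalso
    -- `τ T₀ = T₀`
    have hτT₀ : τ • T₀ = T₀ := by
      rw [hT₀, Field.absoluteGaloisGroup.smul_def, map_div₀, map_sub, map_mul, map_mul, map_mul,
        map_intCast, map_intCast, map_intCast, map_ofNat, ← Field.absoluteGaloisGroup.smul_def, h]
    rw [hτT₀] at hfrob
    -- `T₀ - T₀² = (1 + a₁) T₀ - C/c₄`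
    have hrew : T₀ - T₀ ^ 2 = (1 + ((E₀.a₁ : ℤ) : AlgebraicClosure (v.adicCompletion ℚ))) * T₀ - ((C : ℤ) : AlgebraicClosure (v.adicCompletion ℚ)) / ((E₀.c₄ : ℤ) : AlgebraicClosure (v.adicCompletion ℚ)) := by
      rw [← hT₀eq]; ring
    rw [hrew] at hfrob
    -- `|1 + a₁|_v < 1`
    have hw2 : w (2 : AlgebraicClosure (v.adicCompletion ℚ)) < 1 := by
      have := spectralValuation_natCast_lt_one hw h2v
      rwa [Nat.cast_ofNat] at this
    have hwa : w ((1 + ((E₀.a₁ : ℤ) : AlgebraicClosure (v.adicCompletion ℚ))) * T₀) < 1 := by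
      rw [Valuation.map_mul]
      have h1a : (1 + ((E₀.a₁ : ℤ) : AlgebraicClosure (v.adicCompletion ℚ))) = 2 * (((m + 1 : ℤ)) : AlgebraicClosure (v.adicCompletion ℚ)) := by
        rw [hm]; push_cast; ring
      rw [h1a, Valuation.map_mul]
      calc w (2 : AlgebraicClosure (v.adicCompletion ℚ)) * w (((m + 1 : ℤ)) : AlgebraicClosure (v.adicCompletion ℚ)) * w T₀ ≤ w (2 : AlgebraicClosure (v.adicCompletion ℚ)) * 1 * 1 := by
            gcongr
            · exact (mem_localAbsIntegers_iff_spectralValuation hw).1 (intCast_mem v.localAbsIntegers _)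
        _ < 1 := by rw [mul_one, mul_one]; exact hw2
    -- hence `|C/c₄|_v < 1`, so `2 ∣ C`
    have hwCc : w (((C : ℤ) : AlgebraicClosure (v.adicCompletion ℚ)) / ((E₀.c₄ : ℤ) : AlgebraicClosure (v.adicCompletion ℚ))) < 1 := by
      have e : ((C : ℤ) : AlgebraicClosure (v.adicCompletion ℚ)) / ((E₀.c₄ : ℤ) : AlgebraicClosure (v.adicCompletion ℚ)) =
          (1 + ((E₀.a₁ : ℤ) : AlgebraicClosure (v.adicCompletion ℚ))) * T₀ - ((1 + ((E₀.a₁ : ℤ) : AlgebraicClosure (v.adicCompletion ℚ))) * T₀ -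
            ((C : ℤ) : AlgebraicClosure (v.adicCompletion ℚ)) / ((E₀.c₄ : ℤ) : AlgebraicClosure (v.adicCompletion ℚ))) := by ring
      rw [e]
      exact lt_of_le_of_lt (Valuation.map_sub w _ _) (max_lt hwa hfrob)
    rw [map_div₀, hw4, div_one] at hwCc
    have h2C : (2 : ℤ) ∣ C := by
      by_contra hnd
      have hwC1 : w ((C : ℤ) : AlgebraicClosure (v.adicCompletion ℚ)) = 1 :=
        spectralValuation_intCast_eq_one_of_natCast_mem h2v hw (by rwa [Nat.cast_ofNat])
      rw [hwC1] at hwCc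
      exact lt_irrefl _ hwCc
    -- so the node-tangent quadratic has the root `0` mod `2`: the reduction is split
    apply hns
    haveI : Fact (Nat.Prime 2) := ⟨Nat.prime_two⟩
    refine Literature.NumberTheory.EllipticCurves.Rank1Residual.IntModel.hasSplitMultiplicativeReductionAtPrime_of_intModel_of_root
      (W := W) (E₀ := E₀) hE₀.symm 2 (by exact_mod_cast hΔ) (by exact_mod_cast hc₄) ?_
    have := nodal_root_zero_of_two_dvd E₀ (by rw [hCdef] at h2C; exact h2C)
    exact_mod_cast this
  · exact h

end Flip

end Literature.NumberTheory.EllipticCurves.Greenberg1999.MultTransportAtTwo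

end Part13

/-!
## Part 14 — port of `Summits/BirchSwinnertonDyer/BirchSwinnertonDyer/Theorems/ByReductionTypeAtTwoMultTowerNS2FlipInKer.lean` (1 declarations kept)

# Kernel brick 10 — an element of `H_∞ = Gal(ℚ̄₂/ℚ_{2,∞})` flips `√γ` at a non-split multiplicative `2` (the twist character of the Tate uniformisation is non-trivial

Declarations of this Part (verbatim port; each keeps its own docstring and citation): `exists_mem_localSubgroup_kerSubgroup_smul_sqrt_gamma_eq_neg`.

Reference keys (see `references.bib` and the declarations' citations): [SilvermanATAEC1994], [Washington1997].
-/

section Part14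

set_option autoImplicit false
open scoped _root_.Classical

namespace Literature.NumberTheory.EllipticCurves.Greenberg1999.MultTowerNS2

open _root_.NumberField _root_.IsDedekindDomain _root_.Field _root_.WeierstrassCurve Literature.NumberTheory.EllipticCurves
  Literature.NumberTheory.GaloisRepresentations

variable (W : WeierstrassCurve ℚ) [W.IsElliptic] [W.IsGloballyMinimal] {κ : ZpExtension ℚ 2}

/-- **Some `τ ∈ H_∞ = Gal(ℚ̄₂/ℚ_{2,∞})` flips `√γ(W)`** at a NON-SPLIT multiplicative `2`: for the cyclotomic `ℤ₂`-extension
`κ`, the place `v ∋ 2` and every `t ∈ K̄_v` with `t² = γ(W) = −c₄/c₆`, there is `τ` in the local kernel subgroup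
`localSubgroup κ.kerSubgroup ℚ_v` (restriction in `ker κ = Gal(ℚ̄/ℚ_∞)`) with `τ • t = −t` — an arithmetic Frobenius of
`ℚ_v` lying in `H_∞` (total ramification of `2` in `ℚ_∞`, tree
`ZpExtension.IsCyclotomic.exists_isArithFrobAt_resGal_mem_kerSubgroup`), which flips `t` by
`MultTransportAtTwo.frob_smul_sqrt_gamma_eq_neg_two`. [cite: SilvermanATAEC1994, Ch. V Lemma 5.2 (c), Thm. 5.3, Ex. 5.11]
[cite: Washington1997, §13.1] -/
theorem exists_mem_localSubgroup_kerSubgroup_smul_sqrt_gamma_eq_neg (hκ : κ.IsCyclotomic)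
    (hmult : W.HasMultiplicativeReductionAtPrime 2) (hns : ¬ W.HasSplitMultiplicativeReductionAtPrime 2)
    (v : HeightOneSpectrum (𝓞 ℚ)) (h2v : ((2 : ℕ) : 𝓞 ℚ) ∈ v.asIdeal)
    (t : AlgebraicClosure (v.adicCompletion ℚ))
    (ht : t ^ 2 = algebraMap (v.adicCompletion ℚ) (AlgebraicClosure (v.adicCompletion ℚ))
      (algebraMap ℚ (v.adicCompletion ℚ) (-(W.c₄ / W.c₆)))) :
    ∃ τ : absoluteGaloisGroup (v.adicCompletion ℚ),
      τ ∈ localSubgroup κ.kerSubgroup (v.adicCompletion ℚ) ∧ τ • t = -t := by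
  obtain ⟨𝔐, h𝔐⟩ := v.localPrimesAbove_nonempty
  obtain ⟨w, hw⟩ := v.exists_spectralValuation
  have hϖ : Irreducible ((2 : ℕ) : v.adicCompletionIntegers ℚ) :=
    IsDedekindDomain.HeightOneSpectrum.irreducible_natCast_adicCompletionIntegers_rat h2v
  obtain ⟨τ, hτF, hτker⟩ := hκ.exists_isArithFrobAt_resGal_mem_kerSubgroup hw h𝔐 h2v hϖ
  exact ⟨τ, (mem_localSubgroup_iff κ.kerSubgroup (v.adicCompletion ℚ) τ).mpr hτker,
    MultTransportAtTwo.frob_smul_sqrt_gamma_eq_neg_two W hmult hns h2v h𝔐 hτF t ht⟩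

end Literature.NumberTheory.EllipticCurves.Greenberg1999.MultTowerNS2

end Part14

/-!
## Part 15 — port of `Summits/BirchSwinnertonDyer/BirchSwinnertonDyer/Theorems/ByReductionTypeAtTwoMultTowerNSOddCoboundary.lean` (2 declarations kept)

# Greenberg 1999 §3 at a non-split multiplicative odd `p`, part 2 — the odd-`p` coboundary lemma: a `p^k`-torsion class of the twisted Tate module modulo `(g − 1)` is a c

Declarations of this Part (verbatim port; each keeps its own docstring and citation): `exists_mem_localSubgroup_kerSubgroup_smul_sqrt_gamma_eq_neg_odd`, `exists_eq_zpow_mul_coboundary_of_pow_eq_odd`.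

Reference keys (see `references.bib` and the declarations' citations): [GreenbergLNM1716], [SilvermanATAEC1994], [Washington1997], [NeukirchANT1999].
-/

section Part15

set_option autoImplicit false
open scoped _root_.Classical

namespace Literature.NumberTheory.EllipticCurves.Greenberg1999.MultTowerNSOdd

open _root_.NumberField _root_.IsDedekindDomain _root_.Field _root_.PadicInt _root_.WeierstrassCurve Literature.NumberTheory.EllipticCurves
  Literature.NumberTheory.GaloisRepresentations

variable {p : ℕ} [hp : Fact p.Prime]

/-! ### A flip `τ₀ ∈ H_∞` at a non-split multiplicative ODD `p` -/

/-- **Some `τ₀ ∈ H_∞ = Gal(ℚ̄_p/ℚ_{p,∞})` flips `√γ(W)`** at a NON-SPLIT multiplicative ODD `p`: for the cyclotomic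
`ℤ_p`-extension `κ`, the place `v ∋ p` and every `t ∈ K̄_v` with `t² = γ(W) = −c₄/c₆`, there is `τ₀` in the local kernel
subgroup `localSubgroup κ.kerSubgroup ℚ_v` with `τ₀ • t = −t` — an arithmetic Frobenius of `ℚ_v` lying in `H_∞` (total
ramification of `p` in `ℚ_∞`, tree `ZpExtension.IsCyclotomic.exists_isArithFrobAt_resGal_mem_kerSubgroup`), which flips `t`
by X2's `GreenbergVatsalTateFrobeniusSign.frob_smul_sqrt_gamma_eq_neg` (`c₄, c₆` are `p`-units and `−c₄c₆` is a non-square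
mod `p` at a non-split prime; `p` odd). The odd-`p` sibling of BRICK 10
`MultTowerNS2.exists_mem_localSubgroup_kerSubgroup_smul_sqrt_gamma_eq_neg`; in particular the twist character of the Tate
uniformisation is non-trivial on `Gal(ℚ̄_p/ℚ_{p,n})` for every `n` (`E` stays NON-SPLIT over every layer).
[cite: GreenbergLNM1716, §3 p. 93] [cite: SilvermanATAEC1994, Ch. V Lemma 5.2 (c), Thm. 5.3, Ex. 5.11] [cite: Washington1997, §13.1] -/
theorem exists_mem_localSubgroup_kerSubgroup_smul_sqrt_gamma_eq_neg_odd {κ : ZpExtension ℚ p} (W : WeierstrassCurve ℚ)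
    [W.IsElliptic] [W.IsGloballyMinimal] (hκ : κ.IsCyclotomic) (hp2 : p ≠ 2)
    (hmult : W.HasMultiplicativeReductionAtPrime p) (hns : ¬ W.HasSplitMultiplicativeReductionAtPrime p)
    (v : HeightOneSpectrum (𝓞 ℚ)) (hpv : ((p : ℕ) : 𝓞 ℚ) ∈ v.asIdeal)
    (t : AlgebraicClosure (v.adicCompletion ℚ))
    (ht : t ^ 2 = algebraMap (v.adicCompletion ℚ) (AlgebraicClosure (v.adicCompletion ℚ))
      (algebraMap ℚ (v.adicCompletion ℚ) (-(W.c₄ / W.c₆)))) :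
    ∃ τ : absoluteGaloisGroup (v.adicCompletion ℚ),
      τ ∈ localSubgroup κ.kerSubgroup (v.adicCompletion ℚ) ∧ τ • t = -t := by
  obtain ⟨𝔐, h𝔐⟩ := v.localPrimesAbove_nonempty
  obtain ⟨w, hw⟩ := v.exists_spectralValuation
  have hϖ : Irreducible ((p : ℕ) : v.adicCompletionIntegers ℚ) :=
    IsDedekindDomain.HeightOneSpectrum.irreducible_natCast_adicCompletionIntegers_rat hpv
  obtain ⟨τ, hτF, hτker⟩ := hκ.exists_isArithFrobAt_resGal_mem_kerSubgroup hw h𝔐 hpv hϖ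
  exact ⟨τ, (mem_localSubgroup_iff κ.kerSubgroup (v.adicCompletion ℚ) τ).mpr hτker,
    GreenbergVatsalTateFrobeniusSign.frob_smul_sqrt_gamma_eq_neg W hp2 hmult hns hpv h𝔐 hτF t ht⟩

/-! ### The odd-`p` coboundary lemma -/

set_option maxHeartbeats 800000 in
/-- **The odd-`p` coboundary lemma: every `p^k`-torsion class of `T/(g−1)T·Q^ℤ` is zero.** Data: `κ` cyclotomic, `v`,
`g` with `κ(res g) = p^n u_g` fixing `t` (`σ t = ±t` for all `σ`), a flip `τ₀ ∈ H_∞`, the `Γ`-fixed `Q ≠ 0` of infinite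
order, `p` ODD; `x ≠ 0` fixed by `H_∞ ∩ Stab(t)` with `τ₀x·x = Q^a`, `z ≠ 0` fixed by `H_∞ ∩ Stab(t)` with
`τ₀z·z = Q^{j_z}`, and `x^{p^k} = Q^j · g(z)/z`. Then `x = Q^c · g(w)/w` for some `c ∈ ℤ` and some `w ≠ 0` fixed by
`H_∞ ∩ Stab(t)` with `τ₀w·w = Q^{j_w}`. Proof in the module docstring (parity of the exponent at odd `p`; orbit product
`N_{R+k}(x₀) = 1`; cyclic Hilbert 90; the explicit witness `w = y^{p^k+1}/((y·τ₀y)^e z)`, `2e = p^k + 1`).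
[cite: GreenbergLNM1716, §3 (pp. 87–93)] [cite: NeukirchANT1999, Ch. IV (3.5)] -/
theorem exists_eq_zpow_mul_coboundary_of_pow_eq_odd {κ : ZpExtension ℚ p} (hp2 : p ≠ 2) (v : HeightOneSpectrum (𝓞 ℚ))
    (n : ℕ) {g : absoluteGaloisGroup (v.adicCompletion ℚ)} {ug : ℤ_[p]ˣ}
    (hug : ((κ (resGal (K := ℚ) (v.adicCompletion ℚ) g)).toAdd : ℤ_[p]) = (p : ℤ_[p]) ^ n * (ug : ℤ_[p]))
    {t : AlgebraicClosure (v.adicCompletion ℚ)}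
    (ht : ∀ σ : absoluteGaloisGroup (v.adicCompletion ℚ), σ • t = t ∨ σ • t = -t) (hgt : g • t = t)
    {τ₀ : absoluteGaloisGroup (v.adicCompletion ℚ)} (hτ₀ : τ₀ ∈ localSubgroup κ.kerSubgroup (v.adicCompletion ℚ))
    (hτ₀t : τ₀ • t = -t) {Q : AlgebraicClosure (v.adicCompletion ℚ)}
    (hQfix : ∀ σ : absoluteGaloisGroup (v.adicCompletion ℚ), σ • Q = Q) (hQ0 : Q ≠ 0)
    (hQtor : ∀ j : ℤ, Q ^ j = 1 → j = 0)
    {x : AlgebraicClosure (v.adicCompletion ℚ)} (hx0 : x ≠ 0)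
    (hxL : ∀ h ∈ localSubgroup κ.kerSubgroup (v.adicCompletion ℚ), h • t = t → h • x = x)
    {a : ℤ} (hxa : τ₀ • x * x = Q ^ a)
    {z : AlgebraicClosure (v.adicCompletion ℚ)} (hz0 : z ≠ 0)
    (hzL : ∀ h ∈ localSubgroup κ.kerSubgroup (v.adicCompletion ℚ), h • t = t → h • z = z)
    {jz : ℤ} (hzj : τ₀ • z * z = Q ^ jz) (k : ℕ) {j : ℤ} (hxk : x ^ p ^ k = Q ^ j * (g • z / z)) :
    ∃ (w : AlgebraicClosure (v.adicCompletion ℚ)) (c jw : ℤ), w ≠ 0 ∧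
      (∀ h ∈ localSubgroup κ.kerSubgroup (v.adicCompletion ℚ), h • t = t → h • w = w) ∧
      τ₀ • w * w = Q ^ jw ∧ x = Q ^ c * (g • w / w) := by
  -- normality of the local subgroups
  haveI hHin : (localSubgroup κ.kerSubgroup (v.adicCompletion ℚ)).Normal := by
    rw [localSubgroup_eq_comap]; exact Subgroup.Normal.comap inferInstance _
  have hHmn : ∀ m, (localSubgroup (κ.layerSubgroup m) (v.adicCompletion ℚ)).Normal := fun m ↦ by
    rw [localSubgroup_eq_comap]; exact Subgroup.Normal.comap inferInstance _
  have hile : ∀ m, localSubgroup κ.kerSubgroup (v.adicCompletion ℚ) ≤ localSubgroup (κ.layerSubgroup m) (v.adicCompletion ℚ) :=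
    fun m τ hτ ↦ by
      rw [mem_localSubgroup_iff] at hτ ⊢
      exact κ.kerSubgroup_le_layerSubgroup m hτ
  have hgit : ∀ i : ℕ, (g ^ i) • t = t := fun i ↦ by
    induction i with
    | zero => rw [pow_zero, one_smul]
    | succ i ih => rw [pow_succ, mul_smul, hgt, ih]
  -- (1) the exponent `a` is EVEN: `Q^{a p^k} = Q^{2j}` and `p^k` is odd
  have hcob : τ₀ • (g • z / z) * (g • z / z) = 1 :=
    MultTowerNS2.flip_smul_coboundary_mul_coboundary ht hτ₀ hτ₀t hgt hQ0 (hQfix g) hz0 hzL hzj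
  have h1 : τ₀ • (x ^ p ^ k) * x ^ p ^ k = Q ^ (a * ((p ^ k : ℕ) : ℤ)) := by
    rw [smul_pow', ← mul_pow, hxa, ← zpow_natCast, ← zpow_mul]
  have h2 : τ₀ • (x ^ p ^ k) * x ^ p ^ k = Q ^ (2 * j) := by
    rw [hxk, smul_mul', smul_zpow₀', hQfix τ₀, two_mul, zpow_add₀ hQ0]
    linear_combination (Q ^ j * Q ^ j) * hcob
  have h3 : Q ^ (a * ((p ^ k : ℕ) : ℤ) - 2 * j) = 1 := by
    rw [zpow_sub₀ hQ0, ← h1, h2, div_self (zpow_ne_zero _ hQ0)]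
  have h4 := hQtor _ h3
  have hoddpk : Odd (p ^ k) := (hp.out.odd_of_ne_two hp2).pow
  have hoddZ : Odd ((p ^ k : ℕ) : ℤ) := by exact_mod_cast hoddpk
  have heven : Even (a * ((p ^ k : ℕ) : ℤ)) := ⟨j, by linarith⟩
  obtain ⟨c, hc⟩ : Even a := by
    rcases Int.even_mul.mp heven with ha | hm
    · exact ha
    · exact absurd hm (Int.not_even_iff_odd.mpr hoddZ)
  have hj : j = c * ((p ^ k : ℕ) : ℤ) := by
    rw [hc, add_mul] at h4
    linarith
  -- (2) `x₀ = x / Q^c`: `τ₀x₀·x₀ = 1`, `x₀^{p^k} = g z / z`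
  have hQc0 : Q ^ c ≠ 0 := zpow_ne_zero _ hQ0
  set x₀ : AlgebraicClosure (v.adicCompletion ℚ) := x / Q ^ c with hx₀
  have hx₀0 : x₀ ≠ 0 := div_ne_zero hx0 hQc0
  have hx₀L : ∀ h ∈ localSubgroup κ.kerSubgroup (v.adicCompletion ℚ), h • t = t → h • x₀ = x₀ := fun h hh hht ↦ by
    rw [hx₀, smul_div₀', smul_zpow₀', hQfix h, hxL h hh hht]
  have hx₀U : τ₀ • x₀ * x₀ = 1 := by
    have e1 : τ₀ • x₀ * x₀ = (τ₀ • x * x) / (Q ^ c * Q ^ c) := by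
      rw [hx₀, smul_div₀', smul_zpow₀', hQfix τ₀]; ring
    rw [e1, hxa, hc, zpow_add₀ hQ0, div_self (mul_ne_zero hQc0 hQc0)]
  have hx₀k : x₀ ^ p ^ k = g • z / z := by
    have e1 : Q ^ j = (Q ^ c) ^ p ^ k := by rw [hj, zpow_mul, zpow_natCast]
    rw [hx₀, div_pow, hxk, e1, mul_div_cancel_left₀ _ (pow_ne_zero _ hQc0)]
  have hgz : g • z = x₀ ^ p ^ k * z := by rw [hx₀k, div_mul_cancel₀ _ hz0]
  -- (3) a common finite level `n + R`, the orbit product `N_{R+k}(x₀) = 1`, and cyclic Hilbert 90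
  obtain ⟨R, hxR, hzR⟩ := exists_forall_mem_localSubgroup_layerSubgroup_add_smul_eq₂ (κ := κ) v n t x₀ z hx₀L hzL
  have hgRmem : g ^ p ^ R ∈ localSubgroup (κ.layerSubgroup (n + R)) (v.adicCompletion ℚ) :=
    (MultTowerSP1.pow_mem_localSubgroup_layerSubgroup_iff (κ := κ) v n R hug _).mpr dvd_rfl
  have hgRx : (g ^ p ^ R) • x₀ = x₀ := hxR _ hgRmem (hgit _)
  have hgRz : (g ^ p ^ R) • z = z := hzR _ hgRmem (hgit _)
  have hprodz : (∏ i ∈ Finset.range (p ^ R), (g ^ i) • (g • z / z)) = 1 := by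
    rw [Finset.prod_congr rfl fun i _ ↦ show (g ^ i) • (g • z / z) = (g ^ i) • (g • z) * (g ^ i) • z⁻¹ by
        rw [div_eq_mul_inv, smul_mul'], Finset.prod_mul_distrib, MultTowerNS2.prod_smul_smul_eq g (p ^ R) hgRz,
      MultTowerNS2.prod_smul_inv, mul_inv_cancel₀]
    exact Finset.prod_ne_zero_iff.mpr fun i _ ↦ (smul_ne_zero_iff_ne _).mpr hz0
  have hNRk : (∏ i ∈ Finset.range (p ^ R), (g ^ i) • x₀) ^ p ^ k = 1 := by
    rw [← MultTowerSP1.prod_smul_pow, hx₀k, hprodz]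
  have hNR1 : (∏ i ∈ Finset.range (p ^ (R + k)), (g ^ i) • x₀) = 1 := by
    rw [pow_add, MultTowerSP1.prod_smul_range_mul_eq_pow g (p ^ R) hgRx (p ^ k), hNRk]
  have hx₀R' : ∀ h ∈ localSubgroup (κ.layerSubgroup (n + (R + k))) (v.adicCompletion ℚ), h • t = t → h • x₀ = x₀ :=
    fun h hh hht ↦ hxR h (MultTowerSP1.localSubgroup_layerSubgroup_antitone κ (v.adicCompletion ℚ) (by omega) hh) hht
  obtain ⟨y, hy0, hyR, hxy⟩ := exists_eq_smul_div_of_prod_smul_eq_one (κ := κ) v n (R + k) hug ht hgt hx₀R' hNR1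
  have hyL : ∀ h ∈ localSubgroup κ.kerSubgroup (v.adicCompletion ℚ), h • t = t → h • y = y :=
    fun h hh hht ↦ hyR h (hile _ hh) hht
  haveI := hHmn (n + (R + k))
  have hτyR : ∀ h ∈ localSubgroup (κ.layerSubgroup (n + (R + k))) (v.adicCompletion ℚ), h • t = t →
      h • (τ₀ • y) = τ₀ • y :=
    MultTowerNS2.smul_mem_of_forall_mem_smul_eq ht _ hyR τ₀
  have hτyL : ∀ h ∈ localSubgroup κ.kerSubgroup (v.adicCompletion ℚ), h • t = t → h • (τ₀ • y) = τ₀ • y :=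
    fun h hh hht ↦ hτyR h (hile _ hh) hht
  have hτy0 : τ₀ • y ≠ 0 := (smul_ne_zero_iff_ne τ₀).mpr hy0
  have hgy : g • y = x₀ * y := by rw [hxy, div_mul_cancel₀ _ hy0]
  -- (4) the norm `c_y = y · τ₀y` is fixed by `g` and by `τ₀`
  set cy : AlgebraicClosure (v.adicCompletion ℚ) := y * τ₀ • y with hcy
  have hcy0 : cy ≠ 0 := mul_ne_zero hy0 hτy0
  have hgcy : g • cy = cy := by
    rw [hcy, smul_mul', ← MultTowerNS2.flip_smul_smul_comm ht hτ₀ hτ₀t hgt hyL, hgy, smul_mul']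
    linear_combination (y * τ₀ • y) * hx₀U
  have hτcy : τ₀ • cy = cy := by
    rw [hcy, smul_mul', MultTowerNS2.flip_smul_flip_smul hτ₀ hτ₀t hyL, mul_comm]
  have hhcy : ∀ h ∈ localSubgroup κ.kerSubgroup (v.adicCompletion ℚ), h • t = t → h • cy = cy := fun h hh hht ↦ by
    rw [hcy, smul_mul', hyL h hh hht, hτyL h hh hht]
  -- (5) `p^k + 1 = 2e` and the witness `w = y^{p^k+1} / (c_y^e z)`
  obtain ⟨e, he⟩ : Even (p ^ k + 1) := hoddpk.add_odd odd_one
  set w : AlgebraicClosure (v.adicCompletion ℚ) := y ^ (p ^ k + 1) / (cy ^ e * z) with hw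
  have hden0 : cy ^ e * z ≠ 0 := mul_ne_zero (pow_ne_zero _ hcy0) hz0
  have hw0 : w ≠ 0 := div_ne_zero (pow_ne_zero _ hy0) hden0
  refine ⟨w, c, -jz, hw0, fun h hh hht ↦ ?_, ?_, ?_⟩
  · -- fixed by `H_∞ ∩ Stab(t)`
    rw [hw, smul_div₀', smul_pow', smul_mul', smul_pow', hyL h hh hht, hhcy h hh hht, hzL h hh hht]
  · -- `τ₀w · w = Q^{-j_z}`
    have e1 : τ₀ • w * w = (τ₀ • y * y) ^ (p ^ k + 1) / (cy ^ e * cy ^ e * (τ₀ • z * z)) := by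
      rw [hw, smul_div₀', smul_pow', smul_mul', smul_pow', hτcy, div_mul_div_comm, ← mul_pow]
      congr 1
      ring
    rw [e1, mul_comm (τ₀ • y) y, ← hcy, ← pow_add, ← he, hzj, div_mul_eq_div_div, div_self (pow_ne_zero _ hcy0),
      one_div, zpow_neg]
  · -- `x = Q^c · g(w)/w`
    have hgw : g • w = (x₀ * y) ^ (p ^ k + 1) / (cy ^ e * (x₀ ^ p ^ k * z)) := by
      rw [hw, smul_div₀', smul_pow', smul_mul', smul_pow', hgcy, hgy, hgz]
    have hquot : g • w / w = x₀ := by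
      rw [div_eq_iff hw0, hgw, hw]
      field_simp
      ring
    rw [hquot, hx₀, mul_div_assoc', mul_div_cancel_left₀ _ hQc0]

end Literature.NumberTheory.EllipticCurves.Greenberg1999.MultTowerNSOdd

end Part15

/-!
## Part 16 — port of `Summits/BirchSwinnertonDyer/BirchSwinnertonDyer/Theorems/ByReductionTypeAtTwoMultTowerNSOddHolds.lean` (3 declarations kept)

# Greenberg 1999 §3 at a non-split multiplicative odd `p`, part 3 — `𝒦_{v,n}[p^∞] = 0` at every layer, and the named fact `Greenberg1999.sec3_localTowerKerPrimary_eq_bo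

Declarations of this Part (verbatim port; each keeps its own docstring and citation): `powTorsion_localTowerKerPrimary_card_le_one_nonsplitOdd`, `localTowerKerPrimary_eq_bot_nonsplitOdd`, `sec3_localTowerKerPrimary_eq_bot_nonsplitMultiplicative_odd_rat_holds`.

Reference keys (see `references.bib` and the declarations' citations): [GreenbergLNM1716], [SilvermanATAEC1994], [NeukirchANT1999], [Washington1997].
-/

section Part16

set_option autoImplicit false
open scoped _root_.Classical

namespace Literature.NumberTheory.EllipticCurves.Greenberg1999.MultTowerNSOdd

open _root_.NumberField _root_.IsDedekindDomain _root_.Field _root_.WeierstrassCurve _root_.PadicInt _root_.Rat.HeightOneSpectrum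
  Literature.NumberTheory.EllipticCurves Literature.NumberTheory.EllipticCurves.ResKernel
  Literature.NumberTheory.GaloisRepresentations

variable {p : ℕ} [hp : Fact p.Prime] {κ : ZpExtension ℚ p}

/-! ### `#𝒦_{v,n}[p^∞][p^k] ≤ 1` at every non-split multiplicative odd `p` -/

set_option maxHeartbeats 800000 in
/-- **`𝒦_{v,n}[p^∞][p^k]` has at most one element at EVERY non-split multiplicative ODD `p`, every `k` — KERNEL theorem.**
For a globally minimal `W/ℚ`, multiplicative and NON-SPLIT at the odd prime `p`, every cyclotomic `ℤ_p`-datum `κ`, the place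
`v ∋ p`, every layer `n` and every `k`, the `p^k`-torsion of the local tower kernel `𝒦_{v,n}[p^∞]` is finite with at most
one element. Proof: BRICK 11 (at `m = p^k`) embeds it into the `p^k`-torsion of `M_∞/(g−1)M_∞`; Tate's twisted
uniformisation identifies `M_∞` with `Ψ(T)` (part 1); by the odd-`p` coboundary lemma (part 2) every `p^k`-torsion class
of `M_∞/(g−1)M_∞` vanishes. [cite: GreenbergLNM1716, §3 (pp. 85–93)] [cite: SilvermanATAEC1994, Thm. V.5.3, Lemma V.5.2 (c)]
[cite: NeukirchANT1999, Ch. IV (3.5)] -/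
theorem powTorsion_localTowerKerPrimary_card_le_one_nonsplitOdd (hp2 : p ≠ 2) (W : WeierstrassCurve ℚ) [W.IsElliptic]
    [W.IsGloballyMinimal] (hmult : W.HasMultiplicativeReductionAtPrime p)
    (hns : ¬ W.HasSplitMultiplicativeReductionAtPrime p) (hκ : κ.IsCyclotomic) (v : HeightOneSpectrum (𝓞 ℚ))
    (hv : ((p : ℕ) : 𝓞 ℚ) ∈ v.asIdeal) (n k : ℕ) :
    Finite {x : W.localTowerKerPrimary κ (v.adicCompletion ℚ) n // p ^ k • x = 0} ∧
      Nat.card {x : W.localTowerKerPrimary κ (v.adicCompletion ℚ) n // p ^ k • x = 0} ≤ 1 := by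
  have hile : localSubgroup κ.kerSubgroup (v.adicCompletion ℚ) ≤ localSubgroup (κ.layerSubgroup n) (v.adicCompletion ℚ) :=
    fun τ hτ ↦ by
      rw [mem_localSubgroup_iff] at hτ ⊢
      exact κ.kerSubgroup_le_layerSubgroup n hτ
  -- S0: multiplicative reduction at the place `v`
  have hmultv : W.HasMultiplicativeReductionAt v :=
    GreenbergVatsalStrictSelmerMultiplicative.hasMultiplicativeReductionAt_of_mem W p hmult hv
  -- Tate's twisted uniformisation at `v`
  obtain ⟨q, t, Ψ, hq0, hqv, -, -, ht0, ht2, hsurj, hker, hequiv⟩ :=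
    TateCurve.exists_twistedTateUniformisation_tateJ W v hmultv
  set Q : AlgebraicClosure (v.adicCompletion ℚ) :=
    algebraMap (v.adicCompletion ℚ) (AlgebraicClosure (v.adicCompletion ℚ)) q with hQ
  have hQ0 : Q ≠ 0 := by rw [hQ]; exact (map_ne_zero _).mpr hq0
  have hQfix : ∀ σ : absoluteGaloisGroup (v.adicCompletion ℚ), σ • Q = Q := fun σ ↦
    AlgEquiv.commutes (absoluteGaloisGroup.toAlgEquiv _ σ) q
  have hQtor : ∀ j : ℤ, Q ^ j = 1 → j = 0 := by
    intro j hj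
    have hj' : q ^ j = 1 := by
      apply (algebraMap (v.adicCompletion ℚ) (AlgebraicClosure (v.adicCompletion ℚ))).injective
      rw [map_zpow₀, map_one]; exact hj
    have hq1 : ‖q‖ < 1 := Valued.toNormedField.norm_lt_one_iff.mpr hqv
    have hpow : ∀ m : ℕ, q ^ m = 1 → m = 0 := fun m hm ↦ by
      by_contra hm0
      have h1 : ‖q‖ ^ m < 1 := pow_lt_one₀ (norm_nonneg q) hq1 hm0
      rw [← norm_pow, hm, norm_one] at h1
      exact lt_irrefl _ h1
    cases j with
    | ofNat m =>
      rw [Int.ofNat_eq_natCast, zpow_natCast] at hj'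
      rw [Int.ofNat_eq_natCast, hpow m hj']
      rfl
    | negSucc m =>
      rw [zpow_negSucc, inv_eq_one] at hj'
      exact absurd (hpow (m + 1) hj') (Nat.succ_ne_zero m)
  -- `σ t = ± t`, `-t ≠ t`
  have ht : ∀ σ : absoluteGaloisGroup (v.adicCompletion ℚ), σ • t = t ∨ σ • t = -t := fun σ ↦ by
    apply sq_eq_sq_iff_eq_or_eq_neg.mp
    rw [← smul_pow', ht2]
    exact AlgEquiv.commutes (absoluteGaloisGroup.toAlgEquiv _ σ) _
  have hne : -t ≠ t := by
    haveI : CharZero (AlgebraicClosure (v.adicCompletion ℚ)) :=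
      charZero_of_injective_algebraMap (algebraMap ℚ (AlgebraicClosure (v.adicCompletion ℚ))).injective
    intro h
    exact ht0 (CharZero.neg_eq_self_iff.mp h)
  -- equivariance in value form
  have hequiv' : ∀ (σ : absoluteGaloisGroup (v.adicCompletion ℚ)) (w w' : (AlgebraicClosure (v.adicCompletion ℚ))ˣ),
      (w' : AlgebraicClosure (v.adicCompletion ℚ)) = σ • (w : AlgebraicClosure (v.adicCompletion ℚ)) →
        σ • Ψ (Additive.ofMul w) = (if σ • t = t then (1 : ℤ) else -1) • Ψ (Additive.ofMul w') := by
    intro σ w w' h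
    have hw' : w' = Units.map (absoluteGaloisGroup.toAlgEquiv (v.adicCompletion ℚ) σ :
        AlgebraicClosure (v.adicCompletion ℚ) →* AlgebraicClosure (v.adicCompletion ℚ)) w := Units.ext h
    rw [hw']
    exact hequiv σ w
  -- the flip `τ₀ ∈ H_∞` (odd `p`)
  obtain ⟨τ₀, hτ₀, hτ₀t⟩ :=
    exists_mem_localSubgroup_kerSubgroup_smul_sqrt_gamma_eq_neg_odd (κ := κ) W hκ hp2 hmult hns v hv t ht2
  -- a topological generator `g ∈ H_n` of `H_n` modulo `H_∞` FIXING `t`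
  obtain ⟨g, hgn, hgen, hgt⟩ : ∃ g ∈ localSubgroup (κ.layerSubgroup n) (v.adicCompletion ℚ),
      (∀ U : Subgroup (absoluteGaloisGroup (v.adicCompletion ℚ)),
        IsOpen (U : Set (absoluteGaloisGroup (v.adicCompletion ℚ))) →
          localSubgroup κ.kerSubgroup (v.adicCompletion ℚ) ≤ U → g ∈ U →
            localSubgroup (κ.layerSubgroup n) (v.adicCompletion ℚ) ≤ U) ∧ g • t = t := by
    obtain ⟨g₀, hg₀, hg₀gen⟩ := ZpExtension.exists_mem_localSubgroup_generate κ (v.adicCompletion ℚ) n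
    rcases ht g₀ with h | h
    · exact ⟨g₀, hg₀, hg₀gen, h⟩
    · refine ⟨g₀ * τ₀, Subgroup.mul_mem _ hg₀ (hile hτ₀), fun U hU hiU hgU ↦ hg₀gen U hU hiU ?_, ?_⟩
      · have h1 := U.mul_mem hgU (U.inv_mem (hiU hτ₀))
        rwa [mul_inv_cancel_right] at h1
      · rw [mul_smul, hτ₀t, smul_neg, h, neg_neg]
  -- `κ(res g) = p^n · unit`
  obtain ⟨ug, hug⟩ := MultTowerSP1.exists_units_kappa_resGal_eq_of_generate hκ v hv n hgn hgen
  -- the coinvariants `M_∞/(g-1)M_∞`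
  set P := localPoints W (v.adicCompletion ℚ) with hP
  set M : AddSubgroup P :=
    FixedPoints.addSubgroup (localSubgroup κ.kerSubgroup (v.adicCompletion ℚ)) P with hM
  have memM : ∀ {a : P}, a ∈ M ↔ ∀ h ∈ localSubgroup κ.kerSubgroup (v.adicCompletion ℚ), h • a = a := fun {a} ↦ by
    rw [hM, FixedPoints.mem_addSubgroup]
    exact ⟨fun H h hh ↦ H ⟨h, hh⟩, fun H h ↦ H h h.2⟩
  set d : M →+ M := subOne (localSubgroup κ.kerSubgroup (v.adicCompletion ℚ)) P g with hd
  -- every `p^k`-torsion class of `M_∞/(g-1)M_∞` is ZERO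
  have hzero : ∀ y : M ⧸ d.range, p ^ k • y = 0 → y = 0 := by
    intro y hy
    obtain ⟨m, rfl⟩ := QuotientAddGroup.mk_surjective y
    obtain ⟨x, hxm, hxL, a, hxa⟩ := exists_unit_of_mem_fixedPoints (κ := κ) v hsurj hker hequiv' hQfix hQ0 hQtor hne
      hτ₀ hτ₀t (memM.mp m.2)
    -- `p^k m ∈ (g-1) M_∞`
    have hkm : (p ^ k • m : M) ∈ d.range := by
      rw [← QuotientAddGroup.eq_zero_iff]
      exact hy
    obtain ⟨w, hw⟩ := hkm
    obtain ⟨z, hzm, hzL, jz, hzj⟩ := exists_unit_of_mem_fixedPoints (κ := κ) v hsurj hker hequiv' hQfix hQ0 hQtor hne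
      hτ₀ hτ₀t (memM.mp w.2)
    -- `Ψ (x^{p^k}) = Ψ (gz / z)`, i.e. `x^{p^k} = Q^j · gz/z`
    set gz : (AlgebraicClosure (v.adicCompletion ℚ))ˣ :=
      Units.mk0 (g • (z : AlgebraicClosure (v.adicCompletion ℚ))) ((smul_ne_zero_iff_ne g).mpr z.ne_zero) with hgz
    have hgΨ : g • Ψ (Additive.ofMul z) = Ψ (Additive.ofMul gz) := by
      have h1 := hequiv' g z gz rfl
      rw [if_pos hgt, one_zsmul] at h1
      exact h1
    have h3 : Ψ (Additive.ofMul (x ^ p ^ k)) = Ψ (Additive.ofMul (gz * z⁻¹)) := by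
      rw [ofMul_pow, map_nsmul, hxm, ofMul_mul, ofMul_inv, map_add, map_neg, ← hgΨ, hzm, ← sub_eq_add_neg]
      have h4 := congrArg (fun b : M ↦ (b : P)) hw
      simp only [hd, AddSubgroupClass.coe_nsmul] at h4
      exact h4.symm
    rw [MultTowerNS2.tatePsi_eq_iff v hker] at h3
    obtain ⟨j, hj⟩ := h3
    have hxk : (x : AlgebraicClosure (v.adicCompletion ℚ)) ^ p ^ k =
        Q ^ j * (g • (z : AlgebraicClosure (v.adicCompletion ℚ)) / z) := by
      rw [Units.val_pow_eq_pow_val] at hj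
      rw [hj, Units.val_mul, Units.val_inv_eq_inv_val, hgz, Units.val_mk0, div_eq_mul_inv]
    -- the odd-`p` coboundary lemma: `x = Q^c · gw'/w'` with `w' ∈ T`
    obtain ⟨w', c, jw, hw0, hwL, hwj, hxw⟩ := exists_eq_zpow_mul_coboundary_of_pow_eq_odd (κ := κ) hp2 v n hug ht hgt
      hτ₀ hτ₀t hQfix hQ0 hQtor x.ne_zero hxL hxa z.ne_zero hzL hzj k hxk
    -- `Ψ x = (g - 1) Ψ(w')` with `Ψ w' ∈ M_∞`
    set wu : (AlgebraicClosure (v.adicCompletion ℚ))ˣ := Units.mk0 w' hw0 with hwu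
    have hwM : Ψ (Additive.ofMul wu) ∈ M :=
      memM.mpr (apply_mem_fixedPoints (κ := κ) v hker hequiv' ht hne hτ₀ hτ₀t (x := wu)
        (fun h hh hht ↦ by rw [hwu, Units.val_mk0]; exact hwL h hh hht) (a := jw) (by rw [hwu, Units.val_mk0]; exact hwj))
    set gw : (AlgebraicClosure (v.adicCompletion ℚ))ˣ :=
      Units.mk0 (g • w') ((smul_ne_zero_iff_ne g).mpr hw0) with hgw
    have hgΨw : g • Ψ (Additive.ofMul wu) = Ψ (Additive.ofMul gw) := by
      have h1 := hequiv' g wu gw (by rw [hgw, hwu, Units.val_mk0, Units.val_mk0])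
      rw [if_pos hgt, one_zsmul] at h1
      exact h1
    have hxΨ : Ψ (Additive.ofMul x) = Ψ (Additive.ofMul (gw * wu⁻¹)) := by
      rw [MultTowerNS2.tatePsi_eq_iff v hker]
      exact ⟨c, by rw [hxw, Units.val_mul, Units.val_inv_eq_inv_val, hgw, hwu, Units.val_mk0, Units.val_mk0,
        div_eq_mul_inv]⟩
    have hdP : (d ⟨Ψ (Additive.ofMul wu), hwM⟩ : P) = g • Ψ (Additive.ofMul wu) - Ψ (Additive.ofMul wu) := rfl
    have hmd : (m : P) = (d ⟨Ψ (Additive.ofMul wu), hwM⟩ : P) := by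
      rw [hdP, ← hxm, hxΨ, ofMul_mul, ofMul_inv, map_add, map_neg, ← sub_eq_add_neg, hgΨw]
    rw [QuotientAddGroup.eq_zero_iff]
    exact ⟨⟨Ψ (Additive.ofMul wu), hwM⟩, Subtype.ext hmd.symm⟩
  -- BRICK 11 at `m = p^k`
  haveI : Subsingleton {y : M ⧸ d.range // p ^ k • y = 0} :=
    ⟨fun a b ↦ Subtype.ext ((hzero a.1 a.2).trans (hzero b.1 b.2).symm)⟩
  haveI : Finite {y : M ⧸ d.range // p ^ k • y = 0} := Finite.of_subsingleton
  obtain ⟨hfin, hcard⟩ :=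
    MultTowerNS2.finite_torsionBy_localTowerKerPrimary_and_card_le W κ (v.adicCompletion ℚ) n hgn hgen (p ^ k)
  exact ⟨hfin, hcard.trans (Finite.card_le_one_iff_subsingleton.mpr inferInstance)⟩

/-! ### `𝒦_{v,n}[p^∞] = ⊥` and the named fact -/

/-- **`𝒦_{v,n}[p^∞] = ⊥` at EVERY non-split multiplicative ODD `p`, every layer** (globally minimal `W/ℚ`, cyclotomic `κ`,
`v ∋ p`): every class of `𝒦_{v,n}[p^∞]` is killed by some `p^k`, and `𝒦_{v,n}[p^∞][p^k]` has at most one element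
(`powTorsion_localTowerKerPrimary_card_le_one_nonsplitOdd`). Greenberg, LNM 1716, §3 p. 93 over `ℚ`.
[cite: GreenbergLNM1716, §3, between Prop. 3.6 and Prop. 3.7 (PDF p. 93)] [cite: Washington1997, §13.1] -/
theorem localTowerKerPrimary_eq_bot_nonsplitOdd (hp2 : p ≠ 2) (W : WeierstrassCurve ℚ) [W.IsElliptic]
    [W.IsGloballyMinimal] (hmult : W.HasMultiplicativeReductionAtPrime p)
    (hns : ¬ W.HasSplitMultiplicativeReductionAtPrime p) (hκ : κ.IsCyclotomic) (v : HeightOneSpectrum (𝓞 ℚ))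
    (hv : ((p : ℕ) : 𝓞 ℚ) ∈ v.asIdeal) (n : ℕ) :
    W.localTowerKerPrimary κ (v.adicCompletion ℚ) n = ⊥ := by
  rw [eq_bot_iff]
  intro x hx
  obtain ⟨k, hk⟩ := ((W.mem_localTowerKerPrimary_iff κ (v.adicCompletion ℚ) n x).mp hx).2
  obtain ⟨hfin, hcard⟩ := powTorsion_localTowerKerPrimary_card_le_one_nonsplitOdd (κ := κ) hp2 W hmult hns hκ v hv n k
  haveI := hfin
  have hsub : Subsingleton {y : W.localTowerKerPrimary κ (v.adicCompletion ℚ) n // p ^ k • y = 0} :=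
    Finite.card_le_one_iff_subsingleton.mp hcard
  have hxk : p ^ k • (⟨x, hx⟩ : W.localTowerKerPrimary κ (v.adicCompletion ℚ) n) = 0 := Subtype.ext hk
  have h0 : p ^ k • (0 : W.localTowerKerPrimary κ (v.adicCompletion ℚ) n) = 0 := smul_zero _
  have heq := hsub.elim ⟨⟨x, hx⟩, hxk⟩ ⟨0, h0⟩
  rw [AddSubgroup.mem_bot]
  exact congrArg (fun y ↦ ((y.1 : W.localTowerKerPrimary κ (v.adicCompletion ℚ) n) :
    discreteH1 (localSubgroup (κ.layerSubgroup n) (v.adicCompletion ℚ)) (localPoints W (v.adicCompletion ℚ)))) heq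

/-- **Greenberg, LNM 1716 (1999), §3, PDF p. 93 — NON-SPLIT multiplicative `v ∣ p`, `p` ODD, at EVERY layer, case
`F = ℚ`: the named fact `Greenberg1999.sec3_localTowerKerPrimary_eq_bot_nonsplitMultiplicative_odd_rat`, PROVED**
(signature verbatim: globally minimal elliptic `W/ℚ`, `p ≠ 2`, multiplicative but not split multiplicative reduction at
`p`, `κ` cyclotomic, `v ∋ p`, every `n`: `𝒦_{v,n}[p^∞] = ⊥`). Consumers keep `(hNS : …)` and may now pass this term.
[cite: GreenbergLNM1716, §3, between Prop. 3.6 and Prop. 3.7 (PDF p. 93)] [cite: Washington1997, §13.1] -/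
theorem _root_.Literature.NumberTheory.EllipticCurves.Greenberg1999.sec3_localTowerKerPrimary_eq_bot_nonsplitMultiplicative_odd_rat_holds :
    Greenberg1999.sec3_localTowerKerPrimary_eq_bot_nonsplitMultiplicative_odd_rat := by
  intro W _ _ p _ hp2 hmult hns κ hκ v hpv n
  exact localTowerKerPrimary_eq_bot_nonsplitOdd hp2 W hmult hns hκ v hpv n

end Literature.NumberTheory.EllipticCurves.Greenberg1999.MultTowerNSOdd

end Part16

/-!
## Part 17 — port of `Summits/BirchSwinnertonDyer/BirchSwinnertonDyer/Theorems/ByReductionTypeAtTwoMultTowerNS2CoinvariantsCount.lean` (1 declarations kept)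

# Kernel brick 16d — at most two `2`-torsion coinvariant classes of the twisted Tate module over the local cyclotomic `ℤ₂`-tower

Declarations of this Part (verbatim port; each keeps its own docstring and citation): `div_coboundary_eq_of_norm_rel`.

Reference keys (see `references.bib` and the declarations' citations): [GreenbergLNM1716].
-/

section Part17

set_option autoImplicit false
open scoped _root_.Classical _root_.IntermediateField

namespace Literature.NumberTheory.EllipticCurves.Greenberg1999.MultTowerNS2

open _root_.NumberField _root_.IsDedekindDomain _root_.Field _root_.PadicInt Literature.NumberTheory.EllipticCurves
  Literature.NumberTheory.GaloisRepresentations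

variable {κ : ZpExtension ℚ 2}

/-- **C7: two coboundaries with norms in the same `N_σ`-class modulo `q^ℤ` are congruent modulo `B`.** For `y, y'` non-zero in
`K̄^{H_∞ ∩ Stab(t)}` and `f₀ ≠ 0` in `K̄^{H_n ∩ Stab(t)}` (so `g f₀ = f₀`) with `y·τ₀y = Q^ε · (f₀·τ₀f₀) · (y'·τ₀y')`: the
element `z = y/(y' f₀)` lies in `T` with `τ₀z · z = Q^ε` and `(gy/y)/(gy'/y') = gz/z`. [cite: GreenbergLNM1716, §3 (pp. 87–89)] -/
theorem div_coboundary_eq_of_norm_rel (v : HeightOneSpectrum (𝓞 ℚ)) (n : ℕ)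
    {g : absoluteGaloisGroup (v.adicCompletion ℚ)} (hgn : g ∈ localSubgroup (κ.layerSubgroup n) (v.adicCompletion ℚ))
    {t : AlgebraicClosure (v.adicCompletion ℚ)} (hgt : g • t = t)
    {τ₀ : absoluteGaloisGroup (v.adicCompletion ℚ)} {Q : AlgebraicClosure (v.adicCompletion ℚ)} {ε : ℤ}
    {y y' f₀ : AlgebraicClosure (v.adicCompletion ℚ)} (hy0 : y ≠ 0) (hy'0 : y' ≠ 0) (hf₀0 : f₀ ≠ 0)
    (hyL : ∀ h ∈ localSubgroup κ.kerSubgroup (v.adicCompletion ℚ), h • t = t → h • y = y)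
    (hy'L : ∀ h ∈ localSubgroup κ.kerSubgroup (v.adicCompletion ℚ), h • t = t → h • y' = y')
    (hf₀M : ∀ h ∈ localSubgroup (κ.layerSubgroup n) (v.adicCompletion ℚ), h • t = t → h • f₀ = f₀)
    (hrel : y * τ₀ • y = Q ^ ε * (f₀ * τ₀ • f₀) * (y' * τ₀ • y')) :
    (y / (y' * f₀)) ≠ 0 ∧
      (∀ h ∈ localSubgroup κ.kerSubgroup (v.adicCompletion ℚ), h • t = t → h • (y / (y' * f₀)) = y / (y' * f₀)) ∧
      τ₀ • (y / (y' * f₀)) * (y / (y' * f₀)) = Q ^ ε ∧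
      (g • y / y) / (g • y' / y') = g • (y / (y' * f₀)) / (y / (y' * f₀)) := by
  have hile : localSubgroup κ.kerSubgroup (v.adicCompletion ℚ) ≤ localSubgroup (κ.layerSubgroup n) (v.adicCompletion ℚ) :=
    fun τ hτ ↦ by
      rw [mem_localSubgroup_iff] at hτ ⊢
      exact κ.kerSubgroup_le_layerSubgroup n hτ
  have hgf₀ : g • f₀ = f₀ := hf₀M g hgn hgt
  have hτy'0 : τ₀ • y' ≠ 0 := (smul_ne_zero_iff_ne τ₀).mpr hy'0
  have hτf₀0 : τ₀ • f₀ ≠ 0 := (smul_ne_zero_iff_ne τ₀).mpr hf₀0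
  have hgy'0 : g • y' ≠ 0 := (smul_ne_zero_iff_ne g).mpr hy'0
  refine ⟨div_ne_zero hy0 (mul_ne_zero hy'0 hf₀0), fun h hh hht ↦ ?_, ?_, ?_⟩
  · rw [smul_div₀', smul_mul', hyL h hh hht, hy'L h hh hht, hf₀M h (hile hh) hht]
  · rw [smul_div₀', smul_mul']
    field_simp
    linear_combination hrel
  · rw [smul_div₀', smul_mul', hgf₀]
    field_simp

end Literature.NumberTheory.EllipticCurves.Greenberg1999.MultTowerNS2

end Part17

/-!
## Part 18 — port of `Summits/BirchSwinnertonDyer/BirchSwinnertonDyer/Theorems/ByReductionTypeAtTwoMultTowerNS2OrderCoboundary.lean` (5 declarations kept)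

# The order of the local tower kernel at a non-split multiplicative `2`, part 1 — `2^k`-torsion coinvariant classes of the twisted Tate module of unit exponent

Declarations of this Part (verbatim port; each keeps its own docstring and citation): `pow_smul_eq_of_smul_eq`, `pow_two_pow_add_smul_eq`, `prod_smul_range_two_pow_add_eq_pow`, `smul_mul_zpow_inv_pow`, `exists_coboundary_of_pow_eq`.

Reference keys (see `references.bib` and the declarations' citations): [GreenbergLNM1716], [NeukirchANT1999].
-/

section Part18

set_option autoImplicit false
open scoped _root_.Classical _root_.IntermediateField

namespace Literature.NumberTheory.EllipticCurves.Greenberg1999.MultTowerNS2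

open _root_.NumberField _root_.IsDedekindDomain _root_.Field _root_.PadicInt Literature.NumberTheory.EllipticCurves
  Literature.NumberTheory.GaloisRepresentations

variable {κ : ZpExtension ℚ 2}

/-! ### Orbit products along the tower: `N_{R+k}(w) = N_R(w)^{2^k}` -/

/-- If `h` fixes `w` then so does every power of `h`. [cite: GreenbergLNM1716, §3 (pp. 87–89)] -/
theorem pow_smul_eq_of_smul_eq {K : Type*} [Field K] (h : absoluteGaloisGroup K) {w : AlgebraicClosure K}
    (hw : h • w = w) (m : ℕ) : (h ^ m) • w = w := by
  induction m with
  | zero => rw [pow_zero, one_smul]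
  | succ m ih => rw [pow_succ, mul_smul, hw, ih]

/-- If `g^{2^R}` fixes `w` then so does `g^{2^{R+k}}`. [cite: GreenbergLNM1716, §3 (pp. 87–89)] -/
theorem pow_two_pow_add_smul_eq {K : Type*} [Field K] (g : absoluteGaloisGroup K) (R k : ℕ)
    {w : AlgebraicClosure K} (hw : (g ^ 2 ^ R) • w = w) : (g ^ 2 ^ (R + k)) • w = w := by
  rw [pow_add, pow_mul]
  exact pow_smul_eq_of_smul_eq (g ^ 2 ^ R) hw (2 ^ k)

/-- **`N_{R+k}(w) = N_R(w)^{2^k}` when `g^{2^R} w = w`** (splitting the range `[0, 2^{R+k})` into `2^k` translates of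
`[0, 2^R)`, each contributing `N_R(w)`). [cite: GreenbergLNM1716, §3 (pp. 87–89)] -/
theorem prod_smul_range_two_pow_add_eq_pow {K : Type*} [Field K] (g : absoluteGaloisGroup K) (R k : ℕ)
    {w : AlgebraicClosure K} (hw : (g ^ 2 ^ R) • w = w) :
    (∏ i ∈ Finset.range (2 ^ (R + k)), (g ^ i) • w) = (∏ i ∈ Finset.range (2 ^ R), (g ^ i) • w) ^ 2 ^ k := by
  induction k with
  | zero => rw [add_zero, pow_zero, pow_one]
  | succ k ih =>
    have hfix : (g ^ 2 ^ (R + k)) • w = w := pow_two_pow_add_smul_eq g R k hw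
    rw [show R + (k + 1) = (R + k) + 1 by ring, pow_succ, mul_comm, prod_smul_range_two_mul,
      pow_smul_prod_smul_eq g (2 ^ (R + k)) hfix, ih, ← sq, ← pow_mul, ← pow_succ]

/-! ### Normalising an even-exponent `m`-torsion datum -/

/-- **Normalising an element of even exponent to the unit circle, `m`-torsion form.** If `τ₀x·x = Q^{2c}` then
`x' = x·Q^{-c}` is still fixed by `H_∞ ∩ Stab(t)`, satisfies `τ₀x'·x' = 1`, and `x'^m = Q^{j - m c}·gz/z` whenever
`x^m = Q^j·gz/z`. [cite: GreenbergLNM1716, §3 (pp. 87–89)] -/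
theorem smul_mul_zpow_inv_pow (v : HeightOneSpectrum (𝓞 ℚ)) {g τ₀ : absoluteGaloisGroup (v.adicCompletion ℚ)}
    {t Q x z : AlgebraicClosure (v.adicCompletion ℚ)}
    (hQfix : ∀ σ : absoluteGaloisGroup (v.adicCompletion ℚ), σ • Q = Q) (hQ0 : Q ≠ 0)
    (hxL : ∀ h ∈ localSubgroup κ.kerSubgroup (v.adicCompletion ℚ), h • t = t → h • x = x)
    {c : ℤ} (hxc : τ₀ • x * x = Q ^ (2 * c)) (m : ℕ) {j : ℤ} (hxm : x ^ m = Q ^ j * (g • z / z)) :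
    (∀ h ∈ localSubgroup κ.kerSubgroup (v.adicCompletion ℚ), h • t = t → h • (x * (Q ^ c)⁻¹) = x * (Q ^ c)⁻¹) ∧
      τ₀ • (x * (Q ^ c)⁻¹) * (x * (Q ^ c)⁻¹) = 1 ∧
      (x * (Q ^ c)⁻¹) ^ m = Q ^ (j - m * c) * (g • z / z) := by
  have hQc : Q ^ c ≠ 0 := zpow_ne_zero _ hQ0
  refine ⟨fun h hh hht ↦ by rw [smul_mul', smul_inv'', smul_zpow₀', hQfix, hxL h hh hht], ?_, ?_⟩
  · rw [smul_mul', smul_inv'', smul_zpow₀', hQfix]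
    field_simp
    rw [hxc, two_mul, zpow_add₀ hQ0]
    exact (sq _).symm
  · rw [mul_pow, hxm, inv_pow, ← zpow_natCast (Q ^ c), ← zpow_mul, zpow_sub₀ hQ0]
    ring

/-! ### C3 at exponent `2^k`: unit `2^k`-torsion classes are coboundaries with an `F_n`-rational norm -/

/-- **C3 at exponent `2^k` (scope S3/S6).** Let `x ∈ K̄^{H_∞ ∩ Stab(t)}` with `τ₀x · x = 1` and
`x^{2^k} = Q^j · gz/z` for some `z` of the twisted Tate module (`z ≠ 0` in `K̄^{H_∞ ∩ Stab(t)}` with `τ₀z · z ∈ Q^ℤ`).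
Then `x = g(y)/y` for some non-zero `y ∈ K̄^{H_∞ ∩ Stab(t)}` whose norm `y · τ₀y` is non-zero and fixed by ALL of `H_n`
(an element of `F_n`). Proof: the exponent count gives `j = 0`; at a common finite level `n + R` one has
`N_R(x)^{2^k} = N_R(gz)/N_R(z) = 1`, so `N_{R+k}(x) = N_R(x)^{2^k} = 1` and the cyclic Hilbert 90 of BRICK 16a applies
at level `n + R + k`; `g(y τ₀y) = (xy)·τ₀(xy) = y τ₀y`, `τ₀(y τ₀ y) = y τ₀ y`, and `H_n` is generated by
`H_{n+R+k} ∩ Stab(t)`, `τ₀` and `g` (BRICK 15). The case `k = 1` is C3 (`exists_coboundary_of_sq_eq`).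
[cite: GreenbergLNM1716, §3 (pp. 87–93)] [cite: NeukirchANT1999, Ch. IV (3.5)] -/
theorem exists_coboundary_of_pow_eq (v : HeightOneSpectrum (𝓞 ℚ))
    (n : ℕ) {g : absoluteGaloisGroup (v.adicCompletion ℚ)} {ug : ℤ_[2]ˣ}
    (hug : ((κ (resGal (K := ℚ) (v.adicCompletion ℚ) g)).toAdd : ℤ_[2]) = 2 ^ n * (ug : ℤ_[2]))
    {t : AlgebraicClosure (v.adicCompletion ℚ)}
    (ht : ∀ σ : absoluteGaloisGroup (v.adicCompletion ℚ), σ • t = t ∨ σ • t = -t) (hgt : g • t = t)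
    {τ₀ : absoluteGaloisGroup (v.adicCompletion ℚ)} (hτ₀ : τ₀ ∈ localSubgroup κ.kerSubgroup (v.adicCompletion ℚ))
    (hτ₀t : τ₀ • t = -t) {Q : AlgebraicClosure (v.adicCompletion ℚ)}
    (hQfix : ∀ σ : absoluteGaloisGroup (v.adicCompletion ℚ), σ • Q = Q) (hQ0 : Q ≠ 0)
    (hQtor : ∀ j : ℤ, Q ^ j = 1 → j = 0)
    {x : AlgebraicClosure (v.adicCompletion ℚ)}
    (hxL : ∀ h ∈ localSubgroup κ.kerSubgroup (v.adicCompletion ℚ), h • t = t → h • x = x) (hxU : τ₀ • x * x = 1)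
    (k : ℕ) {j : ℤ} {z : AlgebraicClosure (v.adicCompletion ℚ)} (hz0 : z ≠ 0)
    (hzL : ∀ h ∈ localSubgroup κ.kerSubgroup (v.adicCompletion ℚ), h • t = t → h • z = z)
    {j' : ℤ} (hzj : τ₀ • z * z = Q ^ j') (hxk : x ^ 2 ^ k = Q ^ j * (g • z / z)) :
    ∃ y : AlgebraicClosure (v.adicCompletion ℚ), y ≠ 0 ∧
      (∀ h ∈ localSubgroup κ.kerSubgroup (v.adicCompletion ℚ), h • t = t → h • y = y) ∧ x = g • y / y ∧
      y * τ₀ • y ≠ 0 ∧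
      ∀ h ∈ localSubgroup (κ.layerSubgroup n) (v.adicCompletion ℚ), h • (y * τ₀ • y) = y * τ₀ • y := by
  -- normality of the local subgroups
  haveI hHin : (localSubgroup κ.kerSubgroup (v.adicCompletion ℚ)).Normal := by
    rw [localSubgroup_eq_comap]; exact Subgroup.Normal.comap inferInstance _
  have hHmn : ∀ m, (localSubgroup (κ.layerSubgroup m) (v.adicCompletion ℚ)).Normal := fun m ↦ by
    rw [localSubgroup_eq_comap]; exact Subgroup.Normal.comap inferInstance _
  have hile : ∀ m, localSubgroup κ.kerSubgroup (v.adicCompletion ℚ) ≤ localSubgroup (κ.layerSubgroup m) (v.adicCompletion ℚ) :=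
    fun m τ hτ ↦ by
      rw [mem_localSubgroup_iff] at hτ ⊢
      exact κ.kerSubgroup_le_layerSubgroup m hτ
  have hgit : ∀ i : ℕ, (g ^ i) • t = t := fun i ↦ pow_smul_eq_of_smul_eq g hgt i
  -- (1) `j = 0`
  have hgz0 : g • z ≠ 0 := (smul_ne_zero_iff_ne g).mpr hz0
  have hcob : τ₀ • (g • z / z) * (g • z / z) = 1 :=
    flip_smul_coboundary_mul_coboundary ht hτ₀ hτ₀t hgt hQ0 (hQfix g) hz0 hzL hzj
  have hj : j = 0 := by
    have h1 : τ₀ • (x ^ 2 ^ k) * x ^ 2 ^ k = 1 := by rw [smul_pow', ← mul_pow, hxU, one_pow]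
    rw [hxk, smul_mul', smul_zpow₀', hQfix τ₀] at h1
    have h2 : Q ^ (2 * j) = 1 := by
      rw [two_mul, zpow_add₀ hQ0]
      linear_combination (-(Q ^ j * Q ^ j)) * hcob + h1
    have := hQtor _ h2
    omega
  rw [hj, zpow_zero, one_mul] at hxk
  -- (2) a common finite level `n + R` for `x` and `z`
  obtain ⟨R, hxR, hzR⟩ := exists_forall_mem_localSubgroup_layerSubgroup_add_smul_eq₂ (κ := κ) v n t x z hxL hzL
  have hgRmem : g ^ 2 ^ R ∈ localSubgroup (κ.layerSubgroup (n + R)) (v.adicCompletion ℚ) :=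
    (pow_mem_localSubgroup_layerSubgroup_iff (κ := κ) v n R hug _).mpr dvd_rfl
  have hgRx : (g ^ 2 ^ R) • x = x := hxR _ hgRmem (hgit _)
  have hgRz : (g ^ 2 ^ R) • z = z := hzR _ hgRmem (hgit _)
  -- (3) `N_R(x)^{2^k} = 1`, hence `N_{R+k}(x) = 1`
  have hprodz : (∏ i ∈ Finset.range (2 ^ R), (g ^ i) • (g • z / z)) = 1 := by
    rw [Finset.prod_congr rfl fun i _ ↦ show (g ^ i) • (g • z / z) = (g ^ i) • (g • z) * (g ^ i) • z⁻¹ by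
        rw [div_eq_mul_inv, smul_mul'], Finset.prod_mul_distrib, prod_smul_smul_eq g (2 ^ R) hgRz, prod_smul_inv,
      mul_inv_cancel₀]
    exact Finset.prod_ne_zero_iff.mpr fun i _ ↦ (smul_ne_zero_iff_ne _).mpr hz0
  have hNRk : (∏ i ∈ Finset.range (2 ^ R), (g ^ i) • x) ^ 2 ^ k = 1 := by
    rw [← Finset.prod_pow, Finset.prod_congr rfl fun i _ ↦ (smul_pow' (g ^ i) x (2 ^ k)).symm, hxk, hprodz]
  have hNR1 : (∏ i ∈ Finset.range (2 ^ (R + k)), (g ^ i) • x) = 1 := by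
    rw [prod_smul_range_two_pow_add_eq_pow g R k hgRx, hNRk]
  -- (4) cyclic Hilbert 90 at level `n + R + k`
  have hxRk : ∀ h ∈ localSubgroup (κ.layerSubgroup (n + (R + k))) (v.adicCompletion ℚ), h • t = t → h • x = x :=
    fun h hh hht ↦ hxR h (localSubgroup_layerSubgroup_le_of_le v (by omega) hh) hht
  obtain ⟨y, hy0, hyR, hxy⟩ := exists_eq_smul_div_of_prod_smul_eq_one (κ := κ) v n (R + k) hug ht hgt hxRk hNR1
  have hyL : ∀ h ∈ localSubgroup κ.kerSubgroup (v.adicCompletion ℚ), h • t = t → h • y = y :=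
    fun h hh hht ↦ hyR h (hile _ hh) hht
  have hτy0 : τ₀ • y ≠ 0 := (smul_ne_zero_iff_ne τ₀).mpr hy0
  have hgy : g • y = x * y := by rw [hxy, div_mul_cancel₀ _ hy0]
  -- (5) the norm `y · τ₀ y` is fixed by `g`, by `τ₀`, by `H_{n+R+k} ∩ Stab(t)`, hence by `H_n`
  haveI := hHmn (n + (R + k))
  have hgv : g • (y * τ₀ • y) = y * τ₀ • y := by
    rw [smul_mul', ← flip_smul_smul_comm ht hτ₀ hτ₀t hgt hyL, hgy, smul_mul']
    linear_combination (y * τ₀ • y) * hxU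
  have hτv : τ₀ • (y * τ₀ • y) = y * τ₀ • y := by
    rw [smul_mul', flip_smul_flip_smul hτ₀ hτ₀t hyL, mul_comm]
  have hτyR : ∀ h ∈ localSubgroup (κ.layerSubgroup (n + (R + k))) (v.adicCompletion ℚ), h • t = t →
      h • (τ₀ • y) = τ₀ • y :=
    smul_mem_of_forall_mem_smul_eq ht _ hyR τ₀
  have hvR : ∀ h ∈ localSubgroup (κ.layerSubgroup (n + (R + k))) (v.adicCompletion ℚ),
      h • (y * τ₀ • y) = y * τ₀ • y := by
    intro h hh
    rcases ht h with hht | hht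
    · rw [smul_mul', hyR h hh hht, hτyR h hh hht]
    · -- `h = τ₀ · (τ₀⁻¹ h)` with `τ₀⁻¹ h ∈ H_{n+R+k} ∩ Stab(t)`
      have hmem : τ₀⁻¹ * h ∈ localSubgroup (κ.layerSubgroup (n + (R + k))) (v.adicCompletion ℚ) :=
        Subgroup.mul_mem _ (Subgroup.inv_mem _ (hile _ hτ₀)) hh
      have hfix : (τ₀⁻¹ * h) • t = t := by
        rw [mul_smul, hht, smul_neg, inv_smul_eq_smul_of_smul_eq_or (Or.inr hτ₀t), hτ₀t, neg_neg]
      have h1 : (τ₀⁻¹ * h) • (y * τ₀ • y) = y * τ₀ • y := by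
        rw [smul_mul', hyR _ hmem hfix, hτyR _ hmem hfix]
      rw [mul_smul, inv_smul_eq_iff] at h1
      rw [h1, hτv]
  have hgiv : ∀ i : ℕ, (g ^ i) • (y * τ₀ • y) = y * τ₀ • y := fun i ↦ pow_smul_eq_of_smul_eq g hgv i
  refine ⟨y, hy0, hyL, hxy, mul_ne_zero hy0 hτy0, fun h hh ↦ ?_⟩
  obtain ⟨i, -, hi⟩ := exists_pow_inv_mul_mem_localSubgroup_layerSubgroup (κ := κ) v n (R + k) hug hh
  have h1 := hvR _ hi
  rw [mul_smul, inv_smul_eq_iff, hgiv] at h1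
  exact h1

end Literature.NumberTheory.EllipticCurves.Greenberg1999.MultTowerNS2

end Part18

/-!
## Part 19 — port of `Summits/BirchSwinnertonDyer/BirchSwinnertonDyer/Theorems/ByReductionTypeAtTwoMultTowerNS2OrderCount.lean` (3 declarations kept)

# The order of the local tower kernel at a non-split multiplicative `2`, part 2 — the count, for every `k`

Declarations of this Part (verbatim port; each keeps its own docstring and citation): `exists_div_eq_zpow_mul_coboundary_of_three_even_pow`, `div_powTorsion_data`, `exists_div_eq_zpow_mul_coboundary_of_five_pow`.

Reference keys (see `references.bib` and the declarations' citations): [GreenbergLNM1716], [NeukirchANT1999].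
-/

section Part19

set_option autoImplicit false
open scoped _root_.Classical _root_.IntermediateField

namespace Literature.NumberTheory.EllipticCurves.Greenberg1999.MultTowerNS2

open _root_.NumberField _root_.IsDedekindDomain _root_.Field _root_.PadicInt Literature.NumberTheory.EllipticCurves
  Literature.NumberTheory.GaloisRepresentations

variable {κ : ZpExtension ℚ 2}

/-! ### Among three EVEN-exponent `2^k`-torsion elements two are congruent -/

/-- **No three pairwise incongruent `2^k`-torsion elements of EVEN exponent** (setting of BRICKs 15/16; `g` a topological
generator of `H_n` modulo `H_∞` fixing `t`; `τ₀ ∈ H_∞` a flip; `hN2` the class field input for the quadratic layer in «three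
elements, two congruent» form; NO hypothesis on the Tate unit, NO case split): among any three `x₀, x₁, x₂ ∈ T` with
`τ₀x_i·x_i = Q^{2c_i}` and `x_i^{2^k} ∈ B = Q^ℤ·(g−1)T`, two are congruent modulo `B`. Normalise `x_i' = x_i Q^{-c_i}`
(`smul_mul_zpow_inv_pow`), write `x_i' = gy_i/y_i` with `y_i·τ₀y_i ∈ F_nˣ` (C3 at exponent `2^k`,
`exists_coboundary_of_pow_eq`), apply `hN2` to the three norms, conclude by C7 (`div_coboundary_eq_of_norm_rel`).
[cite: GreenbergLNM1716, §3 (pp. 87–93)] [cite: NeukirchANT1999, Ch. V §1 Thm. (1.1)] -/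
theorem exists_div_eq_zpow_mul_coboundary_of_three_even_pow (v : HeightOneSpectrum (𝓞 ℚ)) (n : ℕ)
    {g : absoluteGaloisGroup (v.adicCompletion ℚ)} {ug : ℤ_[2]ˣ}
    (hug : ((κ (resGal (K := ℚ) (v.adicCompletion ℚ) g)).toAdd : ℤ_[2]) = 2 ^ n * (ug : ℤ_[2]))
    (hgn : g ∈ localSubgroup (κ.layerSubgroup n) (v.adicCompletion ℚ))
    {t : AlgebraicClosure (v.adicCompletion ℚ)}
    (ht : ∀ σ : absoluteGaloisGroup (v.adicCompletion ℚ), σ • t = t ∨ σ • t = -t) (hgt : g • t = t)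
    {τ₀ : absoluteGaloisGroup (v.adicCompletion ℚ)} (hτ₀ : τ₀ ∈ localSubgroup κ.kerSubgroup (v.adicCompletion ℚ))
    (hτ₀t : τ₀ • t = -t) {Q : AlgebraicClosure (v.adicCompletion ℚ)}
    (hQfix : ∀ σ : absoluteGaloisGroup (v.adicCompletion ℚ), σ • Q = Q) (hQ0 : Q ≠ 0)
    (hQtor : ∀ j : ℤ, Q ^ j = 1 → j = 0)
    (hN2 : ∀ c₁ c₂ c₃ : AlgebraicClosure (v.adicCompletion ℚ), c₁ ≠ 0 → c₂ ≠ 0 → c₃ ≠ 0 →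
      (∀ h ∈ localSubgroup (κ.layerSubgroup n) (v.adicCompletion ℚ), h • c₁ = c₁) →
      (∀ h ∈ localSubgroup (κ.layerSubgroup n) (v.adicCompletion ℚ), h • c₂ = c₂) →
      (∀ h ∈ localSubgroup (κ.layerSubgroup n) (v.adicCompletion ℚ), h • c₃ = c₃) →
      ∃ f₀ : AlgebraicClosure (v.adicCompletion ℚ), f₀ ≠ 0 ∧
        (∀ h ∈ localSubgroup (κ.layerSubgroup n) (v.adicCompletion ℚ), h • t = t → h • f₀ = f₀) ∧
        (c₁ = f₀ * τ₀ • f₀ * c₂ ∨ c₁ = f₀ * τ₀ • f₀ * c₃ ∨ c₂ = f₀ * τ₀ • f₀ * c₃))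
    (k : ℕ) {x z : Fin 3 → AlgebraicClosure (v.adicCompletion ℚ)} {c j jz : Fin 3 → ℤ} (hx0 : ∀ i, x i ≠ 0)
    (hxL : ∀ i, ∀ h ∈ localSubgroup κ.kerSubgroup (v.adicCompletion ℚ), h • t = t → h • x i = x i)
    (hxc : ∀ i, τ₀ • x i * x i = Q ^ (2 * c i)) (hz0 : ∀ i, z i ≠ 0)
    (hzL : ∀ i, ∀ h ∈ localSubgroup κ.kerSubgroup (v.adicCompletion ℚ), h • t = t → h • z i = z i)
    (hzj : ∀ i, τ₀ • z i * z i = Q ^ jz i) (hxk : ∀ i, x i ^ 2 ^ k = Q ^ j i * (g • z i / z i)) :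
    ∃ i i' : Fin 3, i ≠ i' ∧ ∃ (c' : ℤ) (w : AlgebraicClosure (v.adicCompletion ℚ)), w ≠ 0 ∧
      (∀ h ∈ localSubgroup κ.kerSubgroup (v.adicCompletion ℚ), h • t = t → h • w = w) ∧
      (∃ jw : ℤ, τ₀ • w * w = Q ^ jw) ∧ x i / x i' = Q ^ c' * (g • w / w) := by
  -- normalise and write each `x_i Q^{-c_i}` as a coboundary `g y_i / y_i` (C3 at exponent `2^k`)
  have hcob : ∀ i, ∃ y : AlgebraicClosure (v.adicCompletion ℚ), y ≠ 0 ∧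
      (∀ h ∈ localSubgroup κ.kerSubgroup (v.adicCompletion ℚ), h • t = t → h • y = y) ∧
      x i * (Q ^ c i)⁻¹ = g • y / y ∧ y * τ₀ • y ≠ 0 ∧
      ∀ h ∈ localSubgroup (κ.layerSubgroup n) (v.adicCompletion ℚ), h • (y * τ₀ • y) = y * τ₀ • y := fun i ↦ by
    obtain ⟨hx'L, hx'U, hx'k⟩ := smul_mul_zpow_inv_pow (κ := κ) v hQfix hQ0 (hxL i) (hxc i) (2 ^ k) (hxk i)
    exact exists_coboundary_of_pow_eq (κ := κ) v n hug ht hgt hτ₀ hτ₀t hQfix hQ0 hQtor hx'L hx'U k (hz0 i) (hzL i)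
      (hzj i) hx'k
  choose y hy0 hyL hxy hN0 hNn using hcob
  -- the class field input on the three norms
  obtain ⟨f, hf0, hfM, hcases⟩ := hN2 (y 0 * τ₀ • y 0) (y 1 * τ₀ • y 1) (y 2 * τ₀ • y 2) (hN0 0) (hN0 1) (hN0 2)
    (hNn 0) (hNn 1) (hNn 2)
  obtain ⟨i, i', hii', hrel⟩ : ∃ i i' : Fin 3, i ≠ i' ∧ y i * τ₀ • y i = f * τ₀ • f * (y i' * τ₀ • y i') := by
    rcases hcases with h | h | h
    exacts [⟨0, 1, by decide, h⟩, ⟨0, 2, by decide, h⟩, ⟨1, 2, by decide, h⟩]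
  have hrel' : y i * τ₀ • y i = Q ^ (0 : ℤ) * (f * τ₀ • f) * (y i' * τ₀ • y i') := by
    rw [zpow_zero, one_mul]; exact hrel
  -- C7
  obtain ⟨hw0, hwL, hwε, hww⟩ :=
    div_coboundary_eq_of_norm_rel (κ := κ) v n hgn hgt (hy0 i) (hy0 i') hf0 (hyL i) (hyL i') hfM hrel'
  refine ⟨i, i', hii', c i - c i', y i / (y i' * f), hw0, hwL, ⟨0, hwε⟩, ?_⟩
  have hQci : Q ^ c i ≠ 0 := zpow_ne_zero _ hQ0
  have hQci' : Q ^ c i' ≠ 0 := zpow_ne_zero _ hQ0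
  have hxi' := hx0 i'
  rw [← hww, ← hxy i, ← hxy i', zpow_sub₀ hQ0]
  field_simp

/-! ### Among FIVE `2^k`-torsion elements two are congruent -/

/-- **Quotient of two `2^k`-torsion data.** If `x, x'` are `H_∞ ∩ Stab(t)`-invariant with `τ₀x·x = Q^a`, `τ₀x'·x' = Q^{a'}`,
`x^{2^k} = Q^j·gz/z`, `x'^{2^k} = Q^{j'}·gz'/z'` (`z, z' ∈ T` with exponents `jz, jz'`), then `X = x/x'`, `Z = z/z'` satisfy the
same with exponents `a − a'`, `j − j'`, `jz − jz'`. [cite: GreenbergLNM1716, §3 (pp. 87–93)] -/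
theorem div_powTorsion_data (v : HeightOneSpectrum (𝓞 ℚ)) {g τ₀ : absoluteGaloisGroup (v.adicCompletion ℚ)}
    {t Q : AlgebraicClosure (v.adicCompletion ℚ)} (hQ0 : Q ≠ 0) (k : ℕ)
    {x x' z z' : AlgebraicClosure (v.adicCompletion ℚ)} {a a' j j' jz jz' : ℤ} (hx0 : x ≠ 0) (hx'0 : x' ≠ 0)
    (hxL : ∀ h ∈ localSubgroup κ.kerSubgroup (v.adicCompletion ℚ), h • t = t → h • x = x)
    (hx'L : ∀ h ∈ localSubgroup κ.kerSubgroup (v.adicCompletion ℚ), h • t = t → h • x' = x')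
    (hxa : τ₀ • x * x = Q ^ a) (hx'a : τ₀ • x' * x' = Q ^ a') (hz0 : z ≠ 0) (hz'0 : z' ≠ 0)
    (hzL : ∀ h ∈ localSubgroup κ.kerSubgroup (v.adicCompletion ℚ), h • t = t → h • z = z)
    (hz'L : ∀ h ∈ localSubgroup κ.kerSubgroup (v.adicCompletion ℚ), h • t = t → h • z' = z')
    (hzj : τ₀ • z * z = Q ^ jz) (hz'j : τ₀ • z' * z' = Q ^ jz')
    (hxk : x ^ 2 ^ k = Q ^ j * (g • z / z)) (hx'k : x' ^ 2 ^ k = Q ^ j' * (g • z' / z')) :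
    x / x' ≠ 0 ∧ (∀ h ∈ localSubgroup κ.kerSubgroup (v.adicCompletion ℚ), h • t = t → h • (x / x') = x / x') ∧
      τ₀ • (x / x') * (x / x') = Q ^ (a - a') ∧ z / z' ≠ 0 ∧
      (∀ h ∈ localSubgroup κ.kerSubgroup (v.adicCompletion ℚ), h • t = t → h • (z / z') = z / z') ∧
      τ₀ • (z / z') * (z / z') = Q ^ (jz - jz') ∧ (x / x') ^ 2 ^ k = Q ^ (j - j') * (g • (z / z') / (z / z')) := by
  have hτx0 : τ₀ • x' ≠ 0 := (smul_ne_zero_iff_ne τ₀).mpr hx'0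
  have hτz0 : τ₀ • z' ≠ 0 := (smul_ne_zero_iff_ne τ₀).mpr hz'0
  have hgz0 : g • z' ≠ 0 := (smul_ne_zero_iff_ne g).mpr hz'0
  have hτx1 : τ₀ • x' * x' ≠ 0 := by rw [hx'a]; exact zpow_ne_zero _ hQ0
  have hτz1 : τ₀ • z' * z' ≠ 0 := by rw [hz'j]; exact zpow_ne_zero _ hQ0
  refine ⟨div_ne_zero hx0 hx'0, fun h hh hht ↦ by rw [smul_div₀', hxL h hh hht, hx'L h hh hht], ?_,
    div_ne_zero hz0 hz'0, fun h hh hht ↦ by rw [smul_div₀', hzL h hh hht, hz'L h hh hht], ?_, ?_⟩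
  · rw [zpow_sub₀ hQ0, ← hxa, ← hx'a, smul_div₀']
    field_simp
  · rw [zpow_sub₀ hQ0, ← hzj, ← hz'j, smul_div₀']
    field_simp
  · rw [div_pow, hxk, hx'k, zpow_sub₀ hQ0, smul_div₀']
    field_simp

/-- **MAIN: no five pairwise incongruent `2^k`-torsion coinvariant classes.** In the setting of
`exists_div_eq_zpow_mul_coboundary_of_three_even_pow`, among any five `x₀, …, x₄ ∈ T` whose `2^k`-th powers lie in
`B = q^ℤ·(g−1)T`, two are congruent modulo `B`: three of them have exponents `a_i` of the same parity (pigeonhole), and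
dividing by one of these gives three EVEN-exponent data (`div_powTorsion_data`), to which the three-even lemma applies.
Hence the `2^k`-torsion of `E(ℚ_{2,∞})/(g−1)` has at most `4` elements for every `k` (assembly in part 3).
[cite: GreenbergLNM1716, §3 (pp. 87–93)] -/
theorem exists_div_eq_zpow_mul_coboundary_of_five_pow (v : HeightOneSpectrum (𝓞 ℚ)) (n : ℕ)
    {g : absoluteGaloisGroup (v.adicCompletion ℚ)} {ug : ℤ_[2]ˣ}
    (hug : ((κ (resGal (K := ℚ) (v.adicCompletion ℚ) g)).toAdd : ℤ_[2]) = 2 ^ n * (ug : ℤ_[2]))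
    (hgn : g ∈ localSubgroup (κ.layerSubgroup n) (v.adicCompletion ℚ))
    {t : AlgebraicClosure (v.adicCompletion ℚ)}
    (ht : ∀ σ : absoluteGaloisGroup (v.adicCompletion ℚ), σ • t = t ∨ σ • t = -t) (hgt : g • t = t)
    {τ₀ : absoluteGaloisGroup (v.adicCompletion ℚ)} (hτ₀ : τ₀ ∈ localSubgroup κ.kerSubgroup (v.adicCompletion ℚ))
    (hτ₀t : τ₀ • t = -t) {Q : AlgebraicClosure (v.adicCompletion ℚ)}
    (hQfix : ∀ σ : absoluteGaloisGroup (v.adicCompletion ℚ), σ • Q = Q) (hQ0 : Q ≠ 0)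
    (hQtor : ∀ j : ℤ, Q ^ j = 1 → j = 0)
    (hN2 : ∀ c₁ c₂ c₃ : AlgebraicClosure (v.adicCompletion ℚ), c₁ ≠ 0 → c₂ ≠ 0 → c₃ ≠ 0 →
      (∀ h ∈ localSubgroup (κ.layerSubgroup n) (v.adicCompletion ℚ), h • c₁ = c₁) →
      (∀ h ∈ localSubgroup (κ.layerSubgroup n) (v.adicCompletion ℚ), h • c₂ = c₂) →
      (∀ h ∈ localSubgroup (κ.layerSubgroup n) (v.adicCompletion ℚ), h • c₃ = c₃) →
      ∃ f₀ : AlgebraicClosure (v.adicCompletion ℚ), f₀ ≠ 0 ∧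
        (∀ h ∈ localSubgroup (κ.layerSubgroup n) (v.adicCompletion ℚ), h • t = t → h • f₀ = f₀) ∧
        (c₁ = f₀ * τ₀ • f₀ * c₂ ∨ c₁ = f₀ * τ₀ • f₀ * c₃ ∨ c₂ = f₀ * τ₀ • f₀ * c₃))
    (k : ℕ) {x z : Fin 5 → AlgebraicClosure (v.adicCompletion ℚ)} {a j jz : Fin 5 → ℤ} (hx0 : ∀ i, x i ≠ 0)
    (hxL : ∀ i, ∀ h ∈ localSubgroup κ.kerSubgroup (v.adicCompletion ℚ), h • t = t → h • x i = x i)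
    (hxa : ∀ i, τ₀ • x i * x i = Q ^ a i) (hz0 : ∀ i, z i ≠ 0)
    (hzL : ∀ i, ∀ h ∈ localSubgroup κ.kerSubgroup (v.adicCompletion ℚ), h • t = t → h • z i = z i)
    (hzj : ∀ i, τ₀ • z i * z i = Q ^ jz i) (hxk : ∀ i, x i ^ 2 ^ k = Q ^ j i * (g • z i / z i)) :
    ∃ i i' : Fin 5, i ≠ i' ∧ ∃ (c' : ℤ) (w : AlgebraicClosure (v.adicCompletion ℚ)), w ≠ 0 ∧
      (∀ h ∈ localSubgroup κ.kerSubgroup (v.adicCompletion ℚ), h • t = t → h • w = w) ∧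
      (∃ jw : ℤ, τ₀ • w * w = Q ^ jw) ∧ x i / x i' = Q ^ c' * (g • w / w) := by
  -- three indices with exponents of the same parity
  obtain ⟨b, hb⟩ := Fintype.exists_lt_card_fiber_of_mul_lt_card (fun i : Fin 5 ↦ decide (Even (a i)))
    (n := 2) (by simp)
  have hs3 : 3 ≤ Fintype.card {i : Fin 5 // decide (Even (a i)) = b} := by
    rw [Fintype.card_subtype]; exact hb
  let emb : Fin 3 ↪ {i : Fin 5 // decide (Even (a i)) = b} :=
    (Fin.castLEEmb hs3).trans (Fintype.equivFin _).symm.toEmbedding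
  let e : Fin 3 → Fin 5 := fun m ↦ (emb m : Fin 5)
  have he_inj : Function.Injective e := fun m m' h ↦ emb.injective (Subtype.ext h)
  have hpar : ∀ m : Fin 3, decide (Even (a (e m))) = b := fun m ↦ (emb m).2
  set i₀ : Fin 5 := e 0 with hi₀
  -- exponents `a (e m) - a i₀` are even
  have heven : ∀ m : Fin 3, ∃ c : ℤ, a (e m) - a i₀ = 2 * c := by
    intro m
    have h1 : Even (a (e m)) ↔ Even (a i₀) := decide_eq_decide.mp ((hpar m).trans (hpar 0).symm)
    have h2 : Even (a (e m) - a i₀) := Int.even_sub.mpr h1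
    obtain ⟨r, hr⟩ := h2
    exact ⟨r, by rw [hr]; ring⟩
  choose c hc using heven
  -- the quotient data `y m = x (e m) / x i₀`
  have hdata := fun m : Fin 3 ↦ div_powTorsion_data (κ := κ) v hQ0 k (hx0 (e m)) (hx0 i₀) (hxL (e m)) (hxL i₀)
    (hxa (e m)) (hxa i₀) (hz0 (e m)) (hz0 i₀) (hzL (e m)) (hzL i₀) (hzj (e m)) (hzj i₀) (hxk (e m)) (hxk i₀)
  have hyc : ∀ m : Fin 3, τ₀ • (x (e m) / x i₀) * (x (e m) / x i₀) = Q ^ (2 * c m) := fun m ↦ by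
    rw [← hc m]; exact (hdata m).2.2.1
  obtain ⟨m, m', hmm', c', w, hw0, hwL, hwj, hxw⟩ :=
    exists_div_eq_zpow_mul_coboundary_of_three_even_pow (κ := κ) v n hug hgn ht hgt hτ₀ hτ₀t hQfix hQ0 hQtor hN2 k
      (x := fun m ↦ x (e m) / x i₀) (z := fun m ↦ z (e m) / z i₀) (c := c) (j := fun m ↦ j (e m) - j i₀)
      (jz := fun m ↦ jz (e m) - jz i₀)
      (fun m ↦ (hdata m).1) (fun m ↦ (hdata m).2.1) hyc (fun m ↦ (hdata m).2.2.2.1) (fun m ↦ (hdata m).2.2.2.2.1)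
      (fun m ↦ (hdata m).2.2.2.2.2.1) (fun m ↦ (hdata m).2.2.2.2.2.2)
  refine ⟨e m, e m', fun h ↦ hmm' (he_inj h), c', w, hw0, hwL, hwj, ?_⟩
  have hxi₀ := hx0 i₀
  have hxm' := hx0 (e m')
  rw [← hxw]
  field_simp

end Literature.NumberTheory.EllipticCurves.Greenberg1999.MultTowerNS2

end Part19

/-!
## Part 20 — port of `Summits/BirchSwinnertonDyer/BirchSwinnertonDyer/Theorems/ByReductionTypeAtTwoTowerLayerNat.lean` (1 declarations kept)

# Multiplicative reduction at a rational prime depends only on the prime (`hasMultiplicativeReductionAtPrime_congr`, transport along an equality of primes)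

Declarations of this Part (verbatim port; each keeps its own docstring and citation): `hasMultiplicativeReductionAtPrime_congr`.

Reference keys (see `references.bib` and the declarations' citations): [GreenbergLNM1716].
-/

section Part20

set_option autoImplicit false

open scoped _root_.Classical _root_.MatrixGroups _root_.ModularForm

open _root_.NumberField _root_.IsDedekindDomain _root_.CongruenceSubgroup _root_.WeierstrassCurve Literature.NumberTheory.EllipticCurves Literature.NumberTheory.EllipticCurves.ModularForms Literature.NumberTheory.EllipticCurves.Rank1Residual Literature.NumberTheory.EllipticCurves.Rank1Residual.Typed Literature.NumberTheory.EllipticCurves.Greenberg1999 Literature.NumberTheory.GaloisRepresentations Literature.NumberTheory.EllipticCurves.Greenberg1999 _root_.Rat.HeightOneSpectrum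

namespace Literature.NumberTheory.EllipticCurves.Greenberg1999.MultTransportAtTwo

section Places

/-- Transport of `HasMultiplicativeReductionAtPrime` along an equality of primes (the `Fact` instances
are propositionally irrelevant). [cite: GreenbergLNM1716, §3 (supporting lemma)] -/
theorem hasMultiplicativeReductionAtPrime_congr (W : WeierstrassCurve ℚ) {q q' : ℕ} (h : q = q')
    [Fact q.Prime] [Fact q'.Prime] :
    W.HasMultiplicativeReductionAtPrime q ↔ W.HasMultiplicativeReductionAtPrime q' := by
  subst h; exact Iff.rfl

end Places

end Literature.NumberTheory.EllipticCurves.Greenberg1999.MultTransportAtTwo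

end Part20

/-!
## Part 21 — port of `Summits/BirchSwinnertonDyer/BirchSwinnertonDyer/Theorems/ByReductionTypeAtTwoMultTowerNS2QuadraticNormIndex.lean` (5 declarations kept)

# Kernel brick 17 — the class field axiom for the quadratic layer `K̄_v^{H_n ∩ Stab(t)} / F_n`: among three elements of `F_nˣ` two are congruent modulo norms `f · τ₀

Declarations of this Part (verbatim port; each keeps its own docstring and citation): `stabilizer_normal`, `isOpen_stabilizer`, `neg_ne_self_of_ne_zero`, `relIndex_inf_stabilizer_eq_two`, `exists_norm_rel_of_three`.

Reference keys (see `references.bib` and the declarations' citations): [NeukirchANT1999].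
-/

section Part21

set_option autoImplicit false
open scoped _root_.Classical _root_.IntermediateField

namespace Literature.NumberTheory.EllipticCurves.Greenberg1999.MultTowerNS2

open _root_.NumberField _root_.IsDedekindDomain _root_.Field Literature.NumberTheory.EllipticCurves
  Literature.NumberTheory.GaloisRepresentations

variable {κ : ZpExtension ℚ 2}

/-! ### The subgroup `H_n ∩ Stab(t)` -/

/-- The stabiliser in `Γ_{ℚ_v}` of an element `t` with `σ t = ± t` for every `σ` is a normal subgroup. [cite: NeukirchANT1999, Ch. V §1 Thm. (1.1)] -/
theorem stabilizer_normal (v : HeightOneSpectrum (𝓞 ℚ)) {t : AlgebraicClosure (v.adicCompletion ℚ)}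
    (ht : ∀ σ : absoluteGaloisGroup (v.adicCompletion ℚ), σ • t = t ∨ σ • t = -t) :
    (MulAction.stabilizer (absoluteGaloisGroup (v.adicCompletion ℚ)) t).Normal := by
  refine ⟨fun h hh σ ↦ ?_⟩
  rw [MulAction.mem_stabilizer_iff] at hh ⊢
  have hσ' : σ • σ⁻¹ • t = t := smul_inv_smul σ t
  rcases ht σ⁻¹ with h1 | h1
  · rw [h1] at hσ'
    rw [mul_smul, mul_smul, h1, hh]
    exact hσ'
  · rw [h1] at hσ'
    rw [mul_smul, mul_smul, h1, smul_neg, hh]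
    exact hσ'

/-- The stabiliser of an element of `K̄_v` in `Γ_{ℚ_v}` is open (it contains the open subgroup `Gal(K̄_v/ℚ_v(t))`).
[cite: NeukirchANT1999, Ch. V §1 Thm. (1.1)] -/
theorem isOpen_stabilizer (v : HeightOneSpectrum (𝓞 ℚ)) (t : AlgebraicClosure (v.adicCompletion ℚ)) :
    IsOpen (MulAction.stabilizer (absoluteGaloisGroup (v.adicCompletion ℚ)) t :
      Set (absoluteGaloisGroup (v.adicCompletion ℚ))) := by
  have hint : IsIntegral (v.adicCompletion ℚ) t := Algebra.IsIntegral.isIntegral t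
  haveI : FiniteDimensional (v.adicCompletion ℚ) (v.adicCompletion ℚ)⟮t⟯ := IntermediateField.adjoin.finiteDimensional hint
  refine Subgroup.isOpen_mono ?_ (IntermediateField.fixingSubgroup_isOpen (v.adicCompletion ℚ)⟮t⟯)
  intro σ hσ
  exact MulAction.mem_stabilizer_iff.mpr
    ((IntermediateField.mem_fixingSubgroup_iff _ _).mp hσ t (IntermediateField.mem_adjoin_simple_self _ t))

/-- `−t ≠ t` for `t ≠ 0` in `K̄_v` (characteristic `0`). [cite: NeukirchANT1999, Ch. V §1 Thm. (1.1)] -/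
theorem neg_ne_self_of_ne_zero (v : HeightOneSpectrum (𝓞 ℚ)) {t : AlgebraicClosure (v.adicCompletion ℚ)}
    (ht0 : t ≠ 0) : -t ≠ t := by
  haveI : CharZero (v.adicCompletion ℚ) :=
    charZero_of_injective_algebraMap (algebraMap ℚ (v.adicCompletion ℚ)).injective
  haveI : CharZero (AlgebraicClosure (v.adicCompletion ℚ)) :=
    charZero_of_injective_algebraMap (algebraMap (v.adicCompletion ℚ) (AlgebraicClosure (v.adicCompletion ℚ))).injective
  intro h
  have h2 : (2 : AlgebraicClosure (v.adicCompletion ℚ)) * t = 0 := by linear_combination -h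
  exact ht0 ((mul_eq_zero.mp h2).resolve_left two_ne_zero)

/-- **`[H : H ∩ Stab(t)] = 2`** whenever `H ≤ Γ_{ℚ_v}` contains an element `τ₀` flipping `t ≠ 0` (`σ t = ± t` for all
`σ`): `b ↦ b τ₀` exchanges `H ∩ Stab(t)` and its complement in `H`. [cite: NeukirchANT1999, Ch. V §1 Thm. (1.1)] -/
theorem relIndex_inf_stabilizer_eq_two (v : HeightOneSpectrum (𝓞 ℚ)) {t : AlgebraicClosure (v.adicCompletion ℚ)}
    (ht : ∀ σ : absoluteGaloisGroup (v.adicCompletion ℚ), σ • t = t ∨ σ • t = -t) (ht0 : t ≠ 0)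
    {H : Subgroup (absoluteGaloisGroup (v.adicCompletion ℚ))} {τ₀ : absoluteGaloisGroup (v.adicCompletion ℚ)}
    (hτ₀ : τ₀ ∈ H) (hτ₀t : τ₀ • t = -t) :
    (H ⊓ MulAction.stabilizer (absoluteGaloisGroup (v.adicCompletion ℚ)) t).relIndex H = 2 := by
  have hne := neg_ne_self_of_ne_zero v ht0
  rw [Subgroup.relIndex_eq_two_iff]
  refine ⟨τ₀, hτ₀, fun b hb ↦ ?_⟩
  rw [Subgroup.mem_inf, Subgroup.mem_inf, MulAction.mem_stabilizer_iff, MulAction.mem_stabilizer_iff, mul_smul, hτ₀t,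
    smul_neg]
  rcases ht b with h | h
  · rw [h]
    exact Or.inr ⟨⟨hb, rfl⟩, fun h' ↦ hne h'.2⟩
  · rw [h, neg_neg]
    exact Or.inl ⟨⟨H.mul_mem hb hτ₀, rfl⟩, fun h' ↦ hne h'.2⟩

/-! ### The class field axiom for the quadratic layer, in «three elements, two congruent» form -/

/-- **Among three elements of `F_nˣ`, two are congruent modulo norms from `L₀ = K̄_v^{H_n ∩ Stab(t)}`.** Let `v ∋ 2`,
`κ` cyclotomic, `H_n = localSubgroup (κ.layerSubgroup n) ℚ_v`, `t ∈ K̄_v`, `t ≠ 0`, with `σ t = ± t` for all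
`σ ∈ Γ_{ℚ_v}`, and `τ₀ ∈ H_n` with `τ₀ t = −t`. For any three non-zero `H_n`-invariant `c₁, c₂, c₃ ∈ K̄_v` there is a
non-zero `f₀`, fixed by `H_n ∩ Stab(t)`, with `c₁ = f₀·τ₀f₀·c₂` or `c₁ = f₀·τ₀f₀·c₃` or `c₂ = f₀·τ₀f₀·c₃`. Proof:
`D = H_n ∩ Stab(t)` is open, normal, of index `2` in `H_n`; `L₀ = K̄_v^D` is Galois over `ℚ_v` (Krull), hence over
`F_n = K̄_v^{H_n}`, of degree `[Γ : D]/[Γ : H_n] = 2`, so cyclic with group `{1, τ₀|_{L₀}}` and `N(f) = f·τ₀f`; the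
local class field axiom `[F_nˣ : N L₀ˣ] = [L₀ : F_n] = 2` (Neukirch V (1.1), the tree's
`normIndex_eq_finrank_of_isNonarchimedeanLocalField`) and pigeonhole in the quotient of order `2`.
[cite: NeukirchANT1999, Ch. V §1 Thm. (1.1)] -/
theorem exists_norm_rel_of_three (hκ : κ.IsCyclotomic) (v : HeightOneSpectrum (𝓞 ℚ))
    (hv : ((2 : ℕ) : 𝓞 ℚ) ∈ v.asIdeal) (n : ℕ) {t : AlgebraicClosure (v.adicCompletion ℚ)}
    (ht : ∀ σ : absoluteGaloisGroup (v.adicCompletion ℚ), σ • t = t ∨ σ • t = -t) (ht0 : t ≠ 0)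
    {τ₀ : absoluteGaloisGroup (v.adicCompletion ℚ)}
    (hτ₀ : τ₀ ∈ localSubgroup (κ.layerSubgroup n) (v.adicCompletion ℚ)) (hτ₀t : τ₀ • t = -t)
    (c₁ c₂ c₃ : AlgebraicClosure (v.adicCompletion ℚ)) (h₁ : c₁ ≠ 0) (h₂ : c₂ ≠ 0) (h₃ : c₃ ≠ 0)
    (hc₁ : ∀ h ∈ localSubgroup (κ.layerSubgroup n) (v.adicCompletion ℚ), h • c₁ = c₁)
    (hc₂ : ∀ h ∈ localSubgroup (κ.layerSubgroup n) (v.adicCompletion ℚ), h • c₂ = c₂)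
    (hc₃ : ∀ h ∈ localSubgroup (κ.layerSubgroup n) (v.adicCompletion ℚ), h • c₃ = c₃) :
    ∃ f₀ : AlgebraicClosure (v.adicCompletion ℚ), f₀ ≠ 0 ∧
      (∀ h ∈ localSubgroup (κ.layerSubgroup n) (v.adicCompletion ℚ), h • t = t → h • f₀ = f₀) ∧
      (c₁ = f₀ * τ₀ • f₀ * c₂ ∨ c₁ = f₀ * τ₀ • f₀ * c₃ ∨ c₂ = f₀ * τ₀ • f₀ * c₃) := by
  -- the groups (all terms mentioning `localSubgroup` are built BEFORE a `CharZero ℚ_v` instance enters the context)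
  set Hn : Subgroup (absoluteGaloisGroup (v.adicCompletion ℚ)) := localSubgroup (κ.layerSubgroup n) (v.adicCompletion ℚ)
    with hHn
  have hopenHn : IsOpen (Hn : Set (absoluteGaloisGroup (v.adicCompletion ℚ))) :=
    isOpen_localSubgroup (κ.layerSubgroup n) (κ.isOpen_layerSubgroup n) (v.adicCompletion ℚ)
  have hnormHn : Hn.Normal := by
    rw [hHn, localSubgroup_eq_comap]; exact Subgroup.Normal.comap inferInstance _
  have hidxHn : Hn.index = 2 ^ n := index_localSubgroup_layerSubgroup hκ v hv n
  set St : Subgroup (absoluteGaloisGroup (v.adicCompletion ℚ)) :=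
    MulAction.stabilizer (absoluteGaloisGroup (v.adicCompletion ℚ)) t with hSt
  have hopenSt : IsOpen (St : Set (absoluteGaloisGroup (v.adicCompletion ℚ))) := isOpen_stabilizer v t
  have hnormSt : St.Normal := stabilizer_normal v ht
  set D : Subgroup (absoluteGaloisGroup (v.adicCompletion ℚ)) := Hn ⊓ St with hD
  have hopenD : IsOpen (D : Set (absoluteGaloisGroup (v.adicCompletion ℚ))) := hopenHn.inter hopenSt
  have hnormD : D.Normal := by
    haveI := hnormHn
    haveI := hnormSt
    exact Subgroup.normal_inf_normal Hn St
  have hDle : D ≤ Hn := inf_le_left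
  have hrel : D.relIndex Hn = 2 := relIndex_inf_stabilizer_eq_two v ht ht0 hτ₀ hτ₀t
  have hidxD : D.index = 2 * 2 ^ n := by rw [← Subgroup.relIndex_mul_index hDle, hrel, hidxHn]
  have memD : ∀ {h : absoluteGaloisGroup (v.adicCompletion ℚ)}, h ∈ D ↔ h ∈ Hn ∧ h • t = t := fun {h} ↦ by
    rw [hD, Subgroup.mem_inf, hSt, MulAction.mem_stabilizer_iff]
  have hne := neg_ne_self_of_ne_zero v ht0
  -- (`CharZero ℚ_v` from here on)
  haveI : CharZero (v.adicCompletion ℚ) :=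
    charZero_of_injective_algebraMap (algebraMap ℚ (v.adicCompletion ℚ)).injective
  -- the fields `F_n = K̄^{H_n} ≤ L₀ = K̄^D`
  set K₀ : IntermediateField (v.adicCompletion ℚ) (AlgebraicClosure (v.adicCompletion ℚ)) :=
    IntermediateField.fixedField Hn with hK₀
  set L₀ : IntermediateField (v.adicCompletion ℚ) (AlgebraicClosure (v.adicCompletion ℚ)) :=
    IntermediateField.fixedField D with hL₀
  have memK : ∀ {x : AlgebraicClosure (v.adicCompletion ℚ)}, x ∈ K₀ ↔ ∀ h ∈ Hn, h • x = x := fun {x} ↦ by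
    rw [hK₀, IntermediateField.mem_fixedField_iff]; rfl
  have memL : ∀ {x : AlgebraicClosure (v.adicCompletion ℚ)}, x ∈ L₀ ↔ ∀ h ∈ Hn, h • t = t → h • x = x :=
    fun {x} ↦ by
      rw [hL₀, IntermediateField.mem_fixedField_iff]
      exact ⟨fun H h hh hht ↦ H h (memD.mpr ⟨hh, hht⟩), fun H h hh ↦ H h (memD.mp hh).1 (memD.mp hh).2⟩
  have hKL : K₀ ≤ L₀ := fun x hx ↦ memL.mpr fun h hh _ ↦ memK.mp hx h hh
  have htL : t ∈ L₀ := memL.mpr fun h _ hht ↦ hht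
  haveI hfinK : FiniteDimensional (v.adicCompletion ℚ) K₀ := finiteDimensional_fixedField_of_isOpen Hn hopenHn
  haveI hfinL : FiniteDimensional (v.adicCompletion ℚ) L₀ := finiteDimensional_fixedField_of_isOpen D hopenD
  have hrkK : Module.finrank (v.adicCompletion ℚ) K₀ = 2 ^ n := by
    rw [hK₀, finrank_fixedField_of_isOpen Hn hopenHn, hidxHn]
  have hrkL : Module.finrank (v.adicCompletion ℚ) L₀ = 2 * 2 ^ n := by
    rw [hL₀, finrank_fixedField_of_isOpen D hopenD, hidxD]
  -- `L₀ / ℚ_v` is Galois (Krull: `D` is open and normal)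
  haveI hGalL : IsGalois (v.adicCompletion ℚ) L₀ := by
    have hfix := fixingSubgroup_fixedField_of_isOpen D hopenD
    have key := fun x ↦ SetLike.ext_iff.mp hfix x
    refine (InfiniteGalois.normal_iff_isGalois _).mp ?_
    exact ⟨fun a ha b ↦ (key _).mpr (hnormD.conj_mem a ((key a).mp ha) b)⟩
  -- `L₀` as a `K₀`-algebra: Galois, of degree `2`, cyclic
  letI : Algebra K₀ L₀ := LocalWeilDatum.towerAlgebra hKL
  haveI : IsScalarTower (v.adicCompletion ℚ) K₀ L₀ := LocalWeilDatum.towerAlgebra_isScalarTower_bot hKL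
  haveI hfinKL : FiniteDimensional K₀ L₀ := LocalWeilDatum.towerAlgebra_finiteDimensional hKL
  haveI hGal : IsGalois K₀ L₀ := IsGalois.tower_top_of_isGalois (v.adicCompletion ℚ) K₀ L₀
  haveI : Module.Free K₀ L₀ := Module.Free.of_divisionRing K₀ L₀
  have hrk : Module.finrank K₀ L₀ = 2 := by
    have h := Module.finrank_mul_finrank (v.adicCompletion ℚ) K₀ L₀
    rw [hrkK, hrkL] at h
    apply Nat.eq_of_mul_eq_mul_left (Nat.pos_of_ne_zero (pow_ne_zero n two_ne_zero))
    rw [h, mul_comm]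
  have hcard : Nat.card (L₀ ≃ₐ[K₀] L₀) = 2 := by rw [IsGalois.card_aut_eq_finrank K₀ L₀, hrk]
  haveI : IsCyclic (L₀ ≃ₐ[K₀] L₀) := isCyclic_of_prime_card hcard
  -- the CLASS FIELD AXIOM `[K₀ˣ : N L₀ˣ] = 2`
  have hidx : (Units.map (Algebra.norm K₀ : L₀ →* K₀)).range.index = 2 := by
    rw [normIndex_eq_finrank_of_isNonarchimedeanLocalField (v.adicCompletion ℚ) K₀ L₀, hrk]
  -- the restriction `τ̄₀ ∈ Gal(L₀/K₀)` of `τ₀` and the norm formula `N(f) = f · τ₀ f`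
  let r : L₀ ≃ₐ[v.adicCompletion ℚ] L₀ :=
    (absoluteGaloisGroup.toAlgEquiv (v.adicCompletion ℚ) τ₀).restrictNormal L₀
  have hr : ∀ x : L₀, ((r x : L₀) : AlgebraicClosure (v.adicCompletion ℚ)) =
      τ₀ • (x : AlgebraicClosure (v.adicCompletion ℚ)) := fun x ↦
    AlgEquiv.restrictNormal_commutes _ L₀ x
  let τ : L₀ ≃ₐ[K₀] L₀ := AlgEquiv.ofRingEquiv (f := r.toRingEquiv) (fun k ↦ by
    apply Subtype.ext
    change ((r (algebraMap K₀ L₀ k) : L₀) : AlgebraicClosure (v.adicCompletion ℚ)) =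
      ((algebraMap K₀ L₀ k : L₀) : AlgebraicClosure (v.adicCompletion ℚ))
    rw [hr, LocalWeilDatum.towerAlgebra_algebraMap_apply]
    exact memK.mp k.2 τ₀ hτ₀)
  have hτ : ∀ x : L₀, ((τ x : L₀) : AlgebraicClosure (v.adicCompletion ℚ)) =
      τ₀ • (x : AlgebraicClosure (v.adicCompletion ℚ)) := fun x ↦ by exact hr x
  have hτ1 : τ ≠ 1 := by
    intro h
    have h1 : ((τ ⟨t, htL⟩ : L₀) : AlgebraicClosure (v.adicCompletion ℚ)) = τ₀ • t := hτ ⟨t, htL⟩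
    rw [h, AlgEquiv.one_apply, hτ₀t] at h1
    exact hne h1.symm
  have hall : ∀ σ : L₀ ≃ₐ[K₀] L₀, σ = 1 ∨ σ = τ := by
    intro σ
    by_contra hσ
    push Not at hσ
    letI : Fintype (L₀ ≃ₐ[K₀] L₀) := Fintype.ofFinite _
    have h3 : ({σ, 1, τ} : Finset (L₀ ≃ₐ[K₀] L₀)).card = 3 := by
      rw [Finset.card_insert_of_notMem (by simp [hσ.1, hσ.2]), Finset.card_pair hτ1.symm]
    have hle := Finset.card_le_univ ({σ, 1, τ} : Finset (L₀ ≃ₐ[K₀] L₀))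
    rw [h3, ← Nat.card_eq_fintype_card, hcard] at hle
    omega
  have hnorm : ∀ f : L₀, ((Algebra.norm K₀ f : K₀) : AlgebraicClosure (v.adicCompletion ℚ)) =
      (f : AlgebraicClosure (v.adicCompletion ℚ)) * τ₀ • (f : AlgebraicClosure (v.adicCompletion ℚ)) := fun f ↦ by
    have h := Algebra.norm_eq_prod_automorphisms K₀ f
    rw [Finset.prod_eq_mul 1 τ hτ1.symm (fun c _ hc ↦ ((hall c).elim hc.1 hc.2).elim)
      (fun h1 ↦ (h1 (Finset.mem_univ _)).elim) (fun h1 ↦ (h1 (Finset.mem_univ _)).elim), AlgEquiv.one_apply] at h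
    have h' : ((Algebra.norm K₀ f : K₀) : AlgebraicClosure (v.adicCompletion ℚ)) =
        ((f * τ f : L₀) : AlgebraicClosure (v.adicCompletion ℚ)) :=
      congrArg (fun y : L₀ ↦ (y : AlgebraicClosure (v.adicCompletion ℚ))) h
    rw [h', MulMemClass.coe_mul, hτ]
  -- pigeonhole in the quotient `K₀ˣ / N L₀ˣ` of order `2`
  set N : Subgroup K₀ˣ := (Units.map (Algebra.norm K₀ : L₀ →* K₀)).range with hN
  have hcardQ : Nat.card (K₀ˣ ⧸ N) = 2 := hidx
  haveI : Finite (K₀ˣ ⧸ N) := Nat.finite_of_card_ne_zero (by rw [hcardQ]; decide)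
  have three : ∀ q₁ q₂ q₃ : K₀ˣ ⧸ N, q₁ = q₂ ∨ q₁ = q₃ ∨ q₂ = q₃ := by
    intro q₁ q₂ q₃
    by_contra hq
    push Not at hq
    obtain ⟨h12, h13, h23⟩ := hq
    letI : Fintype (K₀ˣ ⧸ N) := Fintype.ofFinite _
    have h3 : ({q₁, q₂, q₃} : Finset (K₀ˣ ⧸ N)).card = 3 := by
      rw [Finset.card_insert_of_notMem (by simp [h12, h13]), Finset.card_pair h23]
    have hle := Finset.card_le_univ ({q₁, q₂, q₃} : Finset (K₀ˣ ⧸ N))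
    rw [h3, ← Nat.card_eq_fintype_card, hcardQ] at hle
    omega
  -- units of `K₀` from the `cᵢ`
  have mk : ∀ c : AlgebraicClosure (v.adicCompletion ℚ), c ≠ 0 → (∀ h ∈ Hn, h • c = c) →
      ∃ u : K₀ˣ, ((u : K₀) : AlgebraicClosure (v.adicCompletion ℚ)) = c := fun c hc0 hc ↦
    ⟨Units.mk0 ⟨c, memK.mpr hc⟩ (fun h ↦ hc0 (congrArg Subtype.val h)), rfl⟩
  obtain ⟨u₁, hu₁⟩ := mk c₁ h₁ hc₁
  obtain ⟨u₂, hu₂⟩ := mk c₂ h₂ hc₂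
  obtain ⟨u₃, hu₃⟩ := mk c₃ h₃ hc₃
  -- congruent units differ by a norm `f₀ · τ₀ f₀`, `f₀ ∈ L₀ˣ`
  have key : ∀ {u u' : K₀ˣ}, (QuotientGroup.mk u : K₀ˣ ⧸ N) = QuotientGroup.mk u' →
      ∃ f₀ : AlgebraicClosure (v.adicCompletion ℚ), f₀ ≠ 0 ∧ (∀ h ∈ Hn, h • t = t → h • f₀ = f₀) ∧
        ((u' : K₀) : AlgebraicClosure (v.adicCompletion ℚ)) =
          f₀ * τ₀ • f₀ * ((u : K₀) : AlgebraicClosure (v.adicCompletion ℚ)) := by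
    intro u u' huu
    rw [QuotientGroup.eq, hN, MonoidHom.mem_range] at huu
    obtain ⟨fu, hfu⟩ := huu
    refine ⟨((fu : L₀) : AlgebraicClosure (v.adicCompletion ℚ)), fun h0 ↦ fu.ne_zero (Subtype.ext h0),
      fun h hh hht ↦ memL.mp (fu : L₀).2 h hh hht, ?_⟩
    have h2 : u * Units.map (Algebra.norm K₀ : L₀ →* K₀) fu = u' := by rw [hfu, mul_inv_cancel_left]
    have h3 := congrArg (fun w : K₀ˣ ↦ ((w : K₀) : AlgebraicClosure (v.adicCompletion ℚ))) h2
    simp only [Units.val_mul, Units.coe_map, MulMemClass.coe_mul] at h3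
    rw [hnorm] at h3
    rw [← h3]
    ring
  rcases three (QuotientGroup.mk u₁) (QuotientGroup.mk u₂) (QuotientGroup.mk u₃) with h | h | h
  · obtain ⟨f₀, hf0, hfL, hrel'⟩ := key h.symm
    exact ⟨f₀, hf0, hfL, Or.inl (by rw [← hu₁, ← hu₂]; exact hrel')⟩
  · obtain ⟨f₀, hf0, hfL, hrel'⟩ := key h.symm
    exact ⟨f₀, hf0, hfL, Or.inr (Or.inl (by rw [← hu₁, ← hu₃]; exact hrel'))⟩
  · obtain ⟨f₀, hf0, hfL, hrel'⟩ := key h.symm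
    exact ⟨f₀, hf0, hfL, Or.inr (Or.inr (by rw [← hu₂, ← hu₃]; exact hrel'))⟩

end Literature.NumberTheory.EllipticCurves.Greenberg1999.MultTowerNS2

end Part21

/-!
## Part 22 — port of `Summits/BirchSwinnertonDyer/BirchSwinnertonDyer/Theorems/ByReductionTypeAtTwoMultTowerNS2OrderBound.lean` (4 declarations kept)

# The order of the local tower kernel at a non-split multiplicative `2`, part 3 — `#𝒦_{v,n}[2^∞] ≤ 4` at every layer, and the named fact `hNS2 = Greenberg1999

Declarations of this Part (verbatim port; each keeps its own docstring and citation): `powTorsion_localTowerKerPrimary_le_four_nonsplitTwo`, `finite_and_natCard_le_of_forall_torsionBy_pow`, `finite_and_natCard_localTowerKerPrimary_le_four_nonsplitTwo`, `sec3_natCard_localTowerKerPrimary_le_four_nonsplitMultiplicative_two_holds`.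

Reference keys (see `references.bib` and the declarations' citations): [GreenbergLNM1716], [SilvermanATAEC1994], [NeukirchANT1999], [SilvermanAEC2009].
-/

section Part22

set_option autoImplicit false
open scoped _root_.Classical _root_.IntermediateField

namespace Literature.NumberTheory.EllipticCurves.Greenberg1999.MultTowerNS2

open _root_.NumberField _root_.IsDedekindDomain _root_.Field _root_.WeierstrassCurve _root_.PadicInt _root_.Rat.HeightOneSpectrum
  Literature.NumberTheory.EllipticCurves Literature.NumberTheory.EllipticCurves.ResKernel
  Literature.NumberTheory.GaloisRepresentations

variable {κ : ZpExtension ℚ 2}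

/-! ### The assembly at exponent `2^k`: `#𝒦_{v,n}[2^∞][2^k] ≤ 4` at every non-split `2` -/

/-- **`#𝒦_{v,n}[2^∞][2^k] ≤ 4` at EVERY non-split multiplicative `2`, every `k` — KERNEL theorem.** For a globally minimal
`W/ℚ`, multiplicative and NON-SPLIT at `2`, every cyclotomic `ℤ₂`-datum `κ`, the place `v ∋ 2`, every layer `n` and every
`k`, the `2^k`-torsion of the local tower kernel `𝒦_{v,n}[2^∞]` is finite of order at most `4`. Proof: BRICK 11 (at
`m = 2^k`) embeds it into the `2^k`-torsion of `M_∞/(g−1)M_∞`; Tate's twisted uniformisation identifies `M_∞` with `Ψ(T)`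
(BRICK 18); `exists_div_eq_zpow_mul_coboundary_of_five_pow` (with BRICK 17 for the quadratic class field input, BRICK 10
for the flip, BRICK 15 for the generator) shows that among any five `2^k`-torsion classes two coincide. The case `k = 1` is
GEN 10's `twoTorsion_localTowerKerPrimary_le_four_nonsplitTwo`. [cite: GreenbergLNM1716, §3 (pp. 85–93)]
[cite: SilvermanATAEC1994, Thm. V.5.3, Lemma V.5.2 (c)] [cite: NeukirchANT1999, Ch. V §1 Thm. (1.1)] -/
theorem powTorsion_localTowerKerPrimary_le_four_nonsplitTwo (W : WeierstrassCurve ℚ) [W.IsElliptic] [W.IsGloballyMinimal]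
    (hmult : W.HasMultiplicativeReductionAtPrime 2) (hns : ¬ W.HasSplitMultiplicativeReductionAtPrime 2)
    (hκ : κ.IsCyclotomic) (v : HeightOneSpectrum (𝓞 ℚ)) (hv : ((2 : ℕ) : 𝓞 ℚ) ∈ v.asIdeal) (n k : ℕ) :
    Finite {x : W.localTowerKerPrimary κ (v.adicCompletion ℚ) n // 2 ^ k • x = 0} ∧
      Nat.card {x : W.localTowerKerPrimary κ (v.adicCompletion ℚ) n // 2 ^ k • x = 0} ≤ 4 := by
  -- the groups
  have hile : localSubgroup κ.kerSubgroup (v.adicCompletion ℚ) ≤ localSubgroup (κ.layerSubgroup n) (v.adicCompletion ℚ) :=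
    fun τ hτ ↦ by
      rw [mem_localSubgroup_iff] at hτ ⊢
      exact κ.kerSubgroup_le_layerSubgroup n hτ
  -- S0: multiplicative reduction at the place `v`
  haveI hfact : Fact (Nat.Prime (primesEquiv v : ℕ)) := ⟨(primesEquiv v).2⟩
  have hp2 : ((primesEquiv v : Nat.Primes) : ℕ) = 2 := Rat.HeightOneSpectrum.primesEquiv_eq_of_natCast_mem v Nat.prime_two hv
  have hmultv : W.HasMultiplicativeReductionAt v :=
    (hasMultiplicativeReductionAtPrime_iff_hasMultiplicativeReductionAt_ringOfIntegers (W := W) v).mp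
      ((MultTransportAtTwo.hasMultiplicativeReductionAtPrime_congr W hp2).mpr hmult)
  -- Tate's twisted uniformisation at `v`
  obtain ⟨q, t, Ψ, hq0, hqv, -, -, ht0, ht2, hsurj, hker, hequiv⟩ :=
    TateCurve.exists_twistedTateUniformisation_tateJ W v hmultv
  set Q : AlgebraicClosure (v.adicCompletion ℚ) :=
    algebraMap (v.adicCompletion ℚ) (AlgebraicClosure (v.adicCompletion ℚ)) q with hQ
  have hQ0 : Q ≠ 0 := by rw [hQ]; exact (map_ne_zero _).mpr hq0
  have hQfix : ∀ σ : absoluteGaloisGroup (v.adicCompletion ℚ), σ • Q = Q := fun σ ↦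
    AlgEquiv.commutes (absoluteGaloisGroup.toAlgEquiv _ σ) q
  have hQtor : ∀ j : ℤ, Q ^ j = 1 → j = 0 := by
    intro j hj
    have hj' : q ^ j = 1 := by
      apply (algebraMap (v.adicCompletion ℚ) (AlgebraicClosure (v.adicCompletion ℚ))).injective
      rw [map_zpow₀, map_one]; exact hj
    have hq1 : ‖q‖ < 1 := Valued.toNormedField.norm_lt_one_iff.mpr hqv
    have hpow : ∀ m : ℕ, q ^ m = 1 → m = 0 := fun m hm ↦ by
      by_contra hm0
      have h1 : ‖q‖ ^ m < 1 := pow_lt_one₀ (norm_nonneg q) hq1 hm0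
      rw [← norm_pow, hm, norm_one] at h1
      exact lt_irrefl _ h1
    cases j with
    | ofNat m =>
      rw [Int.ofNat_eq_natCast, zpow_natCast] at hj'
      rw [Int.ofNat_eq_natCast, hpow m hj']
      rfl
    | negSucc m =>
      rw [zpow_negSucc, inv_eq_one] at hj'
      exact absurd (hpow (m + 1) hj') (Nat.succ_ne_zero m)
  -- `σ t = ± t`, `-t ≠ t`
  have ht : ∀ σ : absoluteGaloisGroup (v.adicCompletion ℚ), σ • t = t ∨ σ • t = -t := fun σ ↦ by
    apply sq_eq_sq_iff_eq_or_eq_neg.mp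
    rw [← smul_pow', ht2]
    exact AlgEquiv.commutes (absoluteGaloisGroup.toAlgEquiv _ σ) _
  have hne : -t ≠ t := neg_ne_self_of_ne_zero v ht0
  -- equivariance in value form
  have hequiv' : ∀ (σ : absoluteGaloisGroup (v.adicCompletion ℚ)) (w w' : (AlgebraicClosure (v.adicCompletion ℚ))ˣ),
      (w' : AlgebraicClosure (v.adicCompletion ℚ)) = σ • (w : AlgebraicClosure (v.adicCompletion ℚ)) →
        σ • Ψ (Additive.ofMul w) = (if σ • t = t then (1 : ℤ) else -1) • Ψ (Additive.ofMul w') := by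
    intro σ w w' h
    have hw' : w' = Units.map (absoluteGaloisGroup.toAlgEquiv (v.adicCompletion ℚ) σ :
        AlgebraicClosure (v.adicCompletion ℚ) →* AlgebraicClosure (v.adicCompletion ℚ)) w := Units.ext h
    rw [hw']
    exact hequiv σ w
  -- the flip `τ₀ ∈ H_∞` (BRICK 10)
  obtain ⟨τ₀, hτ₀, hτ₀t⟩ :=
    exists_mem_localSubgroup_kerSubgroup_smul_sqrt_gamma_eq_neg W hκ hmult hns v hv t ht2
  -- a topological generator `g ∈ H_n` of `H_n` modulo `H_∞` FIXING `t`
  obtain ⟨g, hgn, hgen, hgt⟩ : ∃ g ∈ localSubgroup (κ.layerSubgroup n) (v.adicCompletion ℚ),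
      (∀ U : Subgroup (absoluteGaloisGroup (v.adicCompletion ℚ)),
        IsOpen (U : Set (absoluteGaloisGroup (v.adicCompletion ℚ))) →
          localSubgroup κ.kerSubgroup (v.adicCompletion ℚ) ≤ U → g ∈ U →
            localSubgroup (κ.layerSubgroup n) (v.adicCompletion ℚ) ≤ U) ∧ g • t = t := by
    obtain ⟨g₀, hg₀, hg₀gen⟩ := ZpExtension.exists_mem_localSubgroup_generate κ (v.adicCompletion ℚ) n
    rcases ht g₀ with h | h
    · exact ⟨g₀, hg₀, hg₀gen, h⟩
    · refine ⟨g₀ * τ₀, Subgroup.mul_mem _ hg₀ (hile hτ₀), fun U hU hiU hgU ↦ hg₀gen U hU hiU ?_, ?_⟩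
      · have h1 := U.mul_mem hgU (U.inv_mem (hiU hτ₀))
        rwa [mul_inv_cancel_right] at h1
      · rw [mul_smul, hτ₀t, smul_neg, h, neg_neg]
  -- `κ(res g) = 2^n · unit` (BRICK 15)
  obtain ⟨ug, hug⟩ := exists_units_kappa_resGal_eq_of_generate hκ v hv n hgn hgen
  -- the quadratic class field input (BRICK 17)
  have hN2 := fun (c₁ c₂ c₃ : AlgebraicClosure (v.adicCompletion ℚ)) (h1 : c₁ ≠ 0) (h2 : c₂ ≠ 0) (h3 : c₃ ≠ 0)
      (hc₁ : ∀ h ∈ localSubgroup (κ.layerSubgroup n) (v.adicCompletion ℚ), h • c₁ = c₁)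
      (hc₂ : ∀ h ∈ localSubgroup (κ.layerSubgroup n) (v.adicCompletion ℚ), h • c₂ = c₂)
      (hc₃ : ∀ h ∈ localSubgroup (κ.layerSubgroup n) (v.adicCompletion ℚ), h • c₃ = c₃) ↦
    exists_norm_rel_of_three hκ v hv n ht ht0 (hile hτ₀) hτ₀t c₁ c₂ c₃ h1 h2 h3 hc₁ hc₂ hc₃
  -- the coinvariants `M_∞/(g-1)M_∞`
  set P := localPoints W (v.adicCompletion ℚ) with hP
  set M : AddSubgroup P :=
    FixedPoints.addSubgroup (localSubgroup κ.kerSubgroup (v.adicCompletion ℚ)) P with hM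
  have memM : ∀ {a : P}, a ∈ M ↔ ∀ h ∈ localSubgroup κ.kerSubgroup (v.adicCompletion ℚ), h • a = a := fun {a} ↦ by
    rw [hM, FixedPoints.mem_addSubgroup]
    exact ⟨fun H h hh ↦ H ⟨h, hh⟩, fun H h ↦ H h h.2⟩
  set d : M →+ M := subOne (localSubgroup κ.kerSubgroup (v.adicCompletion ℚ)) P g with hd
  -- every `2^k`-torsion class has a representative `Ψ x`, `x ∈ T`, with `x^{2^k} = Q^j · gz/z`, `z ∈ T`
  have hrep : ∀ y : {y : M ⧸ d.range // 2 ^ k • y = 0},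
      ∃ (x z : (AlgebraicClosure (v.adicCompletion ℚ))ˣ) (a j jz : ℤ) (m : M),
        (m : M ⧸ d.range) = y.1 ∧ (m : P) = Ψ (Additive.ofMul x) ∧
        (∀ h ∈ localSubgroup κ.kerSubgroup (v.adicCompletion ℚ), h • t = t →
          h • (x : AlgebraicClosure (v.adicCompletion ℚ)) = x) ∧
        τ₀ • (x : AlgebraicClosure (v.adicCompletion ℚ)) * x = Q ^ a ∧
        (∀ h ∈ localSubgroup κ.kerSubgroup (v.adicCompletion ℚ), h • t = t →
          h • (z : AlgebraicClosure (v.adicCompletion ℚ)) = z) ∧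
        τ₀ • (z : AlgebraicClosure (v.adicCompletion ℚ)) * z = Q ^ jz ∧
        (x : AlgebraicClosure (v.adicCompletion ℚ)) ^ 2 ^ k =
          Q ^ j * (g • (z : AlgebraicClosure (v.adicCompletion ℚ)) / z) := by
    rintro ⟨y, hy⟩
    obtain ⟨m, rfl⟩ := QuotientAddGroup.mk_surjective y
    obtain ⟨x, hxm, hxL, a, hxa⟩ := exists_unit_of_mem_fixedPoints (κ := κ) v hsurj hker hequiv' hQfix hQ0 hQtor hne
      hτ₀ hτ₀t (memM.mp m.2)
    -- `2^k m ∈ (g-1) M_∞`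
    have h2m : (2 ^ k • m : M) ∈ d.range := by
      rw [← QuotientAddGroup.eq_zero_iff]
      exact hy
    obtain ⟨w, hw⟩ := h2m
    obtain ⟨z, hzm, hzL, jz, hzj⟩ := exists_unit_of_mem_fixedPoints (κ := κ) v hsurj hker hequiv' hQfix hQ0 hQtor hne
      hτ₀ hτ₀t (memM.mp w.2)
    -- `Ψ (x^{2^k}) = Ψ (gz / z)`
    set gz : (AlgebraicClosure (v.adicCompletion ℚ))ˣ :=
      Units.mk0 (g • (z : AlgebraicClosure (v.adicCompletion ℚ))) ((smul_ne_zero_iff_ne g).mpr z.ne_zero) with hgz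
    have hgΨ : g • Ψ (Additive.ofMul z) = Ψ (Additive.ofMul gz) := by
      have h1 := hequiv' g z gz rfl
      rw [if_pos hgt, one_zsmul] at h1
      exact h1
    have h3 : Ψ (Additive.ofMul (x ^ 2 ^ k)) = Ψ (Additive.ofMul (gz * z⁻¹)) := by
      rw [ofMul_pow, map_nsmul, hxm, ofMul_mul, ofMul_inv, map_add, map_neg, ← hgΨ, hzm, ← sub_eq_add_neg]
      have h4 := congrArg (fun b : M ↦ (b : P)) hw
      simp only [hd, AddSubgroupClass.coe_nsmul] at h4
      exact h4.symm
    rw [tatePsi_eq_iff v hker] at h3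
    obtain ⟨j, hj⟩ := h3
    refine ⟨x, z, a, j, jz, m, rfl, hxm.symm, hxL, hxa, hzL, hzj, ?_⟩
    rw [Units.val_pow_eq_pow_val] at hj
    rw [hj, Units.val_mul, Units.val_inv_eq_inv_val, hgz, Units.val_mk0, div_eq_mul_inv]
  choose x z a j jz m hmy hmx hxL hxa hzL hzj hxk using hrep
  -- among five `2^k`-torsion classes two coincide
  have key5 : ∀ ys : Fin 5 → {y : M ⧸ d.range // 2 ^ k • y = 0}, ∃ i i' : Fin 5, i ≠ i' ∧ ys i = ys i' := by
    intro ys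
    obtain ⟨i, i', hii', cc, w, hw0, hwL, ⟨jw, hwj⟩, hrel⟩ :=
      exists_div_eq_zpow_mul_coboundary_of_five_pow (κ := κ) v n hug hgn ht hgt hτ₀ hτ₀t hQfix hQ0 hQtor hN2 k
        (x := fun i ↦ (x (ys i) : AlgebraicClosure (v.adicCompletion ℚ)))
        (z := fun i ↦ (z (ys i) : AlgebraicClosure (v.adicCompletion ℚ)))
        (a := fun i ↦ a (ys i)) (j := fun i ↦ j (ys i)) (jz := fun i ↦ jz (ys i))
        (fun i ↦ (x (ys i)).ne_zero) (fun i ↦ hxL (ys i)) (fun i ↦ hxa (ys i)) (fun i ↦ (z (ys i)).ne_zero)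
        (fun i ↦ hzL (ys i)) (fun i ↦ hzj (ys i)) (fun i ↦ hxk (ys i))
    refine ⟨i, i', hii', ?_⟩
    -- `Ψ (x i) - Ψ (x i') = (g - 1) Ψ(w)` with `Ψ w ∈ M_∞`
    set wu : (AlgebraicClosure (v.adicCompletion ℚ))ˣ := Units.mk0 w hw0 with hwu
    have hwM : Ψ (Additive.ofMul wu) ∈ M :=
      memM.mpr (apply_mem_fixedPoints (κ := κ) v hker hequiv' ht hne hτ₀ hτ₀t (x := wu)
        (fun h hh hht ↦ by rw [hwu, Units.val_mk0]; exact hwL h hh hht) (a := jw) (by rw [hwu, Units.val_mk0]; exact hwj))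
    set gw : (AlgebraicClosure (v.adicCompletion ℚ))ˣ :=
      Units.mk0 (g • w) ((smul_ne_zero_iff_ne g).mpr hw0) with hgw
    have hgΨ : g • Ψ (Additive.ofMul wu) = Ψ (Additive.ofMul gw) := by
      have h1 := hequiv' g wu gw (by rw [hgw, hwu, Units.val_mk0, Units.val_mk0])
      rw [if_pos hgt, one_zsmul] at h1
      exact h1
    have hdP : (d ⟨Ψ (Additive.ofMul wu), hwM⟩ : P) = g • Ψ (Additive.ofMul wu) - Ψ (Additive.ofMul wu) := rfl
    have hdiff : Ψ (Additive.ofMul (x (ys i))) - Ψ (Additive.ofMul (x (ys i'))) =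
        (d ⟨Ψ (Additive.ofMul wu), hwM⟩ : P) := by
      rw [hdP, hgΨ]
      have e1 : Ψ (Additive.ofMul (x (ys i))) - Ψ (Additive.ofMul (x (ys i'))) =
          Ψ (Additive.ofMul (x (ys i) * (x (ys i'))⁻¹)) := by
        rw [ofMul_mul, ofMul_inv, map_add, map_neg, sub_eq_add_neg]
      have e2 : Ψ (Additive.ofMul gw) - Ψ (Additive.ofMul wu) = Ψ (Additive.ofMul (gw * wu⁻¹)) := by
        rw [ofMul_mul, ofMul_inv, map_add, map_neg, sub_eq_add_neg]
      rw [e1, e2, tatePsi_eq_iff v hker]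
      refine ⟨cc, ?_⟩
      rw [Units.val_mul, Units.val_inv_eq_inv_val, Units.val_mul, Units.val_inv_eq_inv_val, hgw, hwu, Units.val_mk0,
        Units.val_mk0, ← div_eq_mul_inv, hrel, div_eq_mul_inv]
    have hmm : (m (ys i) : M ⧸ d.range) = m (ys i') := by
      rw [QuotientAddGroup.eq_iff_sub_mem]
      refine ⟨⟨Ψ (Additive.ofMul wu), hwM⟩, Subtype.ext ?_⟩
      rw [AddSubgroupClass.coe_sub, hmx, hmx]
      exact hdiff.symm
    exact Subtype.ext (by rw [← hmy (ys i), ← hmy (ys i'), hmm])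
  -- hence the `2^k`-torsion of the coinvariants is finite of order `≤ 4`
  haveI hfin : Finite {y : M ⧸ d.range // 2 ^ k • y = 0} := by
    by_contra hinf
    rw [not_finite_iff_infinite] at hinf
    let emb := Infinite.natEmbedding {y : M ⧸ d.range // 2 ^ k • y = 0}
    obtain ⟨i, i', hii', h⟩ := key5 (fun i : Fin 5 ↦ emb i)
    exact hii' (Fin.ext (emb.injective h))
  have hcard : Nat.card {y : M ⧸ d.range // 2 ^ k • y = 0} ≤ 4 := by
    by_contra hlt
    push Not at hlt
    letI := Fintype.ofFinite {y : M ⧸ d.range // 2 ^ k • y = 0}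
    rw [Nat.card_eq_fintype_card] at hlt
    let emb : Fin 5 ↪ {y : M ⧸ d.range // 2 ^ k • y = 0} :=
      (Fin.castLEEmb hlt).trans (Fintype.equivFin _).symm.toEmbedding
    obtain ⟨i, i', hii', h⟩ := key5 emb
    exact hii' (emb.injective h)
  -- BRICK 11 at `m = 2^k`
  have h11 := finite_torsionBy_localTowerKerPrimary_and_card_le W κ (v.adicCompletion ℚ) n hgn hgen (2 ^ k)
  exact ⟨h11.1, h11.2.trans hcard⟩

/-! ### `2`-primary exhaustion: from the `2^k`-torsion bounds to the ORDER bound -/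

/-- **A `p`-primary group all of whose `p^k`-torsion subgroups have at most `C` elements has at most `C` elements** (and is
finite): any `C + 1` elements are killed by a common power `p^K`. [cite: GreenbergLNM1716, §3 (pp. 85–93)] -/
theorem finite_and_natCard_le_of_forall_torsionBy_pow {G : Type*} [AddCommGroup G] (p C : ℕ)
    (htor : ∀ x : G, ∃ k : ℕ, p ^ k • x = 0)
    (hk : ∀ k : ℕ, Finite {x : G // p ^ k • x = 0} ∧ Nat.card {x : G // p ^ k • x = 0} ≤ C) :
    Finite G ∧ Nat.card G ≤ C := by
  -- no injective family of `C + 1` elements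
  have key : ∀ f : Fin (C + 1) → G, ¬ Function.Injective f := by
    intro f hf
    choose kf hkf using fun i ↦ htor (f i)
    set K : ℕ := ∑ i, kf i with hK
    have hKf : ∀ i, p ^ K • f i = 0 := fun i ↦ by
      have hle : kf i ≤ K := by
        rw [hK]
        exact Finset.single_le_sum (f := kf) (fun j _ ↦ Nat.zero_le _) (Finset.mem_univ i)
      obtain ⟨e, he⟩ := Nat.exists_eq_add_of_le hle
      rw [he, pow_add, mul_comm, mul_smul, hkf, smul_zero]
    obtain ⟨hfinK, hcardK⟩ := hk K
    let f' : Fin (C + 1) → {x : G // p ^ K • x = 0} := fun i ↦ ⟨f i, hKf i⟩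
    have hf' : Function.Injective f' := fun i i' h ↦ hf (congrArg Subtype.val h)
    have hle := Nat.card_le_card_of_injective f' hf'
    rw [Nat.card_eq_fintype_card, Fintype.card_fin] at hle
    omega
  haveI hfin : Finite G := by
    by_contra hinf
    rw [not_finite_iff_infinite] at hinf
    let emb := Infinite.natEmbedding G
    exact key (fun i : Fin (C + 1) ↦ emb i) fun i i' h ↦ Fin.ext (emb.injective h)
  refine ⟨hfin, ?_⟩
  by_contra hlt
  push Not at hlt
  letI := Fintype.ofFinite G
  rw [Nat.card_eq_fintype_card] at hlt
  let emb : Fin (C + 1) ↪ G := (Fin.castLEEmb hlt).trans (Fintype.equivFin _).symm.toEmbedding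
  exact key emb emb.injective

/-- **`𝒦_{v,n}[2^∞]` is FINITE OF ORDER `≤ 4` at EVERY non-split multiplicative `2`, every layer — KERNEL theorem.** For a
globally minimal `W/ℚ`, multiplicative and NON-SPLIT at `2`, every cyclotomic `ℤ₂`-datum `κ`, the place `v ∋ 2` and every
layer `n`: `Finite (W.localTowerKerPrimary κ ℚ_v n)` and `Nat.card ≤ 4`. This is Greenberg's `|ker(r_{v_n})| ∼ 2c_v ≤ 4`
(LNM 1716 p. 93) over `ℚ` — the `2^k`-torsion bounds `powTorsion_localTowerKerPrimary_le_four_nonsplitTwo` for every `k`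
and `2`-primary exhaustion (`𝒦_{v,n}[2^∞]` is `2`-primary by definition). [cite: GreenbergLNM1716, §3 (pp. 85–93)]
[cite: SilvermanATAEC1994, Thm. V.5.3, Lemma V.5.2 (c)] [cite: NeukirchANT1999, Ch. V §1 Thm. (1.1)] -/
theorem finite_and_natCard_localTowerKerPrimary_le_four_nonsplitTwo (W : WeierstrassCurve ℚ) [W.IsElliptic]
    [W.IsGloballyMinimal] (hmult : W.HasMultiplicativeReductionAtPrime 2)
    (hns : ¬ W.HasSplitMultiplicativeReductionAtPrime 2) (hκ : κ.IsCyclotomic) (v : HeightOneSpectrum (𝓞 ℚ))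
    (hv : ((2 : ℕ) : 𝓞 ℚ) ∈ v.asIdeal) (n : ℕ) :
    Finite (W.localTowerKerPrimary κ (v.adicCompletion ℚ) n) ∧
      Nat.card (W.localTowerKerPrimary κ (v.adicCompletion ℚ) n) ≤ 4 := by
  refine finite_and_natCard_le_of_forall_torsionBy_pow 2 4 (fun x ↦ ?_)
    (fun k ↦ powTorsion_localTowerKerPrimary_le_four_nonsplitTwo W hmult hns hκ v hv n k)
  obtain ⟨-, k, hk⟩ := (W.mem_localTowerKerPrimary_iff κ (v.adicCompletion ℚ) n x.1).mp x.2
  exact ⟨k, Subtype.ext (by rw [AddSubgroupClass.coe_nsmul, hk]; rfl)⟩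

/-! ### The named fact `hNS2`, PROVED -/

/-- **Greenberg, LNM 1716 (1999), §3, PDF p. 93 — NON-SPLIT multiplicative `v ∣ 2`, every layer, case `F = ℚ`: the named
fact `sec3_natCard_localTowerKerPrimary_le_four_nonsplitMultiplicative_two` (PRINT binder `hNS2` of the NON-SPLIT tower doors
of item 19922) HOLDS** — for every globally minimal `W/ℚ` multiplicative but not split multiplicative at `2`, every
cyclotomic `ℤ₂`-extension `κ`, the place `v ∋ 2` and every `n`, `𝒦_{v,n}[2^∞] = ker(r_{v_n})` is finite of order `≤ 4`
("`|ker(r_v)| ∼ 2c_v`", `c_v ∈ {1, 2}`). Signature verbatim; by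
`MultTowerNS2.finite_and_natCard_localTowerKerPrimary_le_four_nonsplitTwo` (twisted Tate module over the local cyclotomic
`ℤ₂`-tower, cyclic Hilbert 90, the class field axiom for the unramified quadratic layer — all kernel theorems). Consumers keep
the hypothesis `(hNS2 : …)` and may pass this term; nothing is re-keyed here. BSD is not proved by this.
[cite: GreenbergLNM1716, §3, between Prop. 3.6 and Prop. 3.7 (PDF p. 93)] [cite: SilvermanAEC2009, C.15 Table 15.1 and VII.5.4] -/
theorem _root_.Literature.NumberTheory.EllipticCurves.Greenberg1999.sec3_natCard_localTowerKerPrimary_le_four_nonsplitMultiplicative_two_holds :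
    Greenberg1999.sec3_natCard_localTowerKerPrimary_le_four_nonsplitMultiplicative_two :=
  fun W _ _ hmult hns _κ hκ v hv n ↦
    finite_and_natCard_localTowerKerPrimary_le_four_nonsplitTwo W hmult hns hκ v hv n

end Literature.NumberTheory.EllipticCurves.Greenberg1999.MultTowerNS2

end Part22

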